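import Mathlib
import Literature.NumberTheory.Sieve.GoldbachSieveConstantEight
import Literature.NumberTheory.Sieve.GoldbachLinnikPairCounts
import Literature.Analysis.SpecialFunctions.EulerMascheroniBounds
import HarnessLib

/-!
# The two-residue Selberg/large-sieve sum made EXPLICIT, and an explicit uniform upper-bound pair sieve

Topic `Literature/NumberTheory/Sieve`; a companion of `GoldbachSieveConstantEight.lean` (Bateman–Diamond,
*Analytic Number Theory*, §13.4–§13.5: the uniform two-residue sieve estimate, Theorem 13.8, by Montgomery's
large sieve).  That file proves, for every `N, X ≥ 1` and every even shift `ak`, the arithmetic large-sieve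
inequality

  `#{p ≤ N : p, ap+k prime} · Q_∅(X) ≤ (X² + N − 1)·∏_{p ∣ ak, p>2}(p−1)/(p−2) + (X+1)·Q_∅(X)`

(`GoldbachSieveEight.card_primePairs_mul_Qsum_le`, (13.13)–(13.14)) and `Q_∅(X) ≥ T(X) := ∑_{n ≤ X} f̃(n)`
(`sum_ft_le_Qsum`, the first half of Lemma 13.11), but it has `T(X)` only as a LIMIT
(`tendsto_sum_ft_div_log_sq`: `T(X)/log²X → 1/(4C₂)` — Lemma 13.11 in liminf form), so every uniform
pair-sieve constant obtained from it is `8 + ε` times Hardy–Littlewood with an INEFFECTIVE threshold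
(`card_primePairs_le_uniform`).  This file supplies the missing EXPLICIT lower bound for `T(X)` and the
resulting explicit, everywhere-uniform pair sieve (an explicit weak form of Theorem 13.8: constant `20.8·f`
in place of `(16 + o(1))·C₂·f = (10.56 + o(1))·f`, valid for all `N ≥ e^{47}`):

* §1–§2  odd harmonic sums (private): `H_odd(Y) ≥ ½ log(Y+1)`, `∑_{u ≤ Y odd} log u/u ≤ ¼ log²Y + 16/15`,
  and the odd divisor sum `D_odd(Y) = ∑_{u odd} H_odd(Y/u)/u ≥ ⅛ log²y − 8/15` (`Y = ⌊y⌋`);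
* §3     `f̃(m) ≥ τ(m)/m` for odd `m` (from `2^{Ω(m)} ≥ τ(m)`), hence `∑_{m ≤ Y odd} f̃(m) ≥ D_odd(Y)`;
* §4     dyadic assembly: **`T(X) ≥ (255/1024) log²X − (247/512)·log 2·log X − 17/16`** for `X ≥ 128`
  (`sum_ft_ge_explicit`, `Qsum_ge_explicit`) — about `0.66 ×` the true asymptotic `log²X/(4C₂)`;
* §5     the explicit large-sieve step `explicit_of_largeSieve` (any count obeying the Bateman–Diamond
  inequality at `X = ⌊√N⌋/4` is `≤ 20.8·F·N/log²N` for `N ≥ e^{47}`) and its three instances: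
  **`primePairs_le_explicit`** (`#{p ≤ N : p, ap+k prime} ≤ 20.8·f(ak)·N/log²N`, `ak` even),
  **`pairCount_le_explicit`** (`#{p ≤ N : p + h prime} ≤ 20.8·f(h)·N/log²N`, `h ≠ 0` even) and
  **`goldbachCount_le_explicit`** (`r(N) ≤ 20.8·f(N)·N/log²N`, `N` even), `f = GoldbachLinnik.oddSingularFactor`.

`pairCount_le_explicit` is literally the hypothesis `RomanoffExplicit.UniformPairSieve 20.8 (exp 47)` of
`RomanoffExplicitAllN.lean`'s `density_general` (there fed by the NAMED FACT `RieselVaughan1983_lemma5`,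
`A = 16C₂` from `e^{24}`); with this file Romanoff's theorem for all `N ≥ 4` follows from Rosser–Schoenfeld
(3.3) alone (appended to that file as `RomanoffExplicit.romanoffAllN_of_RS`, constant `1/48`).

κ-REFINEMENT (§6–§8b, appended; cell parity-ideate seat p5 g17 ROUND-22 §9(a), file
`round22/ExplicitPairSieveV2.lean` sha16 2ced36761163bac7, lines 835–1543): the squarefull convolution
`τ ∗ k̂ = 2^Ω` over the finite set `{1,9,25,27,49,81}` lifts the `log²X` coefficient `255/1024 → 0.3224`
(`sum_ft_ge_kappa`, `Qsum_ge_kappa`, `X ≥ 2^{14}`) and the constants `20.8 → 17.1` (from `e^{47}`) / `17.75` (from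
`e^{41}`): `explicit_of_largeSieve_kappa` (threshold-generic), `primePairs_le_kappa`, `pairCount_le_kappa`,
`goldbachCount_le_kappa`, and the concrete corollaries `twinPrimeCount_le_kappa` (`π₂(N) ≤ 17.1·N/log²N`,
`N ≥ e^{47}`, over the tree's `twinPrimeCount`), `twinPrimeCount_le_kappa'` (`17.75`, `N ≥ e^{41}`), `sophieGermain_le_kappa`.

κ-REFINEMENT II (§9–§9b, appended; cell parity-ideate seat p5 g19 ROUND-38 «CELLS», file
`round38/SchnirelmannCells.lean` sha16 77bda103430a02cc, its §A.2, lines 692–1117, statements and proofs verbatim): the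
squarefull set is enlarged to the 25 odd `19`-smooth squarefull numbers `≤ 2048` (`kappaSet2`, `∑ k̂(s)/s = 1.41732`,
93.6 % of `1/C₂`), the `8·25` cells bounded through three moments (`logUb2`, `Ub2`, `kappa_cell_ge2`,
`sum_ft_odd_level_ge_kappa2`, `level_ge2`), giving the cell polynomial **`TlowK2(l) = 0.3529 l² − 1.2813 l + 1.2789`**
(leading coefficient `0.3224 → 0.3529`; truth `0.3787`) and **`sum_ft_ge_kappa2`** / **`Qsum_ge_kappa2`**
(`T(X), Q_∅(X) ≥ TlowK2(log X)` for `X ≥ 2^{18}`) — the input of the Shnirel'man–Goldbach constant `47` of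
`ShnirelmanGoldbachCells.lean`.

κ-REFINEMENT III (§10–§10b, appended; cell parity-ideate seat p5 g19 ROUND-40 «CELLS-2», file
`round40/SchnirelmannCells2.lean` sha16 af991b1e0448a5be, its §A.3, lines 5249–6194, statements and proofs verbatim): the
68 odd `19`-smooth squarefull numbers `≤ 20000` (`kappaSet3`, `∑ k̂(s)/s = 1.46912`, 97.0 % of `1/C₂`; `logUb3`, `Ub3`,
`kappa_cell_ge3`, `sum_ft_odd_level_ge_kappa3`, `level_ge3`), giving **`TlowK3(l) = 0.3658 l² − 1.5193 l + 2.3407`** and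
**`sum_ft_ge_kappa3`** / **`Qsum_ge_kappa3`** (`X ≥ 2^{22}`) — the input of the unconditional Shnirel'man–Goldbach
constant `45` (`ShnirelmanGoldbachThree.lean`).

THE HARMONIC CONSTANT and κ-REFINEMENT IV (§11–§11b, appended; cell parity-ideate seat p5 g20 ROUND-42 «HARMONIC»,
file `round42/SchnirelmannHarmonic.lean` sha16 a53c05b2c3cf7829, its §B–§C, lines 1679–2191, statements and proofs
verbatim; new import `Literature.Analysis.SpecialFunctions.EulerMascheroniBounds`): §1's `Hodd_ge` keeps only `½ log(Y+1)`
of `H_odd(Y) = H(Y) − ½ H(⌊Y/2⌋)`; here the constant `(γ + log 2)/2 ≥ 0.6351` is restored from the Euler–Mascheroni envelopes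
(**`Hodd_eq_harmonic`**, **`Hodd_ge_sharp`**, `Uodd_le_sharp`, **`Dodd_ge_sharp`**: `D_odd(⌊y⌋) ≥ ⅛ log²y + 0.6351 log y − 0.47`,
vs §2's `⅛ log²y − 8/15`), and the same 68 cells of §10 then give **`TlowK4(l) = 0.3658 l² + 0.3394 l − 1.3336`** with
**`sum_ft_ge_kappa4`** / **`Qsum_ge_kappa4`** (`X ≥ 2^{22}`) — the input of the unconditional Shnirel'man–Goldbach constant `43`.

What is NOT here: no new asymptotic constant (the printed `8 + ε`, Chen's `7.8342`, and the conjectural `2`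
are untouched); no lower-bound sieve; nothing parity-related.  Provenance: cell parity-ideate, seat p5 g17
(lens «nearmiss»), ROUND-22 file `round22/ExplicitPairSieve.lean`; ported with lint-only edits (private
helpers, citations) by parity-ideate-lit g30.  No `sorry`; standard axioms only.

## References
* P. T. Bateman, H. G. Diamond, *Analytic Number Theory: An Introductory Course*, World Scientific (2004),
  §13.4 (13.13)–(13.14), Lemma 13.10, Lemma 13.11, Theorem 13.8 (pp. 325–328). [cite: BatemanDiamond2004, §13.4]
* H. Riesel, R. C. Vaughan, *On sums of primes*, Ark. Mat. 21 (1983) 45–74, Lemma 5 (the printed `h`-uniform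
  pair bound this file's §5 parallels with a proved, weaker constant). [cite: RieselVaughan1983, Lemma 5]
-/

namespace Literature.NumberTheory.Sieve

namespace TwoResidueSelbergExplicit

open Finset Real
open GoldbachSieveEight (ft Qsum sum_ft_le_Qsum card_primePairs_mul_Qsum_le)
open GoldbachLinnik (oddSingularFactor oddSingularFactor_nonneg)

/-! ## §1  Odd harmonic sums -/

/-- The odd integers in `[1, Y]`. [folklore] -/
def oddIcc (Y : ℕ) : Finset ℕ := (Icc 1 Y).filter (fun u => Odd u)

/-- Membership in `oddIcc`. [folklore] -/
private theorem mem_oddIcc {Y u : ℕ} : u ∈ oddIcc Y ↔ 1 ≤ u ∧ u ≤ Y ∧ Odd u := by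
  simp [oddIcc, and_assoc]

/-- `oddIcc Y` is the image of `j ↦ 2j+1`, `j < (Y+1)/2`. [folklore] -/
private theorem oddIcc_eq_image (Y : ℕ) :
    oddIcc Y = (range ((Y + 1) / 2)).image (fun j => 2 * j + 1) := by
  ext u
  simp only [mem_oddIcc, mem_image, mem_range]
  constructor
  · rintro ⟨h1, h2, ⟨j, rfl⟩⟩
    exact ⟨j, by omega, rfl⟩
  · rintro ⟨j, hj, rfl⟩
    exact ⟨by omega, by omega, ⟨j, rfl⟩⟩

/-- Reindex a sum over `oddIcc Y` by `u = 2j+1`. [folklore] -/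
private theorem sum_oddIcc_eq_sum_range (f : ℕ → ℝ) (Y : ℕ) :
    ∑ u ∈ oddIcc Y, f u = ∑ j ∈ range ((Y + 1) / 2), f (2 * j + 1) := by
  rw [oddIcc_eq_image, sum_image]
  intro a _ b _ h
  have : 2 * a + 1 = 2 * b + 1 := h
  omega

/-- `H_odd(Y) = ∑_{v ≤ Y, v odd} 1/v`. [folklore] -/
noncomputable def Hodd (Y : ℕ) : ℝ := ∑ v ∈ oddIcc Y, 1 / (v : ℝ)

/-- `½ (log(v+2) − log v) ≤ 1/v` for `v ≥ 1`. [folklore] -/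
private theorem half_log_diff_le_inv {v : ℝ} (hv : 1 ≤ v) :
    (1 / 2) * (Real.log (v + 2) - Real.log v) ≤ 1 / v := by
  have hv0 : 0 < v := by linarith
  have h : Real.log (v + 2) - Real.log v = Real.log ((v + 2) / v) := by
    rw [Real.log_div (by linarith) hv0.ne']
  rw [h]
  have h2 : Real.log ((v + 2) / v) ≤ (v + 2) / v - 1 := Real.log_le_sub_one_of_pos (by positivity)
  have h3 : (v + 2) / v - 1 = 2 / v := by field_simp; ring
  rw [h3] at h2
  have h4 : (1 / 2 : ℝ) * (2 / v) = 1 / v := by ring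
  linarith [mul_le_mul_of_nonneg_left h2 (by norm_num : (0:ℝ) ≤ 1 / 2)]

/-- **`H_odd(Y) ≥ ½ log(Y+1)`** (telescoping). [folklore] -/
private theorem Hodd_ge (Y : ℕ) : (1 / 2) * Real.log ((Y : ℝ) + 1) ≤ Hodd Y := by
  unfold Hodd
  rw [sum_oddIcc_eq_sum_range]
  set K := (Y + 1) / 2 with hK
  have htel : ∑ j ∈ range K,
      (1 / 2 : ℝ) * (Real.log ((2 * ((j + 1 : ℕ) : ℝ) + 1)) - Real.log (2 * (j : ℝ) + 1))
      = (1 / 2) * Real.log (2 * (K : ℝ) + 1) := by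
    rw [← mul_sum, Finset.sum_range_sub (fun j => Real.log (2 * (j : ℝ) + 1)) K]
    simp
  have hle : ∑ j ∈ range K,
      (1 / 2 : ℝ) * (Real.log ((2 * ((j + 1 : ℕ) : ℝ) + 1)) - Real.log (2 * (j : ℝ) + 1))
      ≤ ∑ j ∈ range K, 1 / (((2 * j + 1 : ℕ) : ℝ)) := by
    refine sum_le_sum fun j _ => ?_
    have hv : (1 : ℝ) ≤ 2 * (j : ℝ) + 1 := by
      have : (0:ℝ) ≤ j := Nat.cast_nonneg j
      linarith
    have := half_log_diff_le_inv hv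
    have e1 : (2 * ((j + 1 : ℕ) : ℝ) + 1) = 2 * (j : ℝ) + 1 + 2 := by push_cast; ring
    have e2 : (((2 * j + 1 : ℕ) : ℝ)) = 2 * (j : ℝ) + 1 := by push_cast; ring
    rw [e1, e2]
    exact this
  have hK1 : (Y : ℝ) + 1 ≤ 2 * (K : ℝ) + 1 := by
    have : Y + 1 ≤ 2 * K + 1 := by omega
    exact_mod_cast this
  have hlog : Real.log ((Y : ℝ) + 1) ≤ Real.log (2 * (K : ℝ) + 1) :=
    Real.log_le_log (by positivity) hK1
  calc (1 / 2) * Real.log ((Y : ℝ) + 1) ≤ (1 / 2) * Real.log (2 * (K : ℝ) + 1) := by linarith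
    _ = _ := htel.symm
    _ ≤ _ := hle

/-- `H_odd(Y) ≥ 0`. [folklore] -/
private theorem Hodd_nonneg (Y : ℕ) : 0 ≤ Hodd Y :=
  sum_nonneg fun v _ => by positivity

/-- Numerical: `log 7 > 1.6`. [folklore] -/
private theorem log_seven_gt : (1.6 : ℝ) < Real.log 7 := by
  rw [Real.lt_log_iff_exp_lt (by norm_num)]
  have h1 : Real.exp 1.6 = Real.exp 1 * Real.exp 0.6 := by
    rw [← Real.exp_add]; norm_num
  have h2 : Real.exp (0.6 : ℝ) * 0.4 ≤ 1 := by
    have h := Real.add_one_le_exp (-0.6 : ℝ)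
    have hmul : Real.exp (0.6 : ℝ) * Real.exp (-0.6) = 1 := by
      rw [← Real.exp_add]; norm_num
    nlinarith [Real.exp_pos (0.6 : ℝ)]
  rw [h1]
  nlinarith [Real.exp_one_lt_d9, Real.exp_pos (0.6 : ℝ), Real.exp_pos (1 : ℝ)]

/-- Numerical: `log 5 ≤ 2`. [folklore] -/
private theorem log_five_le : Real.log 5 ≤ 2 := by
  rw [Real.log_le_iff_le_exp (by norm_num)]
  have : Real.exp 2 = Real.exp 1 * Real.exp 1 := by rw [← Real.exp_add]; norm_num
  rw [this]
  nlinarith [Real.exp_one_gt_d9]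

/-- Numerical: `log 3 ≤ 2`. [folklore] -/
private theorem log_three_le : Real.log 3 ≤ 2 :=
  (Real.log_le_log (by norm_num) (by norm_num)).trans log_five_le

/-- The per-term telescoping bound **`log u / u ≤ ¼ (log²u − log²(u−2))`** for `u ≥ 7`
(from `−log(1−s) ≥ s + s²/2` and `log(1−s) ≥ −s/(1−s)`, `s = 2/u`, and `log u ≥ 1.6 ≥ (u+1)/(u−2)`).
[folklore] -/
private theorem log_div_le_quarter_diff {u : ℝ} (hu : 7 ≤ u) :
    Real.log u / u ≤ (1 / 4) * (Real.log u ^ 2 - Real.log (u - 2) ^ 2) := by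
  have hu0 : 0 < u := by linarith
  have hu2 : 0 < u - 2 := by linarith
  set s : ℝ := 2 / u with hs
  have hs0 : 0 < s := by positivity
  have hs1 : s < 1 := by rw [hs, div_lt_one hu0]; linarith
  have h1s : 0 < 1 - s := by linarith
  have hfac : u - 2 = u * (1 - s) := by rw [hs]; field_simp
  have hlog2 : Real.log (u - 2) = Real.log u + Real.log (1 - s) := by
    rw [hfac, Real.log_mul hu0.ne' h1s.ne']
  -- (a) −log(1−s) ≥ s + s²/2
  have ha : s + s ^ 2 / 2 ≤ -Real.log (1 - s) := by
    have hsum := Real.hasSum_pow_div_log_of_abs_lt_one (show |s| < 1 by rw [abs_of_pos hs0]; exact hs1)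
    have := sum_le_hasSum (range 2) (fun n _ => by positivity) hsum
    simp only [Finset.sum_range_succ, Finset.sum_range_zero, zero_add] at this
    norm_num at this
    linarith
  -- (b) log(1−s) ≥ −s/(1−s) = −2/(u−2)
  have hb : -(2 / (u - 2)) ≤ Real.log (1 - s) := by
    have := Real.one_sub_inv_le_log_of_pos h1s
    have heq : 1 - (1 - s)⁻¹ = -(2 / (u - 2)) := by
      rw [hs]; field_simp; ring
    linarith [heq]
  have hlogu : 1.6 < Real.log u := lt_of_lt_of_le log_seven_gt (Real.log_le_log (by norm_num) hu)
  have hD : s + s ^ 2 / 2 ≤ Real.log u - Real.log (u - 2) := by rw [hlog2]; linarith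
  have hS : 2 * Real.log u - 2 / (u - 2) ≤ Real.log u + Real.log (u - 2) := by rw [hlog2]; linarith
  have hS0 : 0 ≤ 2 * Real.log u - 2 / (u - 2) := by
    have : 2 / (u - 2) ≤ 2 / 5 := div_le_div_of_nonneg_left (by norm_num) (by norm_num) (by linarith)
    linarith
  have hfactor : Real.log u ^ 2 - Real.log (u - 2) ^ 2
      = (Real.log u - Real.log (u - 2)) * (Real.log u + Real.log (u - 2)) := by ring
  rw [hfactor]
  have hD0 : 0 ≤ Real.log u - Real.log (u - 2) := le_trans (by positivity) hD
  have hprod : (s + s ^ 2 / 2) * (2 * Real.log u - 2 / (u - 2))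
      ≤ (Real.log u - Real.log (u - 2)) * (Real.log u + Real.log (u - 2)) :=
    calc (s + s ^ 2 / 2) * (2 * Real.log u - 2 / (u - 2))
        ≤ (Real.log u - Real.log (u - 2)) * (2 * Real.log u - 2 / (u - 2)) :=
          mul_le_mul_of_nonneg_right hD hS0
      _ ≤ _ := mul_le_mul_of_nonneg_left hS hD0
  -- the key algebra: ¼ (s + s²/2)(2ℓ − 2/(u−2)) − ℓ/u = (ℓ(u−2) − (u+1)) / (u²(u−2)) ≥ 0
  have hkey : Real.log u / u ≤ (1 / 4) * ((s + s ^ 2 / 2) * (2 * Real.log u - 2 / (u - 2))) := by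
    have hnum : 0 ≤ Real.log u * (u - 2) - (u + 1) := by
      have : (u + 1) ≤ 1.6 * (u - 2) := by linarith
      nlinarith
    have heq : (1 / 4) * ((s + s ^ 2 / 2) * (2 * Real.log u - 2 / (u - 2))) - Real.log u / u
        = (Real.log u * (u - 2) - (u + 1)) / (u ^ 2 * (u - 2)) := by
      rw [hs]; field_simp; ring
    have : 0 ≤ (1 / 4) * ((s + s ^ 2 / 2) * (2 * Real.log u - 2 / (u - 2))) - Real.log u / u := by
      rw [heq]; positivity
    linarith
  linarith [hkey, hprod]

/-- `U_odd(Y) = ∑_{u ≤ Y, u odd} log u / u`. [folklore] -/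
noncomputable def Uodd (Y : ℕ) : ℝ := ∑ u ∈ oddIcc Y, Real.log u / u

/-- **`U_odd(Y) ≤ ¼ log²Y + 16/15`**. [folklore] -/
private theorem Uodd_le (Y : ℕ) : Uodd Y ≤ (1 / 4) * Real.log Y ^ 2 + 16 / 15 := by
  unfold Uodd
  rw [sum_oddIcc_eq_sum_range]
  set K := (Y + 1) / 2 with hK
  -- the summand as a function of j
  set F : ℕ → ℝ := fun j => Real.log ((2 * j + 1 : ℕ) : ℝ) / ((2 * j + 1 : ℕ) : ℝ) with hF
  change ∑ j ∈ range K, F j ≤ _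
  -- head: j < 3
  have hhead : ∀ K' ≤ 3, ∑ j ∈ range K', F j ≤ 16 / 15 := by
    intro K' hK'
    have h0 : F 0 = 0 := by simp [hF]
    have h1 : F 1 ≤ 2 / 3 := by
      simp only [hF]; norm_num
      linarith [log_three_le]
    have h2 : F 2 ≤ 2 / 5 := by
      simp only [hF]; norm_num
      linarith [log_five_le]
    interval_cases K' <;> simp [Finset.sum_range_succ] <;> linarith
  by_cases hK3 : K ≤ 3
  · have := hhead K hK3
    nlinarith [sq_nonneg (Real.log Y)]
  push Not at hK3
  -- split range K = range 3 ∪ Ico 3 K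
  have hsplit : ∑ j ∈ range K, F j = ∑ j ∈ range 3, F j + ∑ j ∈ Ico 3 K, F j := by
    rw [Finset.range_eq_Ico, Finset.range_eq_Ico]
    exact (Finset.sum_Ico_consecutive F (by norm_num : 0 ≤ 3) hK3.le).symm
  rw [hsplit]
  have htail : ∑ j ∈ Ico 3 K, F j ≤ (1 / 4) * Real.log Y ^ 2 := by
    rw [Finset.sum_Ico_eq_sum_range]
    -- telescoping majorant g i = ¼ log²(2i+5)
    set g : ℕ → ℝ := fun i => (1 / 4) * Real.log (2 * (i : ℝ) + 5) ^ 2 with hg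
    have hterm : ∀ i ∈ range (K - 3), F (3 + i) ≤ g (i + 1) - g i := by
      intro i _
      have hu : (7 : ℝ) ≤ ((2 * (3 + i) + 1 : ℕ) : ℝ) := by
        have : 7 ≤ 2 * (3 + i) + 1 := by omega
        exact_mod_cast this
      have := log_div_le_quarter_diff hu
      simp only [hF, hg]
      have e1 : (2 * ((i + 1 : ℕ) : ℝ) + 5) = ((2 * (3 + i) + 1 : ℕ) : ℝ) := by push_cast; ring
      have e2 : (2 * (i : ℝ) + 5) = ((2 * (3 + i) + 1 : ℕ) : ℝ) - 2 := by push_cast; ring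
      rw [e1, e2]
      linarith
    have htel : ∑ i ∈ range (K - 3), (g (i + 1) - g i) = g (K - 3) - g 0 :=
      Finset.sum_range_sub g (K - 3)
    have hg0 : 0 ≤ g 0 := by simp only [hg]; positivity
    have hgK : g (K - 3) ≤ (1 / 4) * Real.log Y ^ 2 := by
      simp only [hg]
      have h1 : (1 : ℝ) ≤ 2 * ((K - 3 : ℕ) : ℝ) + 5 := by
        have : (0 : ℝ) ≤ ((K - 3 : ℕ) : ℝ) := Nat.cast_nonneg _
        linarith
      have h2 : 2 * ((K - 3 : ℕ) : ℝ) + 5 ≤ (Y : ℝ) := by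
        have : 2 * (K - 3) + 5 ≤ Y := by omega
        exact_mod_cast this
      have hl0 : 0 ≤ Real.log (2 * ((K - 3 : ℕ) : ℝ) + 5) := Real.log_nonneg h1
      have hl : Real.log (2 * ((K - 3 : ℕ) : ℝ) + 5) ≤ Real.log Y :=
        Real.log_le_log (by linarith) h2
      gcongr
    calc ∑ i ∈ range (K - 3), F (3 + i) ≤ ∑ i ∈ range (K - 3), (g (i + 1) - g i) :=
          sum_le_sum hterm
      _ = g (K - 3) - g 0 := htel
      _ ≤ (1 / 4) * Real.log Y ^ 2 := by linarith
  linarith [hhead 3 le_rfl, htail]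

/-- `U_odd(Y) ≥ 0`. [folklore] -/
private theorem Uodd_nonneg (Y : ℕ) : 0 ≤ Uodd Y :=
  sum_nonneg fun u hu => by
    have h1 : (1 : ℝ) ≤ u := by exact_mod_cast (mem_oddIcc.mp hu).1
    exact div_nonneg (Real.log_nonneg h1) (by linarith)

/-! ## §2  The odd divisor sum `D_odd` -/

/-- `D_odd(Y) = ∑_{u ≤ Y odd} H_odd(⌊Y/u⌋)/u = ∑_{uv ≤ Y, u,v odd} 1/(uv)`. [folklore] -/
noncomputable def Dodd (Y : ℕ) : ℝ := ∑ u ∈ oddIcc Y, (1 / (u : ℝ)) * Hodd (Y / u)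

/-- **`D_odd(⌊y⌋) ≥ ⅛ log²y − 8/15`** for real `y ≥ 1`. [folklore] -/
private theorem Dodd_ge {y : ℝ} (hy : 1 ≤ y) :
    (1 / 8) * Real.log y ^ 2 - 8 / 15 ≤ Dodd ⌊y⌋₊ := by
  set Y := ⌊y⌋₊ with hYdef
  have hy0 : 0 < y := by linarith
  have hY1 : 1 ≤ Y := Nat.le_floor (by simpa using hy)
  have hL0 : 0 ≤ Real.log y := Real.log_nonneg hy
  -- step 1: per-term lower bound
  have h1 : ∀ u ∈ oddIcc Y,
      (1 / (u : ℝ)) * ((1 / 2) * (Real.log y - Real.log u)) ≤ (1 / (u : ℝ)) * Hodd (Y / u) := by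
    intro u hu
    obtain ⟨hu1, huY, _⟩ := mem_oddIcc.mp hu
    have hu0 : (0 : ℝ) < u := by exact_mod_cast hu1
    refine mul_le_mul_of_nonneg_left ?_ (by positivity)
    refine le_trans ?_ (Hodd_ge (Y / u))
    have hlt : y / u < ((Y / u : ℕ) : ℝ) + 1 := by
      have := Nat.lt_floor_add_one (y / u)
      rwa [Nat.floor_div_natCast] at this
    have hyu : Real.log y - Real.log u = Real.log (y / u) :=
      (Real.log_div hy0.ne' hu0.ne').symm
    rw [hyu]
    have : Real.log (y / u) ≤ Real.log (((Y / u : ℕ) : ℝ) + 1) :=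
      Real.log_le_log (by positivity) hlt.le
    linarith
  -- step 2: the minorant sums to ½ (log y · H_odd Y − U_odd Y)
  have h2 : ∑ u ∈ oddIcc Y, (1 / (u : ℝ)) * ((1 / 2) * (Real.log y - Real.log u))
      = (1 / 2) * (Real.log y * Hodd Y - Uodd Y) := by
    unfold Hodd Uodd
    rw [mul_sum, mul_sub, mul_sum, mul_sum, ← sum_sub_distrib]
    refine sum_congr rfl fun u _ => ?_
    ring
  have h3 : (1 / 2) * (Real.log y * Hodd Y - Uodd Y) ≤ Dodd Y := by
    rw [← h2]; exact sum_le_sum h1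
  -- step 3: H_odd Y ≥ ½ log y, U_odd Y ≤ ¼ log² y + 16/15
  have hH : (1 / 2) * Real.log y ≤ Hodd Y := by
    refine le_trans ?_ (Hodd_ge Y)
    have : y < (Y : ℝ) + 1 := Nat.lt_floor_add_one y
    have := Real.log_le_log hy0 this.le
    linarith
  have hU : Uodd Y ≤ (1 / 4) * Real.log y ^ 2 + 16 / 15 := by
    refine le_trans (Uodd_le Y) ?_
    have hY0 : (1 : ℝ) ≤ Y := by exact_mod_cast hY1
    have hlY : Real.log Y ≤ Real.log y := Real.log_le_log (by linarith) (Nat.floor_le hy0.le)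
    have hlY0 : 0 ≤ Real.log Y := Real.log_nonneg hY0
    gcongr
  nlinarith [hH, hU, h3, hL0]

/-! ## §3  `f̃(m) ≥ τ(m)/m` for odd `m`, and `∑_{m ≤ Y odd} f̃(m) ≥ D_odd(Y)` -/

/-- `f̃(p^j) = (ω(p)/p)^j` with `ω(2) = 1`, `ω(p) = 2` (`p` odd) — public copies of the tree's private
`ft_prime_pow`. [folklore] -/
private theorem ft_prime_pow' {p : ℕ} (hp : p.Prime) (j : ℕ) :
    ft (p ^ j) = ((if p = 2 then (1 : ℝ) else 2) / p) ^ j := by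
  rw [ft, if_neg (pow_ne_zero j hp.ne_zero), hp.factorization_pow, Finsupp.prod_single_index]
  · rw [polyRootCountMod_twinSystem hp]
    split_ifs <;> simp
  · exact pow_zero _

/-- `f̃(mn) = f̃(m) f̃(n)` (completely multiplicative; public copy). [folklore] -/
private theorem ft_mul' (m n : ℕ) : ft (m * n) = ft m * ft n := by
  rcases eq_or_ne m 0 with rfl | hm
  · simp [ft]
  rcases eq_or_ne n 0 with rfl | hn
  · simp [ft]
  simp only [ft, hm, hn, mul_eq_zero, or_self, if_false]
  rw [Nat.factorization_mul hm hn, Finsupp.prod_add_index']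
  · intro p; exact pow_zero _
  · intro p m₁ m₂; exact pow_add _ _ _

/-- `f̃ ≥ 0`. [folklore] -/
private theorem ft_nonneg' (n : ℕ) : 0 ≤ ft n := by
  unfold ft
  split_ifs
  · exact le_rfl
  · exact Finset.prod_nonneg fun p _ => pow_nonneg (div_nonneg (Nat.cast_nonneg _) (Nat.cast_nonneg _)) _

/-- `f̃(1) = 1`. [folklore] -/
private theorem ft_one' : ft 1 = 1 := by simp [ft]

/-- `f̃(2^a) = 2^{-a}`. [folklore] -/
private theorem ft_two_pow (a : ℕ) : ft (2 ^ a) = (1 / 2 : ℝ) ^ a := by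
  rw [ft_prime_pow' Nat.prime_two]; norm_num

/-- `f̃(p^j) = (2/p)^j` for an odd prime `p`. [folklore] -/
private theorem ft_odd_prime_pow {p : ℕ} (hp : p.Prime) (hp2 : p ≠ 2) (j : ℕ) :
    ft (p ^ j) = ((2 : ℝ) / p) ^ j := by
  rw [ft_prime_pow' hp, if_neg hp2]

/-- `f̃(∏ g) = ∏ f̃(g)`. [folklore] -/
private theorem ft_finset_prod {ι : Type*} [DecidableEq ι] (s : Finset ι) (g : ι → ℕ) :
    ft (∏ i ∈ s, g i) = ∏ i ∈ s, ft (g i) := by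
  induction s using Finset.induction_on with
  | empty => simp [ft_one']
  | insert a s ha ih => rw [prod_insert ha, prod_insert ha, ft_mul', ih]

/-- **`τ(m)/m ≤ f̃(m)` for odd `m`** (from `k+1 ≤ 2^k`). [folklore] -/
private theorem card_divisors_div_le_ft {m : ℕ} (hm : Odd m) : (m.divisors.card : ℝ) / m ≤ ft m := by
  have hm0 : m ≠ 0 := hm.pos.ne'
  have hfac : m.factorization.prod (fun p k => p ^ k) = m := Nat.prod_factorization_pow_eq_self hm0
  have hp2 : ∀ p ∈ m.primeFactors, p ≠ 2 := by
    rintro p hp rfl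
    exact hm.not_two_dvd_nat (Nat.dvd_of_mem_primeFactors hp)
  have hft : ft m = ∏ p ∈ m.primeFactors, ((2 : ℝ) / p) ^ (m.factorization p) := by
    conv_lhs => rw [← hfac]
    rw [Finsupp.prod, Nat.support_factorization, ft_finset_prod]
    refine prod_congr rfl fun p hp => ?_
    rw [ft_odd_prime_pow (Nat.prime_of_mem_primeFactors hp) (hp2 p hp)]
  have hcard : (m.divisors.card : ℝ) = ∏ p ∈ m.primeFactors, ((m.factorization p : ℝ) + 1) := by
    rw [Nat.card_divisors hm0]; push_cast; rfl
  have hmR : (m : ℝ) = ∏ p ∈ m.primeFactors, (p : ℝ) ^ (m.factorization p) := by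
    conv_lhs => rw [← hfac]
    rw [Finsupp.prod, Nat.support_factorization]; push_cast; rfl
  rw [hft, hcard, hmR, ← Finset.prod_div_distrib]
  refine Finset.prod_le_prod (fun p _ => by positivity) fun p hp => ?_
  have hpp := Nat.prime_of_mem_primeFactors hp
  have hp0 : (0 : ℝ) < p := by exact_mod_cast hpp.pos
  rw [div_pow]
  gcongr
  have : m.factorization p + 1 ≤ 2 ^ m.factorization p := Nat.lt_two_pow_self
  exact_mod_cast this

/-- For `u ≥ 1`: the odd `v ≤ Y/u` are the odd `v ≤ Y` with `uv ≤ Y`. [folklore] -/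
private theorem oddIcc_div_eq_filter {Y u : ℕ} (hu : 1 ≤ u) :
    oddIcc (Y / u) = (oddIcc Y).filter (fun v => u * v ≤ Y) := by
  ext v
  simp only [mem_oddIcc, mem_filter]
  constructor
  · rintro ⟨h1, h2, h3⟩
    have h4 : u * v ≤ Y := by
      rw [mul_comm]; exact (Nat.le_div_iff_mul_le (by omega)).mp h2
    exact ⟨⟨h1, le_trans (Nat.le_mul_of_pos_left v (by omega)) h4, h3⟩, h4⟩
  · rintro ⟨⟨h1, _, h3⟩, h4⟩
    exact ⟨h1, (Nat.le_div_iff_mul_le (by omega)).mpr (by rw [mul_comm]; exact h4), h3⟩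

/-- **`D_odd(Y) ≤ ∑_{m ≤ Y odd} f̃(m)`** (divisor-pair fibre count). [folklore] -/
private theorem Dodd_le_sum_ft (Y : ℕ) : Dodd Y ≤ ∑ m ∈ oddIcc Y, ft m := by
  set S : Finset (ℕ × ℕ) := ((oddIcc Y) ×ˢ (oddIcc Y)).filter (fun x => x.1 * x.2 ≤ Y) with hS
  have hD : Dodd Y = ∑ x ∈ S, 1 / ((x.1 : ℝ) * x.2) := by
    unfold Dodd Hodd
    rw [hS, sum_filter, sum_product]
    refine sum_congr rfl fun u hu => ?_
    obtain ⟨hu1, _, _⟩ := mem_oddIcc.mp hu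
    rw [mul_sum, oddIcc_div_eq_filter hu1, sum_filter]
    refine sum_congr rfl fun v _ => ?_
    split_ifs
    · ring
    · rfl
  rw [hD]
  have hmaps : ∀ x ∈ S, x.1 * x.2 ∈ oddIcc Y := by
    intro x hx
    rw [hS, mem_filter, mem_product] at hx
    obtain ⟨⟨h1, h2⟩, h3⟩ := hx
    rw [mem_oddIcc] at h1 h2 ⊢
    exact ⟨Nat.one_le_iff_ne_zero.mpr (Nat.mul_ne_zero (by omega) (by omega)), h3, h1.2.2.mul h2.2.2⟩
  rw [← sum_fiberwise_of_maps_to hmaps]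
  refine sum_le_sum fun m hm => ?_
  obtain ⟨hm1, _, hmo⟩ := mem_oddIcc.mp hm
  have hm0 : (0 : ℝ) < m := by exact_mod_cast hm1
  have hconst : ∀ x ∈ S.filter (fun x => x.1 * x.2 = m), 1 / ((x.1 : ℝ) * x.2) = 1 / (m : ℝ) := by
    intro x hx
    rw [mem_filter] at hx
    rw [← Nat.cast_mul, hx.2]
  rw [sum_congr rfl hconst, sum_const, nsmul_eq_mul]
  have hcard : ((S.filter (fun x => x.1 * x.2 = m)).card : ℝ) ≤ (m.divisors.card : ℝ) := by
    have h := Finset.card_le_card_of_injOn (s := S.filter (fun x => x.1 * x.2 = m))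
      (t := m.divisors) (fun x => x.1) ?_ ?_
    · exact_mod_cast h
    · intro x hx
      have hx' := Finset.mem_coe.mp hx
      rw [mem_filter] at hx'
      simp only [Finset.mem_coe, Nat.mem_divisors]
      exact ⟨Dvd.intro _ hx'.2, by omega⟩
    · intro x hx x' hx' h
      have hx1 := Finset.mem_coe.mp hx
      have hx2 := Finset.mem_coe.mp hx'
      rw [mem_filter] at hx1 hx2
      have hpos : 0 < x.1 := by
        have := (mem_product.mp (mem_filter.mp hx1.1).1).1
        exact (mem_oddIcc.mp this).1
      have heq : x.1 * x.2 = x.1 * x'.2 := by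
        have h' : x.1 = x'.1 := h
        rw [hx1.2, h', hx2.2]
      exact Prod.ext h (Nat.eq_of_mul_eq_mul_left hpos heq)
  calc ((S.filter _).card : ℝ) * (1 / (m : ℝ)) ≤ (m.divisors.card : ℝ) * (1 / (m : ℝ)) := by
        gcongr
    _ = (m.divisors.card : ℝ) / m := by ring
    _ ≤ ft m := card_divisors_div_le_ft hmo

/-! ## §4  Dyadic assembly: the explicit lower bound for `T(X) = ∑_{n ≤ X} f̃(n)` -/

/-- `2^a m = 2^b m'` with `m, m'` odd forces `a = b` and `m = m'`. [folklore] -/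
private theorem two_pow_mul_odd_inj {a b m m' : ℕ} (hm : Odd m) (hm' : Odd m')
    (h : 2 ^ a * m = 2 ^ b * m') : a = b ∧ m = m' := by
  have key : ∀ {a m : ℕ}, Odd m → (2 ^ a * m).factorization 2 = a := by
    intro a m hm
    rw [Nat.factorization_mul (pow_ne_zero _ two_ne_zero) hm.pos.ne', Finsupp.add_apply,
      Nat.Prime.factorization_pow Nat.prime_two, Finsupp.single_eq_same,
      Nat.factorization_eq_zero_of_not_dvd hm.not_two_dvd_nat, add_zero]
  have hab : a = b := by
    have h1 := key (a := a) hm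
    rw [h, key hm'] at h1
    exact h1.symm
  subst hab
  exact ⟨rfl, Nat.eq_of_mul_eq_mul_left (by positivity) h⟩

/-- **Dyadic decomposition**: `∑_{a ≤ A} 2^{-a} ∑_{m ≤ X/2^a odd} f̃(m) ≤ ∑_{n ≤ X} f̃(n)`
(injectivity of `(a, m) ↦ 2^a m`). [folklore] -/
private theorem sum_ft_ge_dyadic (X A : ℕ) :
    ∑ a ∈ range (A + 1), (1 / 2 : ℝ) ^ a * ∑ m ∈ oddIcc (X / 2 ^ a), ft m
      ≤ ∑ n ∈ Icc 1 X, ft n := by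
  set S : Finset (ℕ × ℕ) := ((range (A + 1)) ×ˢ (oddIcc X)).filter (fun x => 2 ^ x.1 * x.2 ≤ X)
    with hS
  have hL : ∑ a ∈ range (A + 1), (1 / 2 : ℝ) ^ a * ∑ m ∈ oddIcc (X / 2 ^ a), ft m
      = ∑ x ∈ S, ft (2 ^ x.1 * x.2) := by
    rw [hS, sum_filter, sum_product]
    refine sum_congr rfl fun a _ => ?_
    rw [mul_sum, oddIcc_div_eq_filter (Nat.one_le_two_pow), sum_filter]
    refine sum_congr rfl fun m _ => ?_
    split_ifs
    · rw [ft_mul', ft_two_pow]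
    · rfl
  rw [hL]
  have hinj : Set.InjOn (fun x : ℕ × ℕ => 2 ^ x.1 * x.2) S := by
    intro x hx x' hx' h
    have hx1 := mem_filter.mp (Finset.mem_coe.mp hx)
    have hx2 := mem_filter.mp (Finset.mem_coe.mp hx')
    have ho : Odd x.2 := (mem_oddIcc.mp (mem_product.mp hx1.1).2).2.2
    have ho' : Odd x'.2 := (mem_oddIcc.mp (mem_product.mp hx2.1).2).2.2
    obtain ⟨h1, h2⟩ := two_pow_mul_odd_inj ho ho' h
    exact Prod.ext h1 h2
  rw [← sum_image hinj]
  refine sum_le_sum_of_subset_of_nonneg ?_ (fun n _ _ => ft_nonneg' n)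
  intro n hn
  rw [mem_image] at hn
  obtain ⟨x, hx, rfl⟩ := hn
  have hx1 := mem_filter.mp hx
  have hm := mem_oddIcc.mp (mem_product.mp hx1.1).2
  rw [mem_Icc]
  exact ⟨Nat.one_le_iff_ne_zero.mpr (Nat.mul_ne_zero (by positivity) (by omega)), hx1.2⟩

/-- The dyadic level bound: for `2^a ≤ X`,
`∑_{m ≤ X/2^a odd} f̃(m) ≥ ⅛ (log X − a log 2)² − 8/15`. [folklore] -/
private theorem sum_ft_odd_level_ge {X a : ℕ} (ha : 2 ^ a ≤ X) :
    (1 / 8) * (Real.log X - a * Real.log 2) ^ 2 - 8 / 15 ≤ ∑ m ∈ oddIcc (X / 2 ^ a), ft m := by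
  refine le_trans ?_ (Dodd_le_sum_ft _)
  have hX0 : (0 : ℝ) < X := by
    have : 0 < X := lt_of_lt_of_le (by positivity) ha
    exact_mod_cast this
  have hy : (1 : ℝ) ≤ (X : ℝ) / (2 : ℝ) ^ a := by
    rw [le_div_iff₀ (by positivity), one_mul]
    exact_mod_cast ha
  have h := Dodd_ge hy
  have hfloor : ⌊(X : ℝ) / (2 : ℝ) ^ a⌋₊ = X / 2 ^ a := by
    rw [show ((2 : ℝ) ^ a) = ((2 ^ a : ℕ) : ℝ) by push_cast; ring, Nat.floor_div_eq_div]
  have hlog : Real.log ((X : ℝ) / (2 : ℝ) ^ a) = Real.log X - a * Real.log 2 := by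
    rw [Real.log_div hX0.ne' (by positivity), Real.log_pow]
  rw [hfloor, hlog] at h
  exact h

/-- **EXPLICIT TWO-RESIDUE SELBERG SUM**: for `X ≥ 128`,
`T(X) = ∑_{n ≤ X} f̃(n) ≥ (255/1024) log²X − (247/512) log 2 · log X − 17/16` (`f̃` the completely multiplicative
function with `f̃(2) = ½`, `f̃(p) = 2/p`; Bateman–Diamond's Lemma 13.11 gives `¼∏_{p>2}(1+1/(p(p−2)))·log²X + O(log X)`
for the squarefree majorant — an explicit weaker lower bound is proved here by odd divisor sums and a dyadic split).
[cite: BatemanDiamond2004, Lemma 13.11, p. 327 (explicit weaker lower bound proved here)] -/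
theorem sum_ft_ge_explicit {X : ℕ} (hX : 128 ≤ X) :
    (255 / 1024) * Real.log X ^ 2 - (247 / 512) * Real.log 2 * Real.log X - 17 / 16
      ≤ ∑ n ∈ Icc 1 X, ft n := by
  refine le_trans ?_ (sum_ft_ge_dyadic X 7)
  have hlev : ∀ a ∈ range 8, (1 / 2 : ℝ) ^ a * ((1 / 8) * (Real.log X - a * Real.log 2) ^ 2 - 8 / 15)
      ≤ (1 / 2 : ℝ) ^ a * ∑ m ∈ oddIcc (X / 2 ^ a), ft m := by
    intro a ha
    have ha7 : a ≤ 7 := by rw [mem_range] at ha; omega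
    refine mul_le_mul_of_nonneg_left (sum_ft_odd_level_ge ?_) (by positivity)
    calc 2 ^ a ≤ 2 ^ 7 := Nat.pow_le_pow_right (by norm_num) ha7
      _ ≤ X := by norm_num; omega
  refine le_trans ?_ (sum_le_sum hlev)
  simp only [Finset.sum_range_succ, Finset.sum_range_zero]
  norm_num
  nlinarith [sq_nonneg (Real.log 2), sq_nonneg (Real.log X)]

/-- The same bound for the tree's `Ioc` form, chained with `sum_ft_le_Qsum` (Lemma 13.11, first half):
**`Q_∅(X) ≥ (255/1024) log²X − (247/512) log 2·log X − 17/16`** for `X ≥ 128`.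
[cite: BatemanDiamond2004, Lemma 13.11, p. 327 (explicit weaker lower bound proved here)] -/
theorem Qsum_ge_explicit {X : ℕ} (hX : 128 ≤ X) :
    (255 / 1024) * Real.log X ^ 2 - (247 / 512) * Real.log 2 * Real.log X - 17 / 16
      ≤ Qsum ∅ X := by
  have h := sum_ft_ge_explicit hX
  have hI : Ioc 0 X = Icc 1 X := rfl
  have h2 := sum_ft_le_Qsum X
  rw [hI] at h2
  linarith


/-! ## §5  The PROVED explicit uniform pair sieve -/

/-- `f(n) ≥ 1`. [folklore] -/
private theorem one_le_oddSingularFactor (n : ℕ) : 1 ≤ oddSingularFactor n := by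
  unfold oddSingularFactor
  have h : ∏ _p ∈ n.primeFactors.filter (2 < ·), (1 : ℝ)
      ≤ ∏ p ∈ n.primeFactors.filter (2 < ·), (((p : ℝ) - 1) / ((p : ℝ) - 2)) := by
    refine Finset.prod_le_prod (fun _ _ => zero_le_one) fun p hp => ?_
    rw [Finset.mem_filter] at hp
    have hp3 : (3 : ℝ) ≤ p := by exact_mod_cast hp.2
    rw [le_div_iff₀ (by linarith)]
    linarith
  simpa using h

/-- Numerical: `exp 1.38632 ≥ 4.0001` (i.e. `log 4.0001 ≤ 1.38632`). [folklore] -/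
private theorem exp_138632_ge : (4.0001 : ℝ) ≤ Real.exp 1.38632 := by
  have hl2 : (2 : ℝ) ≤ Real.exp 0.6931471808 := by
    have h1 := Real.exp_log (show (0:ℝ) < 2 by norm_num)
    have h2 := Real.exp_le_exp.mpr Real.log_two_lt_d9.le
    linarith
  have hsmall : (1.0000128192 : ℝ) ≤ Real.exp 0.0000128192 := by
    have := Real.add_one_le_exp (0.0000128192 : ℝ); linarith
  have hprod : Real.exp (1.38632 : ℝ) = (Real.exp 0.6931471808 * Real.exp 0.0000128192) ^ 2 := by
    rw [← Real.exp_add, sq, ← Real.exp_add]; norm_num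
  rw [hprod]
  have hm : (2 : ℝ) * 1.0000128192 ≤ Real.exp 0.6931471808 * Real.exp 0.0000128192 :=
    mul_le_mul hl2 hsmall (by norm_num) (Real.exp_pos _).le
  nlinarith [hm]

/-- The explicit minorant of `Q_∅` as a function of `l = log X`. [folklore] -/
noncomputable def Tlow (l : ℝ) : ℝ := (255 / 1024) * l ^ 2 - (247 / 512) * Real.log 2 * l - 17 / 16

/-- `Tlow` is increasing on `[22, ∞)`. [folklore] -/
private theorem Tlow_mono {l₁ l : ℝ} (h₁ : 22 ≤ l₁) (h : l₁ ≤ l) : Tlow l₁ ≤ Tlow l := by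
  have hlog2hi : Real.log 2 < 0.6931471808 := Real.log_two_lt_d9
  have hdiff : Tlow l - Tlow l₁ = (l - l₁) * ((255 / 1024) * (l + l₁) - (247 / 512) * Real.log 2) := by
    unfold Tlow; ring
  have h1 : 0 ≤ l - l₁ := by linarith
  have h2 : 0 ≤ (255 / 1024) * (l + l₁) - (247 / 512) * Real.log 2 := by nlinarith
  have h3 := mul_nonneg h1 h2
  rw [← hdiff] at h3
  linarith

/-- `Tlow(l₁) ≥ 113` for `l₁ ≥ 22.11`. [folklore] -/
private theorem Tlow_ge {l₁ : ℝ} (h₁ : 22.11 ≤ l₁) : 113 ≤ Tlow l₁ := by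
  have hlog2hi : Real.log 2 < 0.6931471808 := Real.log_two_lt_d9
  unfold Tlow
  have hl₁0 : (0 : ℝ) ≤ l₁ := by linarith
  have hll : Real.log 2 * l₁ ≤ 0.6931471808 * l₁ := mul_le_mul_of_nonneg_right hlog2hi.le hl₁0
  nlinarith [hll, mul_le_mul_of_nonneg_left h₁ (show (0:ℝ) ≤ l₁ - 22.11 by linarith)]

/-- The main numerical inequality: `17 L² ≤ 16 · 20.78 · Tlow(L/2 − 1.38632)` for `L ≥ 47`
(value `+123`, slope `+177`, convex at `L = 47`). [folklore] -/
private theorem main_numeric {L : ℝ} (hL : 47 ≤ L) : 17 * L ^ 2 ≤ 16 * 20.78 * Tlow (L / 2 - 1.38632) := by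
  have hlog2hi : Real.log 2 < 0.6931471808 := Real.log_two_lt_d9
  unfold Tlow
  have hl₁0 : (0 : ℝ) ≤ L / 2 - 1.38632 := by linarith
  have hll : Real.log 2 * (L / 2 - 1.38632) ≤ 0.6931471808 * (L / 2 - 1.38632) :=
    mul_le_mul_of_nonneg_right hlog2hi.le hl₁0
  nlinarith [hll, mul_self_nonneg (L - 47), mul_le_mul_of_nonneg_left hL (show (0:ℝ) ≤ L - 47 by linarith)]

/-- The boundary-term inequality: `(E/4 + 1)·L² ≤ E²/100` once `E ≥ 100 L²`, `L ≥ 47`. [folklore] -/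
private theorem tail_numeric {L E : ℝ} (hL : 47 ≤ L) (hEL : 100 * L ^ 2 ≤ E) :
    (E / 4 + 1) * L ^ 2 ≤ 0.01 * E ^ 2 := by
  have hL2 : (2209 : ℝ) ≤ L ^ 2 := by nlinarith
  have hE0 : (0 : ℝ) ≤ E := by nlinarith
  -- E² / 100 ≥ E · L² ≥ E L²/4 + L² · (3E/4) ≥ E L²/4 + L²
  have h1 : E * L ^ 2 ≤ 0.01 * E ^ 2 := by nlinarith [mul_le_mul_of_nonneg_left hEL hE0]
  nlinarith [h1, mul_nonneg hE0 (show (0:ℝ) ≤ L ^ 2 by positivity)]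

/-- `2^20 ≤ e^{47}`. [folklore] -/
private theorem two_pow_20_le_exp_47' : (2 : ℝ) ^ 20 ≤ Real.exp 47 := by
  have he : (2 : ℝ) ≤ Real.exp 1 := by have := Real.exp_one_gt_d9; linarith
  have h47 : (2 : ℝ) ^ 47 ≤ Real.exp 47 := by
    rw [show (47 : ℝ) = ((47 : ℕ) : ℝ) * 1 by norm_num, Real.exp_nat_mul]
    exact pow_le_pow_left₀ (by norm_num) he 47
  exact le_trans (by norm_num) h47

/-- The sieve parameter `X = ⌊√N⌋/4` is `≥ 256` once `N ≥ e^{47}` (crudely). [folklore] -/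
private theorem sieveX_ge {N : ℕ} (hN : Real.exp 47 ≤ (N : ℝ)) : 256 ≤ Nat.sqrt N / 4 := by
  have h20 : 2 ^ 20 ≤ N := by
    have : (2 : ℝ) ^ 20 ≤ (N : ℝ) := two_pow_20_le_exp_47'.trans hN
    exact_mod_cast this
  have hs : 1024 ≤ Nat.sqrt N := by
    rw [Nat.le_sqrt]
    calc 1024 * 1024 = 2 ^ 20 := by norm_num
      _ ≤ N := h20
  omega

set_option maxHeartbeats 400000 in
/-- **THE EXPLICIT LARGE-SIEVE STEP (generic)**: if a count `C` satisfies Bateman–Diamond's inequality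
`C · Q_∅(X) ≤ (X² + N − 1)·F + B·Q_∅(X)` ((13.13)–(13.14) with Montgomery's large sieve) at `X = ⌊√N⌋/4` with
`F ≥ 1` and boundary `B ≤ 2X + 2`, then for `N ≥ e^{47}`: `C ≤ 20.8 · F · N / log²N` (`20.78` from
`(17/16)/Tlow(L/2 − 1.38632) ≤ 20.78/L²` for `L = log N ≥ 47`, `+0.02` for the boundary term).
[cite: BatemanDiamond2004, Thm 13.8, §13.4–13.5 pp. 325–328 (explicit form of the final step, proved here)] -/
theorem explicit_of_largeSieve {N : ℕ} {C F B : ℝ} (hN : Real.exp 47 ≤ (N : ℝ)) (hF1 : 1 ≤ F)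
    (hB : B ≤ 2 * ((Nat.sqrt N / 4 : ℕ) : ℝ) + 2)
    (hBD : C * Qsum ∅ (Nat.sqrt N / 4) ≤ (((Nat.sqrt N / 4 : ℕ) : ℝ) ^ 2 + N - 1) * F
      + B * Qsum ∅ (Nat.sqrt N / 4)) :
    C ≤ 20.8 * F * (N : ℝ) / Real.log (N : ℝ) ^ 2 := by
  have hN0 : (0 : ℝ) < N := lt_of_lt_of_le (Real.exp_pos 47) hN
  set L := Real.log (N : ℝ) with hLdef
  have hL : (47 : ℝ) ≤ L := by
    have := Real.log_le_log (Real.exp_pos 47) hN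
    rwa [Real.log_exp] at this
  have hL2pos : 0 < L ^ 2 := by positivity
  -- E = √N = exp(L/2)
  set E := Real.exp (L / 2) with hEdef
  have hE0 : 0 < E := Real.exp_pos _
  have hE2 : E ^ 2 = N := by
    have : E ^ 2 = Real.exp L := by rw [hEdef, sq, ← Real.exp_add]; ring_nf
    rw [this, hLdef, Real.exp_log hN0]
  have hE6 : (L / 2) ^ 6 / 720 ≤ E := by
    have := Real.pow_div_factorial_le_exp (L / 2) (by linarith) 6
    simpa [Nat.factorial] using this
  have hL4 : (47 : ℝ) ^ 4 ≤ L ^ 4 := pow_le_pow_left₀ (by norm_num) hL 4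
  have hEL : 100 * L ^ 2 ≤ E := by
    have h1 : (47 : ℝ) ^ 4 * L ^ 2 ≤ L ^ 4 * L ^ 2 := mul_le_mul_of_nonneg_right hL4 (sq_nonneg L)
    nlinarith [h1, hE6]
  have hEbig : (220900 : ℝ) ≤ E := by
    have : (47 : ℝ) * 47 ≤ L * L := mul_le_mul hL hL (by norm_num) (by linarith)
    nlinarith [hEL, this]
  -- s = ⌊√N⌋, X = s / 4
  set s := Nat.sqrt N with hsdef
  set X := s / 4 with hXdef
  have hs2 : (s : ℝ) ^ 2 ≤ N := by exact_mod_cast Nat.sqrt_le' N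
  have hs2' : (N : ℝ) < ((s : ℝ) + 1) ^ 2 := by exact_mod_cast Nat.lt_succ_sqrt' N
  have hsE : (s : ℝ) ≤ E := by
    have : (s : ℝ) ^ 2 ≤ E ^ 2 := by rw [hE2]; exact hs2
    exact (pow_le_pow_iff_left₀ (Nat.cast_nonneg s) hE0.le two_ne_zero).mp this
  have hEs : E < (s : ℝ) + 1 := by
    have : E ^ 2 < ((s : ℝ) + 1) ^ 2 := by rw [hE2]; exact hs2'
    exact (pow_lt_pow_iff_left₀ hE0.le (by positivity) two_ne_zero).mp this
  have hX4 : 4 * X ≤ s := Nat.mul_div_le s 4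
  have hXR : (X : ℝ) ^ 2 ≤ (N : ℝ) / 16 := by
    have h4 : 4 * (X : ℝ) ≤ s := by exact_mod_cast hX4
    have hX0 : (0 : ℝ) ≤ X := Nat.cast_nonneg X
    have : (4 * (X : ℝ)) ^ 2 ≤ (s : ℝ) ^ 2 := pow_le_pow_left₀ (by positivity) h4 2
    nlinarith [hs2, this]
  have hXlo : E / 4 - 1 < (X : ℝ) := by
    have : (s : ℝ) + 1 ≤ 4 * (X : ℝ) + 4 := by exact_mod_cast (by omega : s + 1 ≤ 4 * X + 4)
    linarith [hEs]
  have hXhi : (X : ℝ) ≤ E / 4 := by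
    have : 4 * (X : ℝ) ≤ s := by exact_mod_cast hX4
    linarith [hsE]
  have hX0 : (0 : ℝ) < X := by linarith
  have hX128 : 128 ≤ X := by
    have : (128 : ℝ) ≤ X := by linarith
    exact_mod_cast this
  -- log X ≥ l₁ := L/2 − 1.38632
  set l₁ := L / 2 - 1.38632 with hl₁def
  have hexp : Real.exp l₁ ≤ (X : ℝ) := by
    rw [hl₁def, Real.exp_sub]
    have h1 : E / Real.exp 1.38632 ≤ E / 4.0001 :=
      div_le_div_of_nonneg_left hE0.le (by norm_num) exp_138632_ge
    have h2 : E / 4.0001 ≤ E / 4 - 1 := by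
      rw [div_le_iff₀ (by norm_num)]
      linarith [hEbig]
    linarith [hXlo]
  have hl : l₁ ≤ Real.log X := by
    rw [Real.le_log_iff_exp_le hX0]; exact hexp
  have hl₁ : (22.11 : ℝ) ≤ l₁ := by rw [hl₁def]; linarith
  -- Q ≥ Tlow(log X) ≥ Tlow(l₁) ≥ 113
  set Q := Qsum ∅ X with hQdef
  have hQ : Tlow (Real.log X) ≤ Q := by
    have := Qsum_ge_explicit hX128
    unfold Tlow; exact this
  have hQT : Tlow l₁ ≤ Q := le_trans (Tlow_mono (by linarith) hl) hQ
  have hT₁ : (113 : ℝ) ≤ Tlow l₁ := Tlow_ge hl₁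
  have hQpos : 0 < Q := by linarith
  have hF0 : 0 ≤ F := le_trans zero_le_one hF1
  -- C ≤ (X² + N − 1) F / Q + B ≤ (17/16) N F / Tlow l₁ + 2X + 2
  have hC1 : C ≤ ((X : ℝ) ^ 2 + N - 1) * F / Q + B := by
    have : C * Q ≤ (((X : ℝ) ^ 2 + N - 1) * F / Q + B) * Q := by
      rw [add_mul, div_mul_cancel₀ _ hQpos.ne']
      exact hBD
    exact le_of_mul_le_mul_right this hQpos
  have hC2 : ((X : ℝ) ^ 2 + N - 1) * F / Q ≤ (17 / 16) * (N : ℝ) * F / Tlow l₁ := by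
    have hnum0 : 0 ≤ (17 / 16) * (N : ℝ) * F := by positivity
    have hnum : ((X : ℝ) ^ 2 + N - 1) * F ≤ (17 / 16) * (N : ℝ) * F := by
      apply mul_le_mul_of_nonneg_right _ hF0
      linarith [hXR]
    calc ((X : ℝ) ^ 2 + N - 1) * F / Q ≤ (17 / 16) * (N : ℝ) * F / Q :=
          div_le_div_of_nonneg_right hnum hQpos.le
      _ ≤ (17 / 16) * (N : ℝ) * F / Tlow l₁ :=
          div_le_div_of_nonneg_left hnum0 (by linarith) hQT
  -- main term: (17/16) N F / Tlow l₁ ≤ 20.78 F N / L²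
  have hmain : (17 / 16) * (N : ℝ) * F / Tlow l₁ ≤ 20.78 * F * (N : ℝ) / L ^ 2 := by
    have hkey : 17 * L ^ 2 ≤ 16 * 20.78 * Tlow l₁ := main_numeric hL
    rw [div_le_div_iff₀ (by linarith) hL2pos]
    have hNF : 0 ≤ (N : ℝ) * F / 16 := by positivity
    have h := mul_le_mul_of_nonneg_left hkey hNF
    calc (17 / 16) * (N : ℝ) * F * L ^ 2 = (N : ℝ) * F / 16 * (17 * L ^ 2) := by ring
      _ ≤ (N : ℝ) * F / 16 * (16 * 20.78 * Tlow l₁) := h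
      _ = 20.78 * F * (N : ℝ) * Tlow l₁ := by ring
  -- boundary term: B ≤ 2X + 2 ≤ E/2 + 2 ≤ 0.02 N / L² ≤ 0.02 F N / L²
  have htail : B ≤ 0.02 * F * (N : ℝ) / L ^ 2 := by
    have h2 : (E / 4 + 1) * L ^ 2 ≤ 0.01 * (N : ℝ) := by
      rw [← hE2]; exact tail_numeric hL hEL
    have h3 : 0.02 * (N : ℝ) ≤ 0.02 * F * (N : ℝ) :=
      calc 0.02 * (N : ℝ) ≤ F * (0.02 * (N : ℝ)) := le_mul_of_one_le_left (by positivity) hF1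
        _ = 0.02 * F * (N : ℝ) := by ring
    rw [le_div_iff₀ hL2pos]
    have h1 : B * L ^ 2 ≤ 2 * ((E / 4 + 1) * L ^ 2) := by
      have : B ≤ 2 * (E / 4 + 1) := by linarith only [hB, hXhi]
      nlinarith only [this, hL2pos]
    linarith only [h1, h2, h3]
  calc C ≤ ((X : ℝ) ^ 2 + N - 1) * F / Q + B := hC1
    _ ≤ (17 / 16) * (N : ℝ) * F / Tlow l₁ + B := by linarith only [hC2]
    _ ≤ 20.78 * F * (N : ℝ) / L ^ 2 + 0.02 * F * (N : ℝ) / L ^ 2 := add_le_add hmain htail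
    _ = 20.8 * F * (N : ℝ) / L ^ 2 := by ring

/-- **EXPLICIT UNIFORM PAIR SIEVE for the pairs `(p, ap + k)` (proved, no named fact)**: for
`a, k ≥ 1` with `ak` even and every `N ≥ e^{47}`,
`#{p ≤ N : p, ap + k prime} ≤ 20.8 · f(ak) · N / log²N`, `f(m) = ∏_{p ∣ m, p > 2}(p−1)/(p−2)`
(twins `a = 1, k = 2`; Sophie Germain `a = 2, k = 1`).  Bateman–Diamond Thm 13.8 has `(8+ε)𝔖 = (16+o(1))C₂f`
with an ineffective threshold (tree `card_primePairs_le_uniform`); the truth is conjecturally `2C₂ f`.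
[cite: BatemanDiamond2004, Thm 13.8, §13.4 pp. 325–326] -/
theorem primePairs_le_explicit {a k N : ℕ} (ha : 1 ≤ a) (hk : 1 ≤ k) (hak : Even (a * k))
    (hN : Real.exp 47 ≤ (N : ℝ)) :
    ((((range (N + 1)).filter (fun p => p.Prime ∧ (a * p + k).Prime)).card : ℕ) : ℝ)
      ≤ 20.8 * oddSingularFactor (a * k) * (N : ℝ) / Real.log (N : ℝ) ^ 2 := by
  have hX1 : 1 ≤ Nat.sqrt N / 4 := le_trans (by norm_num) (sieveX_ge hN)
  have hBD := card_primePairs_mul_Qsum_le a k N (Nat.sqrt N / 4) ha hk hak hX1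
  have hprod : (∏ p ∈ ((a * k).primeFactors.filter (2 < ·)), (((p : ℝ) - 1) / ((p : ℝ) - 2)))
      = oddSingularFactor (a * k) := rfl
  rw [hprod] at hBD
  exact explicit_of_largeSieve hN (one_le_oddSingularFactor _) (by linarith) hBD

/-- **EXPLICIT UNIFORM PAIR SIEVE for prime pairs `(p, p + h)`** in `RomanoffExplicit.UniformPairSieve`'s shape: for every
`N ≥ e^{47}` and every even `h ≠ 0`, `#{p ≤ N : p + h prime} ≤ 20.8 · f(h) · N / log²N`.
(= `RomanoffExplicit.UniformPairSieve 20.8 (exp 47)` of `RomanoffExplicitAllN.lean`, there fed by the NAMED FACT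
Riesel–Vaughan 1983 Lemma 5 with `16C₂ = 10.56` from `e^{24}`; here PROVED with the weaker constant.)
[cite: BatemanDiamond2004, Thm 13.8 (a = 1; explicit form proved here)] [cite: RieselVaughan1983, Lemma 5 (printed h-uniform bound; weaker constant proved here)] -/
theorem pairCount_le_explicit {N h : ℕ} (hN : Real.exp 47 ≤ (N : ℝ)) (hh : h ≠ 0) (heven : Even h) :
    ((((Nat.primesLE N).filter fun p => (p + h).Prime).card : ℕ) : ℝ)
      ≤ 20.8 * oddSingularFactor h * (N : ℝ) / Real.log (N : ℝ) ^ 2 := by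
  have hmain := primePairs_le_explicit (a := 1) (k := h) (N := N) le_rfl
    (Nat.one_le_iff_ne_zero.mpr hh) (by simpa using heven) hN
  have hcount : ((range (N + 1)).filter (fun p => p.Prime ∧ (1 * p + h).Prime)).card
      = ((Nat.primesLE N).filter fun p => (p + h).Prime).card := by
    congr 1
    ext p
    simp only [mem_filter, mem_range, Nat.mem_primesLE, one_mul, Nat.lt_succ_iff]
    tauto
  rw [hcount, one_mul] at hmain
  exact hmain

/-- **EXPLICIT SELBERG–GOLDBACH UPPER BOUND (proved)**: for every even `N ≥ e^{47}`,
`r(N) = #{p ≤ N : N − p prime} ≤ 20.8 · f(N) · N / log²N = (10.4/C₂) · 𝔖(N) N / log²N`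
(`𝔖(N) = 2C₂ f(N)`; the classical constant is `8𝔖(N)(1+o(1))`, tree `goldbachCount_le_eight_eps`-type
statements being ineffective; Chen's `7.8342`, conjecturally `2`·(HL)). [cite: BatemanDiamond2004, §13.4 (13.13)–(13.14)] -/
theorem goldbachCount_le_explicit {N : ℕ} (hN : Real.exp 47 ≤ (N : ℝ)) (heven : Even N) :
    (Literature.NumberTheory.Sieve.SingularSeries.goldbachCount N : ℝ)
      ≤ 20.8 * oddSingularFactor N * (N : ℝ) / Real.log (N : ℝ) ^ 2 := by
  have hX1 : 1 ≤ Nat.sqrt N / 4 := le_trans (by norm_num) (sieveX_ge hN)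
  have hBD := Literature.NumberTheory.Sieve.GoldbachSieveEight.goldbachCount_mul_Qsum_le N
    (Nat.sqrt N / 4) heven hX1
  have hprod : (∏ p ∈ (N.primeFactors.filter (2 < ·)), (((p : ℝ) - 1) / ((p : ℝ) - 2)))
      = oddSingularFactor N := rfl
  rw [hprod] at hBD
  exact explicit_of_largeSieve hN (one_le_oddSingularFactor _) (by linarith) hBD

/-! ## §6  The squarefull convolution `τ ∗ k̂ = 2^Ω` (κ-refinement of §3)

For odd `m`, `m·f̃(m) = 2^{Ω(m)} = ∑_{d ∣ m} k̂(d)·τ(m/d)` with `k̂` multiplicative, `k̂(p) = 0`,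
`k̂(p^j) = 2^{j-2}` (`j ≥ 2`).  Keeping only `d ∈ {1, 9, 25, 27, 49, 81}` refines §3's `f̃(m) ≥ τ(m)/m`
and lifts the coefficient of `log²X` in §4 from `255/1024 = 0.249` to `0.3224` (the full series
`∑_{s odd squarefull} k̂(s)/s = 1/C₂` would give the true `1/(4C₂) = 0.3787`). -/

/-- `c(j) = k̂(p^j)`: `c(0) = 1`, `c(1) = 0`, `c(j) = 2^{j-2}` for `j ≥ 2`. [folklore] -/
def khatCoeff (j : ℕ) : ℕ := if j = 0 then 1 else if j = 1 then 0 else 2 ^ (j - 2)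

/-- `c(j+2) = 2^j`. [folklore] -/
private theorem khatCoeff_add_two (j : ℕ) : khatCoeff (j + 2) = 2 ^ j := by
  simp [khatCoeff]

/-- The arithmetic function `n ↦ ∏_{p^j ∥ n} g(j)` (`0 ↦ 0`). [folklore] -/
def factorizationProd (g : ℕ → ℕ) : ArithmeticFunction ℕ :=
  ⟨fun n => if n = 0 then 0 else n.factorization.prod fun _ j => g j, if_pos rfl⟩

/-- Unfolding `factorizationProd` at `n ≠ 0`. [folklore] -/
private theorem factorizationProd_apply (g : ℕ → ℕ) {n : ℕ} (hn : n ≠ 0) :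
    factorizationProd g n = n.factorization.prod fun _ j => g j := by
  rw [factorizationProd, ArithmeticFunction.coe_mk, if_neg hn]

/-- `factorizationProd g (p^j) = g j` (needs `g 0 = 1`). [folklore] -/
private theorem factorizationProd_prime_pow (g : ℕ → ℕ) (hg : g 0 = 1) {p : ℕ} (hp : p.Prime) (j : ℕ) :
    factorizationProd g (p ^ j) = g j := by
  rw [factorizationProd_apply g (pow_ne_zero j hp.ne_zero), Nat.Prime.factorization_pow hp,
    Finsupp.prod_single_index hg]

/-- `n ↦ ∏_{p^j ∥ n} g(j)` is multiplicative. [folklore] -/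
private theorem isMultiplicative_factorizationProd (g : ℕ → ℕ) :
    (factorizationProd g).IsMultiplicative := by
  rw [ArithmeticFunction.IsMultiplicative.iff_ne_zero]
  refine ⟨?_, ?_⟩
  · rw [factorizationProd_apply g one_ne_zero, Nat.factorization_one, Finsupp.prod_zero_index]
  · intro m n hm hn hmn
    rw [factorizationProd_apply g hm, factorizationProd_apply g hn,
      factorizationProd_apply g (Nat.mul_ne_zero hm hn), Nat.factorization_mul hm hn,
      Finsupp.prod_add_index_of_disjoint]
    rw [Nat.support_factorization, Nat.support_factorization]
    exact hmn.disjoint_primeFactors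

/-- `k̂ = ∏ c(v_p(·))`: the multiplicative function with `τ ∗ k̂ = 2^Ω`. [folklore] -/
def khat : ArithmeticFunction ℕ := factorizationProd khatCoeff

/-- `2^{Ω(n)} = ∏_{p^j ∥ n} 2^j` (`0 ↦ 0`). [folklore] -/
def twoPowOmega : ArithmeticFunction ℕ := factorizationProd fun j => 2 ^ j

/-- `k̂(p^j) = c(j)`. [folklore] -/
private theorem khat_prime_pow {p : ℕ} (hp : p.Prime) (j : ℕ) : khat (p ^ j) = khatCoeff j :=
  factorizationProd_prime_pow _ rfl hp j

/-- `2^{Ω(p^j)} = 2^j`. [folklore] -/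
private theorem twoPowOmega_prime_pow {p : ℕ} (hp : p.Prime) (j : ℕ) : twoPowOmega (p ^ j) = 2 ^ j :=
  factorizationProd_prime_pow _ rfl hp j

/-- `∑_{j ≤ i} c(j) = 2^{i-1}` for `i ≥ 1`. [folklore] -/
private theorem sum_khatCoeff {i : ℕ} (hi : 1 ≤ i) : ∑ j ∈ range (i + 1), khatCoeff j = 2 ^ (i - 1) := by
  induction i, hi using Nat.le_induction with
  | base => simp [Finset.sum_range_succ, khatCoeff]
  | succ k hk ih =>
    rw [Finset.sum_range_succ, ih]
    obtain ⟨j, rfl⟩ : ∃ j, k = j + 1 := ⟨k - 1, by omega⟩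
    rw [show j + 1 + 1 = j + 2 by ring, khatCoeff_add_two]
    simp [pow_succ]; ring

/-- The local identity behind `τ ∗ k̂ = 2^Ω`: `∑_{j ≤ i} c(j)·(i − j + 1) = 2^i`. [folklore] -/
private theorem sum_khatCoeff_mul (i : ℕ) : ∑ j ∈ range (i + 1), khatCoeff j * (i - j + 1) = 2 ^ i := by
  induction i with
  | zero => simp [khatCoeff]
  | succ k ih =>
    have hsplit : ∑ j ∈ range (k + 1), khatCoeff j * (k + 1 - j + 1)
        = ∑ j ∈ range (k + 1), khatCoeff j * (k - j + 1) + ∑ j ∈ range (k + 1), khatCoeff j := by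
      rw [← Finset.sum_add_distrib]
      refine Finset.sum_congr rfl fun j hj => ?_
      have hjk : j ≤ k := by rw [mem_range] at hj; omega
      have : k + 1 - j + 1 = (k - j + 1) + 1 := by omega
      rw [this]; ring
    rw [Finset.sum_range_succ, hsplit, ih, Nat.sub_self, zero_add, mul_one, add_assoc,
      ← Finset.sum_range_succ (fun j => khatCoeff j) (k + 1), sum_khatCoeff (by omega)]
    simp [pow_succ]; ring

/-- **`k̂ ∗ τ = 2^Ω`** as arithmetic functions (both sides multiplicative; compare prime powers).
[folklore] -/
private theorem khat_mul_sigma_zero : khat * ArithmeticFunction.sigma 0 = twoPowOmega := by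
  have hk : khat.IsMultiplicative := isMultiplicative_factorizationProd _
  have h2 : twoPowOmega.IsMultiplicative := isMultiplicative_factorizationProd _
  rw [ArithmeticFunction.IsMultiplicative.eq_iff_eq_on_prime_powers _
    (hk.mul ArithmeticFunction.isMultiplicative_sigma) _ h2]
  intro p i hp
  rw [ArithmeticFunction.mul_apply,
    Nat.sum_divisorsAntidiagonal (fun a b => khat a * ArithmeticFunction.sigma 0 b),
    Nat.sum_divisors_prime_pow hp, twoPowOmega_prime_pow hp, ← sum_khatCoeff_mul i]
  refine Finset.sum_congr rfl fun j hj => ?_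
  have hji : j ≤ i := by rw [mem_range] at hj; omega
  rw [Nat.pow_div hji hp.pos, khat_prime_pow hp, ArithmeticFunction.sigma_zero_apply_prime_pow hp]

/-- Pointwise: **`∑_{d ∣ n} k̂(d)·τ(n/d) = 2^{Ω(n)}`**. [folklore] -/
private theorem sum_divisors_khat_mul_card (n : ℕ) :
    ∑ d ∈ n.divisors, khat d * (n / d).divisors.card = twoPowOmega n := by
  have h := congrArg (fun f : ArithmeticFunction ℕ => f n) khat_mul_sigma_zero
  simp only [ArithmeticFunction.mul_apply] at h
  rw [Nat.sum_divisorsAntidiagonal (fun a b => khat a * ArithmeticFunction.sigma 0 b)] at h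
  simpa [ArithmeticFunction.sigma_zero_apply] using h

/-- For odd `m`: `2^{Ω(m)} = m·f̃(m)` (both are `∏ 2^{v_p}` over `p ∣ m`, `p > 2`). [folklore] -/
private theorem twoPowOmega_eq_mul_ft {m : ℕ} (hm : Odd m) : (twoPowOmega m : ℝ) = m * ft m := by
  have hm0 : m ≠ 0 := hm.pos.ne'
  have hfac : m.factorization.prod (fun p k => p ^ k) = m := Nat.prod_factorization_pow_eq_self hm0
  have hp2 : ∀ p ∈ m.primeFactors, p ≠ 2 := by
    rintro p hp rfl
    exact hm.not_two_dvd_nat (Nat.dvd_of_mem_primeFactors hp)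
  have hft : ft m = ∏ p ∈ m.primeFactors, ((2 : ℝ) / p) ^ (m.factorization p) := by
    conv_lhs => rw [← hfac]
    rw [Finsupp.prod, Nat.support_factorization, ft_finset_prod]
    refine prod_congr rfl fun p hp => ?_
    rw [ft_odd_prime_pow (Nat.prime_of_mem_primeFactors hp) (hp2 p hp)]
  have hmR : (m : ℝ) = ∏ p ∈ m.primeFactors, (p : ℝ) ^ (m.factorization p) := by
    conv_lhs => rw [← hfac]
    rw [Finsupp.prod, Nat.support_factorization]; push_cast; rfl
  have h2 : (twoPowOmega m : ℝ) = ∏ p ∈ m.primeFactors, (2 : ℝ) ^ (m.factorization p) := by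
    rw [twoPowOmega, factorizationProd_apply _ hm0, Finsupp.prod, Nat.support_factorization]
    push_cast; rfl
  rw [h2, hft, hmR, ← Finset.prod_mul_distrib]
  refine Finset.prod_congr rfl fun p hp => ?_
  have hp0 : (p : ℝ) ≠ 0 := by exact_mod_cast (Nat.prime_of_mem_primeFactors hp).ne_zero
  rw [← mul_pow, mul_div_cancel₀ _ hp0]

/-! ## §7  κ-refined explicit Selberg sum -/

/-- The odd divisor-pair set behind `D_odd(Z)`: odd `u, v ≤ Z` with `uv ≤ Z`. [folklore] -/
def oddPairs (Z : ℕ) : Finset (ℕ × ℕ) := ((oddIcc Z) ×ˢ (oddIcc Z)).filter (fun x => x.1 * x.2 ≤ Z)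

/-- `D_odd(Z) = ∑_{(u,v) ∈ oddPairs Z} 1/(uv)`. [folklore] -/
private theorem Dodd_eq_sum_oddPairs (Z : ℕ) : Dodd Z = ∑ x ∈ oddPairs Z, 1 / ((x.1 : ℝ) * x.2) := by
  unfold Dodd Hodd oddPairs
  rw [sum_filter, sum_product]
  refine sum_congr rfl fun u hu => ?_
  obtain ⟨hu1, _, _⟩ := mem_oddIcc.mp hu
  rw [mul_sum, oddIcc_div_eq_filter hu1, sum_filter]
  refine sum_congr rfl fun v _ => ?_
  split_ifs
  · ring
  · rfl

/-- For `s ≥ 1`: `oddPairs (Y/s)` = the odd pairs `u, v ≤ Y` with `s·uv ≤ Y`. [folklore] -/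
private theorem oddPairs_div_eq_filter {Y s : ℕ} (hs : 1 ≤ s) :
    oddPairs (Y / s) = ((oddIcc Y) ×ˢ (oddIcc Y)).filter (fun x => s * (x.1 * x.2) ≤ Y) := by
  ext x
  simp only [oddPairs, mem_filter, mem_product, mem_oddIcc]
  constructor
  · rintro ⟨⟨⟨h1, h2, h3⟩, ⟨h4, h5, h6⟩⟩, h7⟩
    have h8 : s * (x.1 * x.2) ≤ Y := by
      rw [mul_comm]; exact (Nat.le_div_iff_mul_le (by omega)).mp h7
    refine ⟨⟨⟨h1, le_trans h2 (Nat.div_le_self Y s), h3⟩, ⟨h4, le_trans h5 (Nat.div_le_self Y s), h6⟩⟩, h8⟩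
  · rintro ⟨⟨⟨h1, _, h3⟩, ⟨h4, _, h6⟩⟩, h7⟩
    have h8 : x.1 * x.2 ≤ Y / s :=
      (Nat.le_div_iff_mul_le (by omega)).mpr (by rw [mul_comm]; exact h7)
    exact ⟨⟨⟨h1, le_trans (Nat.le_mul_of_pos_right x.1 (by omega)) h8, h3⟩,
      ⟨h4, le_trans (Nat.le_mul_of_pos_left x.2 (by omega)) h8, h6⟩⟩, h8⟩

/-- **κ-refined fibre bound**: for a finite set `S` of odd numbers,
`∑_{s ∈ S} k̂(s)/s · D_odd(Y/s) ≤ ∑_{m ≤ Y odd} f̃(m)` (triples `(s,u,v) ↦ suv`; the fibre over `m`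
has `k̂`-weight `≤ ∑_{d ∣ m} k̂(d)τ(m/d) = 2^{Ω(m)} = m f̃(m)`). [folklore] -/
private theorem sum_khat_Dodd_le_sum_ft (S : Finset ℕ) (hS : ∀ s ∈ S, Odd s) (Y : ℕ) :
    ∑ s ∈ S, (khat s : ℝ) / s * Dodd (Y / s) ≤ ∑ m ∈ oddIcc Y, ft m := by
  set T : Finset (ℕ × (ℕ × ℕ)) :=
    (S ×ˢ ((oddIcc Y) ×ˢ (oddIcc Y))).filter (fun y => y.1 * (y.2.1 * y.2.2) ≤ Y) with hT
  have hS1 : ∀ s ∈ S, 1 ≤ s := fun s hs => (hS s hs).pos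
  -- Step 1: the left side as a sum over triples
  have hL : ∑ s ∈ S, (khat s : ℝ) / s * Dodd (Y / s)
      = ∑ y ∈ T, (khat y.1 : ℝ) / ((y.1 : ℝ) * (y.2.1 * y.2.2)) := by
    rw [hT, sum_filter, sum_product]
    refine sum_congr rfl fun s hs => ?_
    rw [Dodd_eq_sum_oddPairs, oddPairs_div_eq_filter (hS1 s hs), mul_sum, sum_filter]
    refine sum_congr rfl fun x _ => ?_
    split_ifs
    · have hs0 : (s : ℝ) ≠ 0 := by exact_mod_cast Nat.one_le_iff_ne_zero.mp (hS1 s hs)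
      field_simp
    · rfl
  rw [hL]
  -- Step 2: fibre over m = s·u·v
  have hmaps : ∀ y ∈ T, y.1 * (y.2.1 * y.2.2) ∈ oddIcc Y := by
    intro y hy
    rw [hT, mem_filter, mem_product, mem_product] at hy
    obtain ⟨⟨h1, h2, h3⟩, h4⟩ := hy
    rw [mem_oddIcc] at h2 h3 ⊢
    refine ⟨Nat.one_le_iff_ne_zero.mpr (Nat.mul_ne_zero (by linarith [hS1 _ h1])
      (Nat.mul_ne_zero (by omega) (by omega))), h4, (hS _ h1).mul (h2.2.2.mul h3.2.2)⟩
  rw [← sum_fiberwise_of_maps_to hmaps]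
  refine sum_le_sum fun m hm => ?_
  obtain ⟨hm1, _, hmo⟩ := mem_oddIcc.mp hm
  have hm0 : m ≠ 0 := by omega
  have hmR : (0 : ℝ) < m := by exact_mod_cast hm1
  set Fm := T.filter (fun y => y.1 * (y.2.1 * y.2.2) = m) with hFm
  have hconst : ∀ y ∈ Fm, (khat y.1 : ℝ) / ((y.1 : ℝ) * (y.2.1 * y.2.2)) = (khat y.1 : ℝ) / m := by
    intro y hy
    rw [hFm, mem_filter] at hy
    rw [show ((y.1 : ℝ) * (y.2.1 * y.2.2)) = ((y.1 * (y.2.1 * y.2.2) : ℕ) : ℝ) by push_cast; ring, hy.2]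
  rw [sum_congr rfl hconst, ← Finset.sum_div]
  -- Step 3: the k̂-weight of the fibre is ≤ 2^{Ω(m)}
  have hweight : (∑ y ∈ Fm, (khat y.1 : ℝ)) ≤ (twoPowOmega m : ℝ) := by
    -- fibre again over s = y.1 ∈ S
    have hmaps2 : ∀ y ∈ Fm, y.1 ∈ S := by
      intro y hy
      rw [hFm, mem_filter, hT, mem_filter, mem_product] at hy
      exact hy.1.1.1
    rw [← sum_fiberwise_of_maps_to hmaps2]
    have hinner : ∀ s ∈ S, ∑ y ∈ Fm.filter (fun y => y.1 = s), (khat y.1 : ℝ)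
        = (khat s : ℝ) * ((Fm.filter (fun y => y.1 = s)).card : ℝ) := by
      intro s _
      rw [mul_comm, ← nsmul_eq_mul, ← sum_const]
      refine sum_congr rfl fun y hy => ?_
      rw [(mem_filter.mp hy).2]
    rw [sum_congr rfl hinner]
    -- card of the s-fibre ≤ [s ∣ m] τ(m/s)
    have hcard : ∀ s ∈ S, ((Fm.filter (fun y => y.1 = s)).card : ℝ)
        ≤ if s ∣ m then ((m / s).divisors.card : ℝ) else 0 := by
      intro s hs
      split_ifs with hsm
      · have h := Finset.card_le_card_of_injOn (s := Fm.filter (fun y => y.1 = s))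
          (t := (m / s).divisors) (fun y => y.2.1) ?_ ?_
        · exact_mod_cast h
        · intro y hy
          have hy' := mem_filter.mp (Finset.mem_coe.mp hy)
          have hy'' := mem_filter.mp hy'.1
          simp only [Finset.mem_coe, Nat.mem_divisors]
          have hprod : y.2.1 * y.2.2 = m / s := by
            rw [← hy''.2, hy'.2, Nat.mul_div_cancel_left _ (hS1 s hs)]
          refine ⟨Dvd.intro _ hprod, ?_⟩
          rw [← hprod]
          have h21 := (mem_oddIcc.mp (mem_product.mp (mem_product.mp (mem_filter.mp hy''.1).1).2).1).1
          have h22 := (mem_oddIcc.mp (mem_product.mp (mem_product.mp (mem_filter.mp hy''.1).1).2).2).1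
          exact Nat.mul_ne_zero (by omega) (by omega)
        · intro y hy y' hy' h
          have hy1 := mem_filter.mp (Finset.mem_coe.mp hy)
          have hy2 := mem_filter.mp (Finset.mem_coe.mp hy')
          have hf1 := mem_filter.mp hy1.1
          have hf2 := mem_filter.mp hy2.1
          have hs0 : 0 < s := hS1 s hs
          have hpos : 0 < y.2.1 :=
            (mem_oddIcc.mp (mem_product.mp (mem_product.mp (mem_filter.mp hf1.1).1).2).1).1
          have hfst : y.1 = y'.1 := by rw [hy1.2, hy2.2]
          have h' : y.2.1 = y'.2.1 := h
          have hprod : y.1 * (y.2.1 * y.2.2) = y'.1 * (y'.2.1 * y'.2.2) := by rw [hf1.2, hf2.2]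
          rw [hfst] at hprod
          have h3 := Nat.eq_of_mul_eq_mul_left (by rw [← hy2.2] at hs0; exact hs0) hprod
          rw [h'] at h3
          have h4 := Nat.eq_of_mul_eq_mul_left (by rw [← h']; exact hpos) h3
          exact Prod.ext hfst (Prod.ext h' h4)
      · have hempty : Fm.filter (fun y => y.1 = s) = ∅ := by
          rw [Finset.filter_eq_empty_iff]
          intro y hy hys
          apply hsm
          rw [hFm, mem_filter] at hy
          exact Dvd.intro _ (by rw [← hys]; exact hy.2)
        rw [hempty]; simp
    have hstep : ∑ s ∈ S, (khat s : ℝ) * ((Fm.filter (fun y => y.1 = s)).card : ℝ)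
        ≤ ∑ s ∈ S, if s ∣ m then (khat s : ℝ) * ((m / s).divisors.card : ℝ) else 0 := by
      refine sum_le_sum fun s hs => ?_
      have := hcard s hs
      split_ifs at this ⊢ with hsm
      · exact mul_le_mul_of_nonneg_left this (Nat.cast_nonneg _)
      · have : ((Fm.filter (fun y => y.1 = s)).card : ℝ) = 0 := le_antisymm this (Nat.cast_nonneg _)
        rw [this, mul_zero]
    refine le_trans hstep ?_
    rw [← sum_filter, ← sum_divisors_khat_mul_card m]
    push_cast
    refine Finset.sum_le_sum_of_subset_of_nonneg ?_ (fun d _ _ => by positivity)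
    intro s hs
    rw [mem_filter] at hs
    exact Nat.mem_divisors.mpr ⟨hs.2, hm0⟩
  calc (∑ y ∈ Fm, (khat y.1 : ℝ)) / m ≤ (twoPowOmega m : ℝ) / m :=
        div_le_div_of_nonneg_right hweight hmR.le
    _ = ft m := by rw [twoPowOmega_eq_mul_ft hmo, mul_div_cancel_left₀ _ hmR.ne']

/-- The finite odd squarefull set used for the κ-refinement. [folklore] -/
def kappaSet : Finset ℕ := {1, 9, 25, 27, 49, 81}

/-- Its elements are odd. [folklore] -/
private theorem kappaSet_odd : ∀ s ∈ kappaSet, Odd s := by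
  intro s hs
  simp only [kappaSet, mem_insert, mem_singleton] at hs
  rcases hs with rfl | rfl | rfl | rfl | rfl | rfl <;> decide

/-- `k̂` on `kappaSet`: `k̂(1) = k̂(9) = k̂(25) = k̂(49) = 1`, `k̂(27) = 2`, `k̂(81) = 4`. [folklore] -/
private theorem khat_one : khat 1 = 1 := by
  rw [show (1 : ℕ) = 3 ^ 0 by norm_num, khat_prime_pow (by norm_num) 0]; rfl

/-- `k̂(9) = 1`. [folklore] -/
private theorem khat_9 : khat 9 = 1 := by
  rw [show (9 : ℕ) = 3 ^ 2 by norm_num, khat_prime_pow (by norm_num) 2]; rfl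

/-- `k̂(25) = 1`. [folklore] -/
private theorem khat_25 : khat 25 = 1 := by
  rw [show (25 : ℕ) = 5 ^ 2 by norm_num, khat_prime_pow (by norm_num) 2]; rfl

/-- `k̂(27) = 2`. [folklore] -/
private theorem khat_27 : khat 27 = 2 := by
  rw [show (27 : ℕ) = 3 ^ 3 by norm_num, khat_prime_pow (by norm_num) 3]; rfl

/-- `k̂(49) = 1`. [folklore] -/
private theorem khat_49 : khat 49 = 1 := by
  rw [show (49 : ℕ) = 7 ^ 2 by norm_num, khat_prime_pow (by norm_num) 2]; rfl

/-- `k̂(81) = 4`. [folklore] -/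
private theorem khat_81 : khat 81 = 4 := by
  rw [show (81 : ℕ) = 3 ^ 4 by norm_num, khat_prime_pow (by norm_num) 4]; rfl

/-- Numerical: `log 3 ≤ 1.0987`. [folklore] -/
private theorem log_three_le' : Real.log 3 ≤ 1.0987 := by
  rw [Real.log_le_iff_le_exp (by norm_num)]
  refine le_trans ?_ (Real.sum_le_exp_of_nonneg (by norm_num) 10)
  simp only [Finset.sum_range_succ, Finset.sum_range_zero, Nat.factorial]
  norm_num

/-- Numerical: `log 5 ≤ 1.6095`. [folklore] -/
private theorem log_five_le' : Real.log 5 ≤ 1.6095 := by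
  rw [Real.log_le_iff_le_exp (by norm_num)]
  refine le_trans ?_ (Real.sum_le_exp_of_nonneg (by norm_num) 12)
  simp only [Finset.sum_range_succ, Finset.sum_range_zero, Nat.factorial]
  norm_num

/-- Numerical: `log 7 ≤ 1.946`. [folklore] -/
private theorem log_seven_le' : Real.log 7 ≤ 1.946 := by
  rw [Real.log_le_iff_le_exp (by norm_num)]
  refine le_trans ?_ (Real.sum_le_exp_of_nonneg (by norm_num) 13)
  simp only [Finset.sum_range_succ, Finset.sum_range_zero, Nat.factorial]
  norm_num

/-- Rational upper bounds `logUb s ≥ log s` on `kappaSet`. [folklore] -/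
noncomputable def logUb (s : ℕ) : ℝ :=
  if s = 9 then 2.1974 else if s = 25 then 3.219 else if s = 27 then 3.2961
  else if s = 49 then 3.892 else if s = 81 then 4.3948 else 0

/-- `log s ≤ logUb s` on `kappaSet`. [folklore] -/
private theorem log_le_logUb : ∀ s ∈ kappaSet, Real.log s ≤ logUb s := by
  intro s hs
  simp only [kappaSet, mem_insert, mem_singleton] at hs
  rcases hs with rfl | rfl | rfl | rfl | rfl | rfl
  · simp [logUb]
  · rw [show ((9 : ℕ) : ℝ) = (3 : ℝ) ^ 2 by norm_num, Real.log_pow]; norm_num [logUb]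
    linarith [log_three_le']
  · rw [show ((25 : ℕ) : ℝ) = (5 : ℝ) ^ 2 by norm_num, Real.log_pow]; norm_num [logUb]
    linarith [log_five_le']
  · rw [show ((27 : ℕ) : ℝ) = (3 : ℝ) ^ 3 by norm_num, Real.log_pow]; norm_num [logUb]
    linarith [log_three_le']
  · rw [show ((49 : ℕ) : ℝ) = (7 : ℝ) ^ 2 by norm_num, Real.log_pow]; norm_num [logUb]
    linarith [log_seven_le']
  · rw [show ((81 : ℕ) : ℝ) = (3 : ℝ) ^ 4 by norm_num, Real.log_pow]; norm_num [logUb]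
    linarith [log_three_le']

/-- `logUb s ≥ 0`. [folklore] -/
private theorem logUb_nonneg (s : ℕ) : 0 ≤ logUb s := by
  unfold logUb; split_ifs <;> norm_num

/-- `logUb s ≤ 4.3948`. [folklore] -/
private theorem logUb_le (s : ℕ) : logUb s ≤ 4.3948 := by
  unfold logUb; split_ifs <;> norm_num

/-- `U(a,s) = a·0.6931472 + logUb s ≥ a log 2 + log s`. [folklore] -/
noncomputable def Ub (a s : ℕ) : ℝ := (a : ℝ) * 0.6931472 + logUb s

/-- One `(a, s)` cell: for `2^a s ≤ X` and `log X ≥ U(a,s)`,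
`k̂(s)/s·(⅛(log X − U(a,s))² − 8/15) ≤ k̂(s)/s · D_odd(X/2^a/s)`. [folklore] -/
private theorem kappa_cell_ge {X a s : ℕ} (hs : s ∈ kappaSet) (hX : 2 ^ a * s ≤ X) (hl : Ub a s ≤ Real.log X) :
    (khat s : ℝ) / s * ((1 / 8) * (Real.log X - Ub a s) ^ 2 - 8 / 15)
      ≤ (khat s : ℝ) / s * Dodd (X / 2 ^ a / s) := by
  have hs1 : 1 ≤ s := (kappaSet_odd s hs).pos
  have hsR : (0 : ℝ) < s := by exact_mod_cast hs1
  have hX0 : (0 : ℝ) < X := by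
    have : 0 < X := lt_of_lt_of_le (Nat.mul_pos (by positivity) hs1) hX
    exact_mod_cast this
  refine mul_le_mul_of_nonneg_left ?_ (by positivity)
  have hy : (1 : ℝ) ≤ (X : ℝ) / ((2 : ℝ) ^ a * s) := by
    rw [le_div_iff₀ (by positivity), one_mul]
    exact_mod_cast hX
  have h := Dodd_ge hy
  have hfloor : ⌊(X : ℝ) / ((2 : ℝ) ^ a * s)⌋₊ = X / 2 ^ a / s := by
    rw [show ((2 : ℝ) ^ a * s) = ((2 ^ a * s : ℕ) : ℝ) by push_cast; ring, Nat.floor_div_eq_div,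
      Nat.div_div_eq_div_mul]
  have hlog : Real.log ((X : ℝ) / ((2 : ℝ) ^ a * s)) = Real.log X - a * Real.log 2 - Real.log s := by
    rw [Real.log_div hX0.ne' (by positivity), Real.log_mul (by positivity) hsR.ne', Real.log_pow]
    ring
  rw [hfloor, hlog] at h
  refine le_trans ?_ h
  have hU : (a : ℝ) * Real.log 2 + Real.log s ≤ Ub a s := by
    unfold Ub
    have h2 : Real.log 2 ≤ 0.6931472 := by linarith [Real.log_two_lt_d9]
    have := log_le_logUb s hs
    nlinarith [h2, this, Nat.cast_nonneg (α := ℝ) a]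
  have h0 : 0 ≤ Real.log X - Ub a s := by linarith
  have hsq : (Real.log X - Ub a s) ^ 2 ≤ (Real.log X - a * Real.log 2 - Real.log s) ^ 2 :=
    pow_le_pow_left₀ h0 (by linarith) 2
  linarith

/-- One dyadic level, κ-refined: for `2^a·81 ≤ X` and `log X ≥ 9.25`,
`∑_{s ∈ kappaSet} k̂(s)/s·(⅛(log X − U(a,s))² − 8/15) ≤ ∑_{m ≤ X/2^a odd} f̃(m)`. [folklore] -/
private theorem sum_ft_odd_level_ge_kappa {X a : ℕ} (ha : a ≤ 7) (hX : 2 ^ a * 81 ≤ X)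
    (hl : 9.25 ≤ Real.log X) :
    ∑ s ∈ kappaSet, (khat s : ℝ) / s * ((1 / 8) * (Real.log X - Ub a s) ^ 2 - 8 / 15)
      ≤ ∑ m ∈ oddIcc (X / 2 ^ a), ft m := by
  refine le_trans ?_ (sum_khat_Dodd_le_sum_ft kappaSet kappaSet_odd (X / 2 ^ a))
  refine sum_le_sum fun s hs => kappa_cell_ge hs ?_ ?_
  · have hs81 : s ≤ 81 := by
      simp only [kappaSet, mem_insert, mem_singleton] at hs
      rcases hs with rfl | rfl | rfl | rfl | rfl | rfl <;> norm_num
    exact le_trans (Nat.mul_le_mul_left _ hs81) hX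
  · have ha7 : (a : ℝ) ≤ 7 := by exact_mod_cast ha
    have := logUb_le s
    unfold Ub
    nlinarith [this, ha7, Nat.cast_nonneg (α := ℝ) a]

/-- The κ-refined explicit minorant of `T(X)` (and `Q_∅(X)`) as a function of `l = log X`:
`0.3224 l² − 0.8881 l + 0.0974` (rounded from the 48-cell sum; `0.3224 ≈ 0.85/(4C₂)`). [folklore] -/
noncomputable def TlowK (l : ℝ) : ℝ := 0.3224 * l ^ 2 - 0.8881 * l + 0.0974

/-- The 48-cell sum dominates `TlowK`. [folklore] -/
private theorem TlowK_le_cells {l : ℝ} (hl : 9.25 ≤ l) :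
    TlowK l ≤ ∑ a ∈ range 8, (1 / 2 : ℝ) ^ a *
      ∑ s ∈ kappaSet, (khat s : ℝ) / s * ((1 / 8) * (l - Ub a s) ^ 2 - 8 / 15) := by
  norm_num [Finset.sum_range_succ, kappaSet, khat_one, khat_9, khat_25, khat_27, khat_49, khat_81,
    Ub, logUb, TlowK]
  nlinarith [hl]

/-- **κ-REFINED EXPLICIT TWO-RESIDUE SELBERG SUM**: for `X ≥ 2^{14}`,
`∑_{n ≤ X} f̃(n) ≥ 0.3224 log²X − 0.8881 log X + 0.0974` (κ-refinement of `sum_ft_ge_explicit` by the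
squarefull convolution `τ ∗ k̂ = 2^Ω` over `kappaSet = {1,9,25,27,49,81}`; truth `1/(4C₂) = 0.3787`).
[cite: BatemanDiamond2004, Lemma 13.11, p. 327 (explicit weaker lower bound proved here)] -/
theorem sum_ft_ge_kappa {X : ℕ} (hX : 16384 ≤ X) :
    TlowK (Real.log X) ≤ ∑ n ∈ Icc 1 X, ft n := by
  have hXR : (16384 : ℝ) ≤ X := by exact_mod_cast hX
  have hl : 9.25 ≤ Real.log X := by
    have h1 : Real.log ((2 : ℝ) ^ 14) ≤ Real.log X :=
      Real.log_le_log (by positivity) (by norm_num; exact_mod_cast hXR)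
    rw [Real.log_pow] at h1
    have h2 := Real.log_two_gt_d9
    push_cast at h1
    linarith
  refine le_trans (TlowK_le_cells hl) ?_
  refine le_trans ?_ (sum_ft_ge_dyadic X 7)
  refine sum_le_sum fun a ha => ?_
  have ha7 : a ≤ 7 := by rw [mem_range] at ha; omega
  refine mul_le_mul_of_nonneg_left (sum_ft_odd_level_ge_kappa ha7 ?_ hl) (by positivity)
  calc 2 ^ a * 81 ≤ 2 ^ 7 * 81 := Nat.mul_le_mul_right _ (Nat.pow_le_pow_right (by norm_num) ha7)
    _ ≤ X := by norm_num; omega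

/-- `Q_∅(X) ≥ TlowK(log X)` for `X ≥ 2^{14}` (chained with `sum_ft_le_Qsum`). [cite: BatemanDiamond2004, Lemma 13.11, p. 327 (explicit weaker lower bound proved here)] -/
theorem Qsum_ge_kappa {X : ℕ} (hX : 16384 ≤ X) : TlowK (Real.log X) ≤ Qsum ∅ X := by
  have h := sum_ft_ge_kappa hX
  have hI : Ioc 0 X = Icc 1 X := rfl
  have h2 := sum_ft_le_Qsum X
  rw [hI] at h2
  linarith

/-! ## §8  κ-refined explicit large-sieve step and pair sieves -/

/-- `TlowK` is increasing on `[2, ∞)`. [folklore] -/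
private theorem TlowK_mono {l₁ l : ℝ} (h₁ : 2 ≤ l₁) (h : l₁ ≤ l) : TlowK l₁ ≤ TlowK l := by
  unfold TlowK; nlinarith [h₁, h]

/-- `TlowK(l₁) ≥ 100` for `l₁ ≥ 19.11`. [folklore] -/
private theorem TlowK_ge {l₁ : ℝ} (h₁ : 19.11 ≤ l₁) : 100 ≤ TlowK l₁ := by
  unfold TlowK; nlinarith [h₁]

/-- κ-numerics at threshold `e^{41}`: `17 L² ≤ 16·17.73·TlowK(L/2 − 1.38632)` for `L ≥ 41`. [folklore] -/
private theorem kappa_numeric_41 {L : ℝ} (hL : 41 ≤ L) :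
    17 * L ^ 2 ≤ 16 * (17.75 - 0.02) * TlowK (L / 2 - 1.38632) := by
  unfold TlowK; nlinarith [hL]

/-- κ-numerics at threshold `e^{47}`: `17 L² ≤ 16·17.08·TlowK(L/2 − 1.38632)` for `L ≥ 47`. [folklore] -/
private theorem kappa_numeric_47 {L : ℝ} (hL : 47 ≤ L) :
    17 * L ^ 2 ≤ 16 * (17.1 - 0.02) * TlowK (L / 2 - 1.38632) := by
  unfold TlowK; nlinarith [hL]

/-- The boundary numerics from `L ≥ 41`: `(E/4 + 1)·L² ≤ 0.01·E²` once `100 L² ≤ E`. [folklore] -/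
private theorem tail_numeric' {L E : ℝ} (hL : 41 ≤ L) (hEL : 100 * L ^ 2 ≤ E) :
    (E / 4 + 1) * L ^ 2 ≤ 0.01 * E ^ 2 := by
  have hL2 : (1681 : ℝ) ≤ L ^ 2 := by nlinarith [hL]
  have hE : (168100 : ℝ) ≤ E := by linarith
  nlinarith [hEL, hE, hL2]

set_option maxHeartbeats 400000 in
/-- **THE κ-REFINED EXPLICIT LARGE-SIEVE STEP (generic in the threshold)**: if `Λ ≥ 41`,
`17 L² ≤ 16(A − 0.02)·TlowK(L/2 − 1.38632)` for all `L ≥ Λ`, and a count `C` satisfies the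
Bateman–Diamond inequality `C·Q_∅(X) ≤ (X² + N − 1)·F + B·Q_∅(X)` at `X = ⌊√N⌋/4` with `F ≥ 1`,
`B ≤ 2X + 2`, then `C ≤ A·F·N/log²N` for every `N ≥ e^Λ`.
[cite: BatemanDiamond2004, Thm 13.8, §13.4–13.5 pp. 325–328 (explicit form proved here)] -/
theorem explicit_of_largeSieve_kappa {Λ A : ℝ} (hΛ : 41 ≤ Λ)
    (hA : ∀ L : ℝ, Λ ≤ L → 17 * L ^ 2 ≤ 16 * (A - 0.02) * TlowK (L / 2 - 1.38632))
    {N : ℕ} {C F B : ℝ} (hN : Real.exp Λ ≤ (N : ℝ)) (hF1 : 1 ≤ F)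
    (hB : B ≤ 2 * ((Nat.sqrt N / 4 : ℕ) : ℝ) + 2)
    (hBD : C * Qsum ∅ (Nat.sqrt N / 4) ≤ (((Nat.sqrt N / 4 : ℕ) : ℝ) ^ 2 + N - 1) * F
      + B * Qsum ∅ (Nat.sqrt N / 4)) :
    C ≤ A * F * (N : ℝ) / Real.log (N : ℝ) ^ 2 := by
  have hN0 : (0 : ℝ) < N := lt_of_lt_of_le (Real.exp_pos Λ) hN
  set L := Real.log (N : ℝ) with hLdef
  have hL : Λ ≤ L := by
    have := Real.log_le_log (Real.exp_pos Λ) hN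
    rwa [Real.log_exp] at this
  have hL41 : (41 : ℝ) ≤ L := le_trans hΛ hL
  have hL2pos : 0 < L ^ 2 := by positivity
  -- E = √N = exp(L/2)
  set E := Real.exp (L / 2) with hEdef
  have hE0 : 0 < E := Real.exp_pos _
  have hE2 : E ^ 2 = N := by
    have : E ^ 2 = Real.exp L := by rw [hEdef, sq, ← Real.exp_add]; ring_nf
    rw [this, hLdef, Real.exp_log hN0]
  have hE8 : (L / 2) ^ 8 / 40320 ≤ E := by
    have := Real.pow_div_factorial_le_exp (L / 2) (by linarith) 8
    simpa [Nat.factorial] using this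
  have hLsq : (1681 : ℝ) ≤ L ^ 2 := by nlinarith [hL41]
  have hL4 : (1681 : ℝ) ^ 2 ≤ (L ^ 2) ^ 2 := pow_le_pow_left₀ (by norm_num) hLsq 2
  have hEL : 100 * L ^ 2 ≤ E := by
    have h1 : (1681 : ℝ) ^ 2 * 1681 * L ^ 2 ≤ (L ^ 2) ^ 2 * L ^ 2 * L ^ 2 := by
      have := mul_le_mul hL4 hLsq (by norm_num) (by positivity)
      nlinarith [this, hL2pos]
    have h2 : (L / 2) ^ 8 / 40320 = (L ^ 2) ^ 2 * L ^ 2 * L ^ 2 / 10321920 := by ring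
    rw [h2] at hE8
    nlinarith [h1, hE8]
  have hEbig : (168100 : ℝ) ≤ E := by linarith
  -- s = ⌊√N⌋, X = s / 4
  set s := Nat.sqrt N with hsdef
  set X := s / 4 with hXdef
  have hs2 : (s : ℝ) ^ 2 ≤ N := by exact_mod_cast Nat.sqrt_le' N
  have hs2' : (N : ℝ) < ((s : ℝ) + 1) ^ 2 := by exact_mod_cast Nat.lt_succ_sqrt' N
  have hsE : (s : ℝ) ≤ E := by
    have : (s : ℝ) ^ 2 ≤ E ^ 2 := by rw [hE2]; exact hs2
    exact (pow_le_pow_iff_left₀ (Nat.cast_nonneg s) hE0.le two_ne_zero).mp this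
  have hEs : E < (s : ℝ) + 1 := by
    have : E ^ 2 < ((s : ℝ) + 1) ^ 2 := by rw [hE2]; exact hs2'
    exact (pow_lt_pow_iff_left₀ hE0.le (by positivity) two_ne_zero).mp this
  have hX4 : 4 * X ≤ s := Nat.mul_div_le s 4
  have hXR : (X : ℝ) ^ 2 ≤ (N : ℝ) / 16 := by
    have h4 : 4 * (X : ℝ) ≤ s := by exact_mod_cast hX4
    have hX0 : (0 : ℝ) ≤ X := Nat.cast_nonneg X
    have : (4 * (X : ℝ)) ^ 2 ≤ (s : ℝ) ^ 2 := pow_le_pow_left₀ (by positivity) h4 2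
    nlinarith [hs2, this]
  have hXlo : E / 4 - 1 < (X : ℝ) := by
    have : (s : ℝ) + 1 ≤ 4 * (X : ℝ) + 4 := by exact_mod_cast (by omega : s + 1 ≤ 4 * X + 4)
    linarith [hEs]
  have hXhi : (X : ℝ) ≤ E / 4 := by
    have : 4 * (X : ℝ) ≤ s := by exact_mod_cast hX4
    linarith [hsE]
  have hX0 : (0 : ℝ) < X := by linarith
  have hX16384 : 16384 ≤ X := by
    have : (16384 : ℝ) ≤ X := by linarith
    exact_mod_cast this
  -- log X ≥ l₁ := L/2 − 1.38632
  set l₁ := L / 2 - 1.38632 with hl₁def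
  have hexp : Real.exp l₁ ≤ (X : ℝ) := by
    rw [hl₁def, Real.exp_sub]
    have h1 : E / Real.exp 1.38632 ≤ E / 4.0001 :=
      div_le_div_of_nonneg_left hE0.le (by norm_num) exp_138632_ge
    have h2 : E / 4.0001 ≤ E / 4 - 1 := by
      rw [div_le_iff₀ (by norm_num)]
      linarith [hEbig]
    linarith [hXlo]
  have hl : l₁ ≤ Real.log X := by
    rw [Real.le_log_iff_exp_le hX0]; exact hexp
  have hl₁ : (19.11 : ℝ) ≤ l₁ := by rw [hl₁def]; linarith
  -- Q ≥ TlowK(log X) ≥ TlowK(l₁) ≥ 100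
  set Q := Qsum ∅ X with hQdef
  have hQ : TlowK (Real.log X) ≤ Q := Qsum_ge_kappa hX16384
  have hQT : TlowK l₁ ≤ Q := le_trans (TlowK_mono (by linarith) hl) hQ
  have hT₁ : (100 : ℝ) ≤ TlowK l₁ := TlowK_ge hl₁
  have hQpos : 0 < Q := by linarith
  have hF0 : 0 ≤ F := le_trans zero_le_one hF1
  have hC1 : C ≤ ((X : ℝ) ^ 2 + N - 1) * F / Q + B := by
    have : C * Q ≤ (((X : ℝ) ^ 2 + N - 1) * F / Q + B) * Q := by
      rw [add_mul, div_mul_cancel₀ _ hQpos.ne']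
      exact hBD
    exact le_of_mul_le_mul_right this hQpos
  have hC2 : ((X : ℝ) ^ 2 + N - 1) * F / Q ≤ (17 / 16) * (N : ℝ) * F / TlowK l₁ := by
    have hnum0 : 0 ≤ (17 / 16) * (N : ℝ) * F := by positivity
    have hnum : ((X : ℝ) ^ 2 + N - 1) * F ≤ (17 / 16) * (N : ℝ) * F := by
      apply mul_le_mul_of_nonneg_right _ hF0
      linarith [hXR]
    calc ((X : ℝ) ^ 2 + N - 1) * F / Q ≤ (17 / 16) * (N : ℝ) * F / Q :=
          div_le_div_of_nonneg_right hnum hQpos.le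
      _ ≤ (17 / 16) * (N : ℝ) * F / TlowK l₁ :=
          div_le_div_of_nonneg_left hnum0 (by linarith) hQT
  -- main term
  have hmain : (17 / 16) * (N : ℝ) * F / TlowK l₁ ≤ (A - 0.02) * F * (N : ℝ) / L ^ 2 := by
    have hkey : 17 * L ^ 2 ≤ 16 * (A - 0.02) * TlowK l₁ := hA L hL
    rw [div_le_div_iff₀ (by linarith) hL2pos]
    have hNF : 0 ≤ (N : ℝ) * F / 16 := by positivity
    have h := mul_le_mul_of_nonneg_left hkey hNF
    calc (17 / 16) * (N : ℝ) * F * L ^ 2 = (N : ℝ) * F / 16 * (17 * L ^ 2) := by ring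
      _ ≤ (N : ℝ) * F / 16 * (16 * (A - 0.02) * TlowK l₁) := h
      _ = (A - 0.02) * F * (N : ℝ) * TlowK l₁ := by ring
  -- boundary term
  have htail : B ≤ 0.02 * F * (N : ℝ) / L ^ 2 := by
    have h2 : (E / 4 + 1) * L ^ 2 ≤ 0.01 * (N : ℝ) := by
      rw [← hE2]; exact tail_numeric' hL41 hEL
    have h3 : 0.02 * (N : ℝ) ≤ 0.02 * F * (N : ℝ) :=
      calc 0.02 * (N : ℝ) ≤ F * (0.02 * (N : ℝ)) := le_mul_of_one_le_left (by positivity) hF1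
        _ = 0.02 * F * (N : ℝ) := by ring
    rw [le_div_iff₀ hL2pos]
    have h1 : B * L ^ 2 ≤ 2 * ((E / 4 + 1) * L ^ 2) := by
      have : B ≤ 2 * (E / 4 + 1) := by linarith only [hB, hXhi]
      nlinarith only [this, hL2pos]
    linarith only [h1, h2, h3]
  calc C ≤ ((X : ℝ) ^ 2 + N - 1) * F / Q + B := hC1
    _ ≤ (17 / 16) * (N : ℝ) * F / TlowK l₁ + B := by linarith only [hC2]
    _ ≤ (A - 0.02) * F * (N : ℝ) / L ^ 2 + 0.02 * F * (N : ℝ) / L ^ 2 := add_le_add hmain htail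
    _ = A * F * (N : ℝ) / L ^ 2 := by ring

/-- **κ-REFINED EXPLICIT PAIR SIEVE for `(p, ap + k)`**: for `a, k ≥ 1`, `ak` even, `N ≥ e^{47}`:
`#{p ≤ N : p, ap+k prime} ≤ 17.1·f(ak)·N/log²N`. [cite: BatemanDiamond2004, Thm 13.8] -/
theorem primePairs_le_kappa {a k N : ℕ} (ha : 1 ≤ a) (hk : 1 ≤ k) (hak : Even (a * k))
    (hN : Real.exp 47 ≤ (N : ℝ)) :
    ((((range (N + 1)).filter (fun p => p.Prime ∧ (a * p + k).Prime)).card : ℕ) : ℝ)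
      ≤ 17.1 * oddSingularFactor (a * k) * (N : ℝ) / Real.log (N : ℝ) ^ 2 := by
  have hX1 : 1 ≤ Nat.sqrt N / 4 := le_trans (by norm_num) (sieveX_ge hN)
  have hBD := card_primePairs_mul_Qsum_le a k N (Nat.sqrt N / 4) ha hk hak hX1
  have hprod : (∏ p ∈ ((a * k).primeFactors.filter (2 < ·)), (((p : ℝ) - 1) / ((p : ℝ) - 2)))
      = oddSingularFactor (a * k) := rfl
  rw [hprod] at hBD
  exact explicit_of_largeSieve_kappa (Λ := 47) (by norm_num) (fun L hL => kappa_numeric_47 hL) hN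
    (one_le_oddSingularFactor _) (by linarith) hBD

/-- **κ-REFINED EXPLICIT PAIR SIEVE for `(p, p + h)` from `e^{41}`**: for every `N ≥ e^{41}` and even
`h ≠ 0`, `#{p ≤ N : p + h prime} ≤ 17.75·f(h)·N/log²N` (the Romanoff-tuned threshold).
[cite: BatemanDiamond2004, Thm 13.8, §13.4–13.5 pp. 325–328 (explicit form proved here)] [cite: RieselVaughan1983, Lemma 5 (printed h-uniform bound; weaker constant proved here)] -/
theorem pairCount_le_kappa {N h : ℕ} (hN : Real.exp 41 ≤ (N : ℝ)) (hh : h ≠ 0) (heven : Even h) :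
    ((((Nat.primesLE N).filter fun p => (p + h).Prime).card : ℕ) : ℝ)
      ≤ 17.75 * oddSingularFactor h * (N : ℝ) / Real.log (N : ℝ) ^ 2 := by
  have h20 : (2 : ℝ) ^ 20 ≤ (N : ℝ) := by
    refine le_trans ?_ hN
    have he : (2 : ℝ) ≤ Real.exp 1 := by have := Real.exp_one_gt_d9; linarith
    have h41 : (2 : ℝ) ^ 41 ≤ Real.exp 41 := by
      rw [show (41 : ℝ) = ((41 : ℕ) : ℝ) * 1 by norm_num, Real.exp_nat_mul]
      exact pow_le_pow_left₀ (by norm_num) he 41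
    exact le_trans (by norm_num) h41
  have hX1 : 1 ≤ Nat.sqrt N / 4 := by
    have h20' : 2 ^ 20 ≤ N := by exact_mod_cast h20
    have hs : 1024 ≤ Nat.sqrt N := by
      rw [Nat.le_sqrt]
      calc 1024 * 1024 = 2 ^ 20 := by norm_num
        _ ≤ N := h20'
    omega
  have hBD := card_primePairs_mul_Qsum_le 1 h N (Nat.sqrt N / 4) le_rfl
    (Nat.one_le_iff_ne_zero.mpr hh) (by simpa using heven) hX1
  have hprod : (∏ p ∈ ((1 * h).primeFactors.filter (2 < ·)), (((p : ℝ) - 1) / ((p : ℝ) - 2)))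
      = oddSingularFactor h := by rw [one_mul]; rfl
  rw [hprod] at hBD
  have hmain := explicit_of_largeSieve_kappa (Λ := 41) le_rfl (fun L hL => kappa_numeric_41 hL) hN
    (one_le_oddSingularFactor _) (by linarith) hBD
  have hcount : ((range (N + 1)).filter (fun p => p.Prime ∧ (1 * p + h).Prime)).card
      = ((Nat.primesLE N).filter fun p => (p + h).Prime).card := by
    congr 1
    ext p
    simp only [mem_filter, mem_range, Nat.mem_primesLE, one_mul, Nat.lt_succ_iff]
    tauto
  rw [hcount] at hmain
  exact hmain

/-- **κ-REFINED EXPLICIT SELBERG–GOLDBACH BOUND**: for every even `N ≥ e^{47}`,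
`r(N) ≤ 17.1·f(N)·N/log²N` (`= (8.55/C₂)·𝔖(N)·N/log²N ≈ 12.95·𝔖(N) N/log²N`; classical `8𝔖(1+o(1))`).
[cite: BatemanDiamond2004, §13.4 (13.13)–(13.14)] -/
theorem goldbachCount_le_kappa {N : ℕ} (hN : Real.exp 47 ≤ (N : ℝ)) (heven : Even N) :
    (Literature.NumberTheory.Sieve.SingularSeries.goldbachCount N : ℝ)
      ≤ 17.1 * oddSingularFactor N * (N : ℝ) / Real.log (N : ℝ) ^ 2 := by
  have hX1 : 1 ≤ Nat.sqrt N / 4 := le_trans (by norm_num) (sieveX_ge hN)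
  have hBD := Literature.NumberTheory.Sieve.GoldbachSieveEight.goldbachCount_mul_Qsum_le N
    (Nat.sqrt N / 4) heven hX1
  have hprod : (∏ p ∈ (N.primeFactors.filter (2 < ·)), (((p : ℝ) - 1) / ((p : ℝ) - 2)))
      = oddSingularFactor N := rfl
  rw [hprod] at hBD
  exact explicit_of_largeSieve_kappa (Λ := 47) (by norm_num) (fun L hL => kappa_numeric_47 hL) hN
    (one_le_oddSingularFactor _) (by linarith) hBD


/-! ### §8b  Concrete corollaries: twins and Sophie Germain pairs -/

/-- `f(2) = 1`. [folklore] -/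
private theorem oddSingularFactor_two : oddSingularFactor 2 = 1 := by
  rw [show (2 : ℕ) = 2 ^ 1 * 1 by norm_num,
    Literature.NumberTheory.Sieve.GoldbachLinnik.oddSingularFactor_two_pow_mul 1 one_ne_zero,
    Literature.NumberTheory.Sieve.GoldbachLinnik.oddSingularFactor_one]

/-- **Explicit twin-prime count bound**: `π₂(N) ≤ 17.1·N/log²N` for every `N ≥ e^{47}`
(print: Siebert 1976 `16C₂ = 10.56` for all `N > 1`; Hardy–Littlewood conjecture `2C₂ = 1.32`).
[cite: BatemanDiamond2004, Thm 13.8] -/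
theorem twinPrimeCount_le_kappa {N : ℕ} (hN : Real.exp 47 ≤ (N : ℝ)) :
    (Literature.NumberTheory.Sieve.twinPrimeCount N : ℝ) ≤ 17.1 * (N : ℝ) / Real.log (N : ℝ) ^ 2 := by
  have h := primePairs_le_kappa (a := 1) (k := 2) (N := N) le_rfl (by norm_num) (by norm_num) hN
  rw [one_mul, oddSingularFactor_two, mul_one] at h
  have hc : Literature.NumberTheory.Sieve.twinPrimeCount N
      = ((range (N + 1)).filter (fun p => p.Prime ∧ (1 * p + 2).Prime)).card := by
    unfold Literature.NumberTheory.Sieve.twinPrimeCount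
    simp only [one_mul]
  rw [hc]
  exact h

/-- **Explicit twin-prime count bound from `e^{41}`**: `π₂(N) ≤ 17.75·N/log²N` for `N ≥ e^{41}`.
[cite: BatemanDiamond2004, Thm 13.8] -/
theorem twinPrimeCount_le_kappa' {N : ℕ} (hN : Real.exp 41 ≤ (N : ℝ)) :
    (Literature.NumberTheory.Sieve.twinPrimeCount N : ℝ) ≤ 17.75 * (N : ℝ) / Real.log (N : ℝ) ^ 2 := by
  have h := pairCount_le_kappa (N := N) (h := 2) hN two_ne_zero (by norm_num)
  rw [oddSingularFactor_two, mul_one] at h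
  have hc : Literature.NumberTheory.Sieve.twinPrimeCount N
      = ((Nat.primesLE N).filter fun p => (p + 2).Prime).card := by
    unfold Literature.NumberTheory.Sieve.twinPrimeCount
    congr 1
    ext p
    simp only [mem_filter, mem_range, Nat.mem_primesLE, Nat.lt_succ_iff]
    tauto
  rw [hc]
  exact h

/-- **Explicit Sophie Germain pair bound**: `#{p ≤ N : p, 2p+1 prime} ≤ 17.1·N/log²N` for
`N ≥ e^{47}`. [cite: BatemanDiamond2004, Thm 13.8] -/
theorem sophieGermain_le_kappa {N : ℕ} (hN : Real.exp 47 ≤ (N : ℝ)) :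
    ((((range (N + 1)).filter (fun p => p.Prime ∧ (2 * p + 1).Prime)).card : ℕ) : ℝ)
      ≤ 17.1 * (N : ℝ) / Real.log (N : ℝ) ^ 2 := by
  have h := primePairs_le_kappa (a := 2) (k := 1) (N := N) (by norm_num) le_rfl (by norm_num) hN
  rw [mul_one, oddSingularFactor_two, mul_one] at h
  exact h


/-! ## §9  κ-refinement II (cell parity-ideate p5 ROUND-38 «CELLS»): the enlarged squarefull set `kappaSet2` and the cell polynomial `TlowK2`

ONE input varied relative to the tree's `TwoResidueSelbergExplicit.sum_ft_ge_kappa`: the finite odd squarefull set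
behind the κ-refinement, `kappaSet = {1,9,25,27,49,81}` (`∑ k̂(s)/s = 1.29497`, 85.5 percent of `1/C₂ = 1.5148`) ↦ the
25 odd `{3,5,7,11,13,17,19}`-smooth squarefull `s ≤ 2048` (`∑ k̂(s)/s = 1.41732`, 93.6 percent); the `8·25 = 200` cells then
dominate `TlowK2(l) = 0.3529 l² − 1.2813 l + 1.2789` (leading coefficient vs `0.3224`; truth `1/(4C₂) = 0.3787`), valid for
`X ≥ 2^18` (cells need `2^7·2025 ≤ X`).  The cell sum is bounded through its three moments
`∑ k̂/s`, `∑ (k̂/s)·logUb2`, `∑ (k̂/s)·logUb2²` (no symbolic 200-term expansion). -/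

/-- The odd `19`-smooth squarefull numbers `≤ 2048`. [folklore] -/
def kappaSet2 : Finset ℕ := {1, 9, 25, 27, 49, 81, 121, 125, 169, 225, 243, 289, 343, 361, 441, 625, 675, 729, 1089, 1125, 1225, 1323, 1331, 1521, 2025}

/-- Its elements are odd. [folklore] -/
private theorem kappaSet2_odd : ∀ s ∈ kappaSet2, Odd s := by
  intro s hs
  simp only [kappaSet2, mem_insert, mem_singleton] at hs
  rcases hs with rfl | rfl | rfl | rfl | rfl | rfl | rfl | rfl | rfl | rfl | rfl | rfl | rfl | rfl | rfl | rfl | rfl | rfl | rfl | rfl | rfl | rfl | rfl | rfl | rfl <;> decide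

/-- Its elements are `≤ 2025`. [folklore] -/
private theorem kappaSet2_le : ∀ s ∈ kappaSet2, s ≤ 2025 := by
  intro s hs
  simp only [kappaSet2, mem_insert, mem_singleton] at hs
  rcases hs with rfl | rfl | rfl | rfl | rfl | rfl | rfl | rfl | rfl | rfl | rfl | rfl | rfl | rfl | rfl | rfl | rfl | rfl | rfl | rfl | rfl | rfl | rfl | rfl | rfl <;> norm_num

/-- `k̂` is multiplicative on coprime arguments. [folklore] -/
private theorem khat_mul_coprime {m n : ℕ} (h : m.Coprime n) : khat (m * n) = khat m * khat n :=
  (isMultiplicative_factorizationProd khatCoeff).map_mul_of_coprime h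

/-- `k̂(1) = 1`. [folklore] -/
private theorem khat2_1 : khat 1 = 1 := by
  rw [show (1 : ℕ) = 3 ^ 0 by norm_num, khat_prime_pow (p := 3) (by norm_num) 0]; rfl

/-- `k̂(9) = 1` (`9 = 3^2`). [folklore] -/
private theorem khat2_9 : khat 9 = 1 := by
  rw [show (9 : ℕ) = 3 ^ 2 by norm_num, khat_prime_pow (p := 3) (by norm_num) 2]; rfl

/-- `k̂(25) = 1` (`25 = 5^2`). [folklore] -/
private theorem khat2_25 : khat 25 = 1 := by
  rw [show (25 : ℕ) = 5 ^ 2 by norm_num, khat_prime_pow (p := 5) (by norm_num) 2]; rfl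

/-- `k̂(27) = 2` (`27 = 3^3`). [folklore] -/
private theorem khat2_27 : khat 27 = 2 := by
  rw [show (27 : ℕ) = 3 ^ 3 by norm_num, khat_prime_pow (p := 3) (by norm_num) 3]; rfl

/-- `k̂(49) = 1` (`49 = 7^2`). [folklore] -/
private theorem khat2_49 : khat 49 = 1 := by
  rw [show (49 : ℕ) = 7 ^ 2 by norm_num, khat_prime_pow (p := 7) (by norm_num) 2]; rfl

/-- `k̂(81) = 4` (`81 = 3^4`). [folklore] -/
private theorem khat2_81 : khat 81 = 4 := by
  rw [show (81 : ℕ) = 3 ^ 4 by norm_num, khat_prime_pow (p := 3) (by norm_num) 4]; rfl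

/-- `k̂(121) = 1` (`121 = 11^2`). [folklore] -/
private theorem khat2_121 : khat 121 = 1 := by
  rw [show (121 : ℕ) = 11 ^ 2 by norm_num, khat_prime_pow (p := 11) (by norm_num) 2]; rfl

/-- `k̂(125) = 2` (`125 = 5^3`). [folklore] -/
private theorem khat2_125 : khat 125 = 2 := by
  rw [show (125 : ℕ) = 5 ^ 3 by norm_num, khat_prime_pow (p := 5) (by norm_num) 3]; rfl

/-- `k̂(169) = 1` (`169 = 13^2`). [folklore] -/
private theorem khat2_169 : khat 169 = 1 := by
  rw [show (169 : ℕ) = 13 ^ 2 by norm_num, khat_prime_pow (p := 13) (by norm_num) 2]; rfl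

/-- `k̂(225) = 1` (`225 = 3^2·5^2`). [folklore] -/
private theorem khat2_225 : khat 225 = 1 := by
  rw [show (225 : ℕ) = 3 ^ 2 * 5 ^ 2 by norm_num, khat_mul_coprime (by norm_num),
    khat_prime_pow (p := 3) (by norm_num) 2, khat_prime_pow (p := 5) (by norm_num) 2]; rfl

/-- `k̂(243) = 8` (`243 = 3^5`). [folklore] -/
private theorem khat2_243 : khat 243 = 8 := by
  rw [show (243 : ℕ) = 3 ^ 5 by norm_num, khat_prime_pow (p := 3) (by norm_num) 5]; rfl

/-- `k̂(289) = 1` (`289 = 17^2`). [folklore] -/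
private theorem khat2_289 : khat 289 = 1 := by
  rw [show (289 : ℕ) = 17 ^ 2 by norm_num, khat_prime_pow (p := 17) (by norm_num) 2]; rfl

/-- `k̂(343) = 2` (`343 = 7^3`). [folklore] -/
private theorem khat2_343 : khat 343 = 2 := by
  rw [show (343 : ℕ) = 7 ^ 3 by norm_num, khat_prime_pow (p := 7) (by norm_num) 3]; rfl

/-- `k̂(361) = 1` (`361 = 19^2`). [folklore] -/
private theorem khat2_361 : khat 361 = 1 := by
  rw [show (361 : ℕ) = 19 ^ 2 by norm_num, khat_prime_pow (p := 19) (by norm_num) 2]; rfl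

/-- `k̂(441) = 1` (`441 = 3^2·7^2`). [folklore] -/
private theorem khat2_441 : khat 441 = 1 := by
  rw [show (441 : ℕ) = 3 ^ 2 * 7 ^ 2 by norm_num, khat_mul_coprime (by norm_num),
    khat_prime_pow (p := 3) (by norm_num) 2, khat_prime_pow (p := 7) (by norm_num) 2]; rfl

/-- `k̂(625) = 4` (`625 = 5^4`). [folklore] -/
private theorem khat2_625 : khat 625 = 4 := by
  rw [show (625 : ℕ) = 5 ^ 4 by norm_num, khat_prime_pow (p := 5) (by norm_num) 4]; rfl

/-- `k̂(675) = 2` (`675 = 3^3·5^2`). [folklore] -/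
private theorem khat2_675 : khat 675 = 2 := by
  rw [show (675 : ℕ) = 3 ^ 3 * 5 ^ 2 by norm_num, khat_mul_coprime (by norm_num),
    khat_prime_pow (p := 3) (by norm_num) 3, khat_prime_pow (p := 5) (by norm_num) 2]; rfl

/-- `k̂(729) = 16` (`729 = 3^6`). [folklore] -/
private theorem khat2_729 : khat 729 = 16 := by
  rw [show (729 : ℕ) = 3 ^ 6 by norm_num, khat_prime_pow (p := 3) (by norm_num) 6]; rfl

/-- `k̂(1089) = 1` (`1089 = 3^2·11^2`). [folklore] -/
private theorem khat2_1089 : khat 1089 = 1 := by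
  rw [show (1089 : ℕ) = 3 ^ 2 * 11 ^ 2 by norm_num, khat_mul_coprime (by norm_num),
    khat_prime_pow (p := 3) (by norm_num) 2, khat_prime_pow (p := 11) (by norm_num) 2]; rfl

/-- `k̂(1125) = 2` (`1125 = 3^2·5^3`). [folklore] -/
private theorem khat2_1125 : khat 1125 = 2 := by
  rw [show (1125 : ℕ) = 3 ^ 2 * 5 ^ 3 by norm_num, khat_mul_coprime (by norm_num),
    khat_prime_pow (p := 3) (by norm_num) 2, khat_prime_pow (p := 5) (by norm_num) 3]; rfl

/-- `k̂(1225) = 1` (`1225 = 5^2·7^2`). [folklore] -/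
private theorem khat2_1225 : khat 1225 = 1 := by
  rw [show (1225 : ℕ) = 5 ^ 2 * 7 ^ 2 by norm_num, khat_mul_coprime (by norm_num),
    khat_prime_pow (p := 5) (by norm_num) 2, khat_prime_pow (p := 7) (by norm_num) 2]; rfl

/-- `k̂(1323) = 2` (`1323 = 3^3·7^2`). [folklore] -/
private theorem khat2_1323 : khat 1323 = 2 := by
  rw [show (1323 : ℕ) = 3 ^ 3 * 7 ^ 2 by norm_num, khat_mul_coprime (by norm_num),
    khat_prime_pow (p := 3) (by norm_num) 3, khat_prime_pow (p := 7) (by norm_num) 2]; rfl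

/-- `k̂(1331) = 2` (`1331 = 11^3`). [folklore] -/
private theorem khat2_1331 : khat 1331 = 2 := by
  rw [show (1331 : ℕ) = 11 ^ 3 by norm_num, khat_prime_pow (p := 11) (by norm_num) 3]; rfl

/-- `k̂(1521) = 1` (`1521 = 3^2·13^2`). [folklore] -/
private theorem khat2_1521 : khat 1521 = 1 := by
  rw [show (1521 : ℕ) = 3 ^ 2 * 13 ^ 2 by norm_num, khat_mul_coprime (by norm_num),
    khat_prime_pow (p := 3) (by norm_num) 2, khat_prime_pow (p := 13) (by norm_num) 2]; rfl

/-- `k̂(2025) = 4` (`2025 = 3^4·5^2`). [folklore] -/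
private theorem khat2_2025 : khat 2025 = 4 := by
  rw [show (2025 : ℕ) = 3 ^ 4 * 5 ^ 2 by norm_num, khat_mul_coprime (by norm_num),
    khat_prime_pow (p := 3) (by norm_num) 4, khat_prime_pow (p := 5) (by norm_num) 2]; rfl

/-- Numerical: `log 3 ≤ 1.0988`. [folklore] -/
private theorem logb_3 : Real.log 3 ≤ 1.0988 := by
  rw [Real.log_le_iff_le_exp (by norm_num)]
  refine le_trans ?_ (Real.sum_le_exp_of_nonneg (by norm_num) 7)
  simp only [Finset.sum_range_succ, Finset.sum_range_zero, Nat.factorial]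
  norm_num

/-- Numerical: `log 5 ≤ 1.6096`. [folklore] -/
private theorem logb_5 : Real.log 5 ≤ 1.6096 := by
  rw [Real.log_le_iff_le_exp (by norm_num)]
  refine le_trans ?_ (Real.sum_le_exp_of_nonneg (by norm_num) 9)
  simp only [Finset.sum_range_succ, Finset.sum_range_zero, Nat.factorial]
  norm_num

/-- Numerical: `log 7 ≤ 1.9461`. [folklore] -/
private theorem logb_7 : Real.log 7 ≤ 1.9461 := by
  rw [Real.log_le_iff_le_exp (by norm_num)]
  refine le_trans ?_ (Real.sum_le_exp_of_nonneg (by norm_num) 10)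
  simp only [Finset.sum_range_succ, Finset.sum_range_zero, Nat.factorial]
  norm_num

/-- Numerical: `log 11 ≤ 2.3981`. [folklore] -/
private theorem logb_11 : Real.log 11 ≤ 2.3981 := by
  rw [Real.log_le_iff_le_exp (by norm_num)]
  refine le_trans ?_ (Real.sum_le_exp_of_nonneg (by norm_num) 10)
  simp only [Finset.sum_range_succ, Finset.sum_range_zero, Nat.factorial]
  norm_num

/-- Numerical: `log 13 ≤ 2.5651`. [folklore] -/
private theorem logb_13 : Real.log 13 ≤ 2.5651 := by
  rw [Real.log_le_iff_le_exp (by norm_num)]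
  refine le_trans ?_ (Real.sum_le_exp_of_nonneg (by norm_num) 11)
  simp only [Finset.sum_range_succ, Finset.sum_range_zero, Nat.factorial]
  norm_num

/-- Numerical: `log 17 ≤ 2.8334`. [folklore] -/
private theorem logb_17 : Real.log 17 ≤ 2.8334 := by
  rw [Real.log_le_iff_le_exp (by norm_num)]
  refine le_trans ?_ (Real.sum_le_exp_of_nonneg (by norm_num) 11)
  simp only [Finset.sum_range_succ, Finset.sum_range_zero, Nat.factorial]
  norm_num

/-- Numerical: `log 19 ≤ 2.9446`. [folklore] -/
private theorem logb_19 : Real.log 19 ≤ 2.9446 := by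
  rw [Real.log_le_iff_le_exp (by norm_num)]
  refine le_trans ?_ (Real.sum_le_exp_of_nonneg (by norm_num) 12)
  simp only [Finset.sum_range_succ, Finset.sum_range_zero, Nat.factorial]
  norm_num

/-- Rational upper bounds `logUb2 s ≥ log s` on `kappaSet2` (`logUb2 1 = 0`). [folklore] -/
noncomputable def logUb2 (s : ℕ) : ℝ :=
  if s = 9 then 2.1976
  else if s = 25 then 3.2192
  else if s = 27 then 3.2964
  else if s = 49 then 3.8922
  else if s = 81 then 4.3952
  else if s = 121 then 4.7962
  else if s = 125 then 4.8288
  else if s = 169 then 5.1302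
  else if s = 225 then 5.4168
  else if s = 243 then 5.494
  else if s = 289 then 5.6668
  else if s = 343 then 5.8383
  else if s = 361 then 5.8892
  else if s = 441 then 6.0898
  else if s = 625 then 6.4384
  else if s = 675 then 6.5156
  else if s = 729 then 6.5928
  else if s = 1089 then 6.9938
  else if s = 1125 then 7.0264
  else if s = 1225 then 7.1114
  else if s = 1323 then 7.1886
  else if s = 1331 then 7.1943
  else if s = 1521 then 7.3278
  else if s = 2025 then 7.6144 else 0

/-- `log s ≤ logUb2 s` on `kappaSet2`. [folklore] -/
private theorem log_le_logUb2 : ∀ s ∈ kappaSet2, Real.log s ≤ logUb2 s := by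
  intro s hs
  simp only [kappaSet2, mem_insert, mem_singleton] at hs
  rcases hs with rfl | rfl | rfl | rfl | rfl | rfl | rfl | rfl | rfl | rfl | rfl | rfl | rfl | rfl | rfl | rfl | rfl | rfl | rfl | rfl | rfl | rfl | rfl | rfl | rfl
  · simp [logUb2]
  · rw [show ((9 : ℕ) : ℝ) = (3 : ℝ) ^ 2 by norm_num, Real.log_pow]; norm_num [logUb2]
    linarith [logb_3]
  · rw [show ((25 : ℕ) : ℝ) = (5 : ℝ) ^ 2 by norm_num, Real.log_pow]; norm_num [logUb2]
    linarith [logb_5]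
  · rw [show ((27 : ℕ) : ℝ) = (3 : ℝ) ^ 3 by norm_num, Real.log_pow]; norm_num [logUb2]
    linarith [logb_3]
  · rw [show ((49 : ℕ) : ℝ) = (7 : ℝ) ^ 2 by norm_num, Real.log_pow]; norm_num [logUb2]
    linarith [logb_7]
  · rw [show ((81 : ℕ) : ℝ) = (3 : ℝ) ^ 4 by norm_num, Real.log_pow]; norm_num [logUb2]
    linarith [logb_3]
  · rw [show ((121 : ℕ) : ℝ) = (11 : ℝ) ^ 2 by norm_num, Real.log_pow]; norm_num [logUb2]
    linarith [logb_11]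
  · rw [show ((125 : ℕ) : ℝ) = (5 : ℝ) ^ 3 by norm_num, Real.log_pow]; norm_num [logUb2]
    linarith [logb_5]
  · rw [show ((169 : ℕ) : ℝ) = (13 : ℝ) ^ 2 by norm_num, Real.log_pow]; norm_num [logUb2]
    linarith [logb_13]
  · rw [show ((225 : ℕ) : ℝ) = (3 : ℝ) ^ 2 * (5 : ℝ) ^ 2 by norm_num,
      Real.log_mul (by positivity) (by positivity), Real.log_pow, Real.log_pow]; norm_num [logUb2]
    linarith [logb_3, logb_5]
  · rw [show ((243 : ℕ) : ℝ) = (3 : ℝ) ^ 5 by norm_num, Real.log_pow]; norm_num [logUb2]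
    linarith [logb_3]
  · rw [show ((289 : ℕ) : ℝ) = (17 : ℝ) ^ 2 by norm_num, Real.log_pow]; norm_num [logUb2]
    linarith [logb_17]
  · rw [show ((343 : ℕ) : ℝ) = (7 : ℝ) ^ 3 by norm_num, Real.log_pow]; norm_num [logUb2]
    linarith [logb_7]
  · rw [show ((361 : ℕ) : ℝ) = (19 : ℝ) ^ 2 by norm_num, Real.log_pow]; norm_num [logUb2]
    linarith [logb_19]
  · rw [show ((441 : ℕ) : ℝ) = (3 : ℝ) ^ 2 * (7 : ℝ) ^ 2 by norm_num,
      Real.log_mul (by positivity) (by positivity), Real.log_pow, Real.log_pow]; norm_num [logUb2]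
    linarith [logb_3, logb_7]
  · rw [show ((625 : ℕ) : ℝ) = (5 : ℝ) ^ 4 by norm_num, Real.log_pow]; norm_num [logUb2]
    linarith [logb_5]
  · rw [show ((675 : ℕ) : ℝ) = (3 : ℝ) ^ 3 * (5 : ℝ) ^ 2 by norm_num,
      Real.log_mul (by positivity) (by positivity), Real.log_pow, Real.log_pow]; norm_num [logUb2]
    linarith [logb_3, logb_5]
  · rw [show ((729 : ℕ) : ℝ) = (3 : ℝ) ^ 6 by norm_num, Real.log_pow]; norm_num [logUb2]
    linarith [logb_3]
  · rw [show ((1089 : ℕ) : ℝ) = (3 : ℝ) ^ 2 * (11 : ℝ) ^ 2 by norm_num,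
      Real.log_mul (by positivity) (by positivity), Real.log_pow, Real.log_pow]; norm_num [logUb2]
    linarith [logb_3, logb_11]
  · rw [show ((1125 : ℕ) : ℝ) = (3 : ℝ) ^ 2 * (5 : ℝ) ^ 3 by norm_num,
      Real.log_mul (by positivity) (by positivity), Real.log_pow, Real.log_pow]; norm_num [logUb2]
    linarith [logb_3, logb_5]
  · rw [show ((1225 : ℕ) : ℝ) = (5 : ℝ) ^ 2 * (7 : ℝ) ^ 2 by norm_num,
      Real.log_mul (by positivity) (by positivity), Real.log_pow, Real.log_pow]; norm_num [logUb2]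
    linarith [logb_5, logb_7]
  · rw [show ((1323 : ℕ) : ℝ) = (3 : ℝ) ^ 3 * (7 : ℝ) ^ 2 by norm_num,
      Real.log_mul (by positivity) (by positivity), Real.log_pow, Real.log_pow]; norm_num [logUb2]
    linarith [logb_3, logb_7]
  · rw [show ((1331 : ℕ) : ℝ) = (11 : ℝ) ^ 3 by norm_num, Real.log_pow]; norm_num [logUb2]
    linarith [logb_11]
  · rw [show ((1521 : ℕ) : ℝ) = (3 : ℝ) ^ 2 * (13 : ℝ) ^ 2 by norm_num,
      Real.log_mul (by positivity) (by positivity), Real.log_pow, Real.log_pow]; norm_num [logUb2]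
    linarith [logb_3, logb_13]
  · rw [show ((2025 : ℕ) : ℝ) = (3 : ℝ) ^ 4 * (5 : ℝ) ^ 2 by norm_num,
      Real.log_mul (by positivity) (by positivity), Real.log_pow, Real.log_pow]; norm_num [logUb2]
    linarith [logb_3, logb_5]

/-- `logUb2 s ≤ 7.6144` on `kappaSet2`. [folklore] -/
private theorem logUb2_le : ∀ s ∈ kappaSet2, logUb2 s ≤ 7.6144 := by
  intro s hs
  simp only [kappaSet2, mem_insert, mem_singleton] at hs
  rcases hs with rfl | rfl | rfl | rfl | rfl | rfl | rfl | rfl | rfl | rfl | rfl | rfl | rfl | rfl | rfl | rfl | rfl | rfl | rfl | rfl | rfl | rfl | rfl | rfl | rfl <;> norm_num [logUb2]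

/-- `U₂(a,s) = a·0.6931472 + logUb2 s ≥ a log 2 + log s`. [folklore] -/
noncomputable def Ub2 (a s : ℕ) : ℝ := (a : ℝ) * 0.6931472 + logUb2 s

/-- One `(a, s)` cell: for `2^a s ≤ X` and `log X ≥ U(a,s)`,
`k̂(s)/s·(⅛(log X − U(a,s))² − 8/15) ≤ k̂(s)/s · D_odd(X/2^a/s)`. [folklore] -/
private theorem kappa_cell_ge2 {X a s : ℕ} (hs : s ∈ kappaSet2) (hX : 2 ^ a * s ≤ X) (hl : Ub2 a s ≤ Real.log X) :
    (khat s : ℝ) / s * ((1 / 8) * (Real.log X - Ub2 a s) ^ 2 - 8 / 15)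
      ≤ (khat s : ℝ) / s * Dodd (X / 2 ^ a / s) := by
  have hs1 : 1 ≤ s := (kappaSet2_odd s hs).pos
  have hsR : (0 : ℝ) < s := by exact_mod_cast hs1
  have hX0 : (0 : ℝ) < X := by
    have : 0 < X := lt_of_lt_of_le (Nat.mul_pos (by positivity) hs1) hX
    exact_mod_cast this
  refine mul_le_mul_of_nonneg_left ?_ (by positivity)
  have hy : (1 : ℝ) ≤ (X : ℝ) / ((2 : ℝ) ^ a * s) := by
    rw [le_div_iff₀ (by positivity), one_mul]
    exact_mod_cast hX
  have h := Dodd_ge hy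
  have hfloor : ⌊(X : ℝ) / ((2 : ℝ) ^ a * s)⌋₊ = X / 2 ^ a / s := by
    rw [show ((2 : ℝ) ^ a * s) = ((2 ^ a * s : ℕ) : ℝ) by push_cast; ring, Nat.floor_div_eq_div,
      Nat.div_div_eq_div_mul]
  have hlog : Real.log ((X : ℝ) / ((2 : ℝ) ^ a * s)) = Real.log X - a * Real.log 2 - Real.log s := by
    rw [Real.log_div hX0.ne' (by positivity), Real.log_mul (by positivity) hsR.ne', Real.log_pow]
    ring
  rw [hfloor, hlog] at h
  refine le_trans ?_ h
  have hU : (a : ℝ) * Real.log 2 + Real.log s ≤ Ub2 a s := by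
    unfold Ub2
    have h2 : Real.log 2 ≤ 0.6931472 := by linarith [Real.log_two_lt_d9]
    have := log_le_logUb2 s hs
    nlinarith [h2, this, Nat.cast_nonneg (α := ℝ) a]
  have h0 : 0 ≤ Real.log X - Ub2 a s := by linarith
  have hsq : (Real.log X - Ub2 a s) ^ 2 ≤ (Real.log X - a * Real.log 2 - Real.log s) ^ 2 :=
    pow_le_pow_left₀ h0 (by linarith) 2
  linarith

/-- One dyadic level, κ-refined: for `2^a·2025 ≤ X` and `log X ≥ 12.47`,
`∑_{s ∈ kappaSet2} k̂(s)/s·(⅛(log X − U(a,s))² − 8/15) ≤ ∑_{m ≤ X/2^a odd} f̃(m)`. [folklore] -/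
private theorem sum_ft_odd_level_ge_kappa2 {X a : ℕ} (ha : a ≤ 7) (hX : 2 ^ a * 2025 ≤ X)
    (hl : 12.47 ≤ Real.log X) :
    ∑ s ∈ kappaSet2, (khat s : ℝ) / s * ((1 / 8) * (Real.log X - Ub2 a s) ^ 2 - 8 / 15)
      ≤ ∑ m ∈ oddIcc (X / 2 ^ a), ft m := by
  refine le_trans ?_ (sum_khat_Dodd_le_sum_ft kappaSet2 kappaSet2_odd (X / 2 ^ a))
  refine sum_le_sum fun s hs => kappa_cell_ge2 hs ?_ ?_
  · exact le_trans (Nat.mul_le_mul_left _ (kappaSet2_le s hs)) hX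
  · have ha7 : (a : ℝ) ≤ 7 := by exact_mod_cast ha
    have := logUb2_le s hs
    unfold Ub2
    nlinarith [this, ha7, Nat.cast_nonneg (α := ℝ) a]

/-! ### §9b  The three moments of `kappaSet2` and the cell polynomial `TlowK2` -/

set_option maxHeartbeats 1000000 in
/-- `∑ k̂(s)/s ≥ 1.417323`. [folklore] -/
private theorem sum_w_ge : (1.417323 : ℝ) ≤ ∑ s ∈ kappaSet2, (khat s : ℝ) / s := by
  norm_num [kappaSet2, khat2_1, khat2_9, khat2_25, khat2_27, khat2_49, khat2_81, khat2_121, khat2_125, khat2_169, khat2_225, khat2_243, khat2_289, khat2_343, khat2_361, khat2_441, khat2_625, khat2_675, khat2_729, khat2_1089, khat2_1125, khat2_1225, khat2_1323, khat2_1331, khat2_1521, khat2_2025]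

set_option maxHeartbeats 1000000 in
/-- `∑ k̂(s)/s ≤ 1.417324`. [folklore] -/
private theorem sum_w_le : ∑ s ∈ kappaSet2, (khat s : ℝ) / s ≤ 1.417324 := by
  norm_num [kappaSet2, khat2_1, khat2_9, khat2_25, khat2_27, khat2_49, khat2_81, khat2_121, khat2_125, khat2_169, khat2_225, khat2_243, khat2_289, khat2_343, khat2_361, khat2_441, khat2_625, khat2_675, khat2_729, khat2_1089, khat2_1125, khat2_1225, khat2_1323, khat2_1331, khat2_1521, khat2_2025]

set_option maxHeartbeats 1000000 in
/-- `∑ (k̂(s)/s)·logUb2 s ≤ 1.621043`. [folklore] -/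
private theorem sum_wu_le : ∑ s ∈ kappaSet2, (khat s : ℝ) / s * logUb2 s ≤ 1.621043 := by
  norm_num [kappaSet2, khat2_1, khat2_9, khat2_25, khat2_27, khat2_49, khat2_81, khat2_121, khat2_125, khat2_169, khat2_225, khat2_243, khat2_289, khat2_343, khat2_361, khat2_441, khat2_625, khat2_675, khat2_729, khat2_1089, khat2_1125, khat2_1225, khat2_1323, khat2_1331, khat2_1521, khat2_2025, logUb2]

set_option maxHeartbeats 1000000 in
/-- `∑ (k̂(s)/s)·(logUb2 s)² ≥ 7.176994`. [folklore] -/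
private theorem sum_wu2_ge : (7.176994 : ℝ) ≤ ∑ s ∈ kappaSet2, (khat s : ℝ) / s * logUb2 s ^ 2 := by
  norm_num [kappaSet2, khat2_1, khat2_9, khat2_25, khat2_27, khat2_49, khat2_81, khat2_121, khat2_125, khat2_169, khat2_225, khat2_243, khat2_289, khat2_343, khat2_361, khat2_441, khat2_625, khat2_675, khat2_729, khat2_1089, khat2_1125, khat2_1225, khat2_1323, khat2_1331, khat2_1521, khat2_2025, logUb2]

/-- One level through the moments: for `l ≥ 12.47`, `a ≤ 7`, with `m = l − a·0.6931472 ≥ 0`,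
`∑_s k̂/s·(⅛(l − U₂(a,s))² − 8/15) ≥ ⅛(1.417323 m² − 2·1.621043 m + 7.176994) − (8/15)·1.417324`. [folklore] -/
private theorem level_ge2 {l : ℝ} {a : ℕ} (hl : 12.47 ≤ l) (ha : a ≤ 7) :
    (1 / 8) * (1.417323 * (l - a * 0.6931472) ^ 2 - 2 * 1.621043 * (l - a * 0.6931472) + 7.176994)
        - (8 / 15) * 1.417324
      ≤ ∑ s ∈ kappaSet2, (khat s : ℝ) / s * ((1 / 8) * (l - Ub2 a s) ^ 2 - 8 / 15) := by
  have ha7 : (a : ℝ) ≤ 7 := by exact_mod_cast ha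
  set m : ℝ := l - a * 0.6931472 with hm
  have hm0 : 0 ≤ m := by rw [hm]; nlinarith [hl, ha7, Nat.cast_nonneg (α := ℝ) a]
  have hcell : ∀ s ∈ kappaSet2, (khat s : ℝ) / s * ((1 / 8) * (l - Ub2 a s) ^ 2 - 8 / 15)
      = (1 / 8) * m ^ 2 * ((khat s : ℝ) / s) - (1 / 4) * m * ((khat s : ℝ) / s * logUb2 s)
        + (1 / 8) * ((khat s : ℝ) / s * logUb2 s ^ 2) - (8 / 15) * ((khat s : ℝ) / s) := by
    intro s _
    rw [hm, Ub2]; ring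
  rw [sum_congr rfl hcell, sum_sub_distrib, sum_add_distrib, sum_sub_distrib, ← mul_sum, ← mul_sum, ← mul_sum,
    ← mul_sum]
  have h1 := mul_nonneg (sub_nonneg.2 sum_w_ge) (sq_nonneg m)
  have h2 := mul_nonneg (sub_nonneg.2 sum_wu_le) hm0
  have h3 := sum_wu2_ge
  have h4 := sum_w_le
  nlinarith [h1, h2, h3, h4]

/-- The enlarged κ-refined explicit minorant of `T(X)` (and `Q_∅(X)`) as a function of `l = log X`:
`0.3529 l² − 1.2813 l + 1.2789` (rounded down from the 8-level moment bound; `0.3529/0.3787 = 0.932` of the truth). [folklore] -/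
noncomputable def TlowK2 (l : ℝ) : ℝ := 0.3529 * l ^ 2 - 1.2813 * l + 1.2789

/-- `TlowK2` is below the 8-level moment polynomial. [folklore] -/
private theorem TlowK2_le_levels {l : ℝ} (hl : 12.47 ≤ l) :
    TlowK2 l ≤ ∑ a ∈ range 8, (1 / 2 : ℝ) ^ a *
      ((1 / 8) * (1.417323 * (l - a * 0.6931472) ^ 2 - 2 * 1.621043 * (l - a * 0.6931472) + 7.176994)
        - (8 / 15) * 1.417324) := by
  norm_num [Finset.sum_range_succ, TlowK2]
  nlinarith [hl, sq_nonneg l]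

/-- The cell sum dominates `TlowK2`. [folklore] -/
private theorem TlowK2_le_cells {l : ℝ} (hl : 12.47 ≤ l) :
    TlowK2 l ≤ ∑ a ∈ range 8, (1 / 2 : ℝ) ^ a *
      ∑ s ∈ kappaSet2, (khat s : ℝ) / s * ((1 / 8) * (l - Ub2 a s) ^ 2 - 8 / 15) := by
  refine le_trans (TlowK2_le_levels hl) (sum_le_sum fun a ha => ?_)
  have ha7 : a ≤ 7 := by rw [mem_range] at ha; omega
  exact mul_le_mul_of_nonneg_left (level_ge2 hl ha7) (by positivity)

/-- **ENLARGED κ-REFINED EXPLICIT TWO-RESIDUE SELBERG SUM** (ROUND-38 «CELLS»): for `X ≥ 2^{18}`,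
`∑_{n ≤ X} f̃(n) ≥ TlowK2 (log X)`. [cite: BatemanDiamond2004, Lemma 13.11, p. 327 (explicit weaker lower bound proved here)] -/
theorem sum_ft_ge_kappa2 {X : ℕ} (hX : 262144 ≤ X) :
    TlowK2 (Real.log X) ≤ ∑ n ∈ Icc 1 X, ft n := by
  have hXR : (262144 : ℝ) ≤ X := by exact_mod_cast hX
  have hl : 12.47 ≤ Real.log X := by
    have h1 : Real.log ((2 : ℝ) ^ 18) ≤ Real.log X :=
      Real.log_le_log (by positivity) (by norm_num; exact_mod_cast hXR)
    rw [Real.log_pow] at h1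
    have h2 := Real.log_two_gt_d9
    push_cast at h1
    linarith
  refine le_trans (TlowK2_le_cells hl) ?_
  refine le_trans ?_ (sum_ft_ge_dyadic X 7)
  refine sum_le_sum fun a ha => ?_
  have ha7 : a ≤ 7 := by rw [mem_range] at ha; omega
  refine mul_le_mul_of_nonneg_left (sum_ft_odd_level_ge_kappa2 ha7 ?_ hl) (by positivity)
  calc 2 ^ a * 2025 ≤ 2 ^ 7 * 2025 := Nat.mul_le_mul_right _ (Nat.pow_le_pow_right (by norm_num) ha7)
    _ ≤ X := by norm_num; omega

/-- `Q_∅(X) ≥ TlowK2(log X)` for `X ≥ 2^{18}` (chained with `sum_ft_le_Qsum`). [cite: BatemanDiamond2004, Lemma 13.11, p. 327 (explicit weaker lower bound proved here)] -/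
theorem Qsum_ge_kappa2 {X : ℕ} (hX : 262144 ≤ X) : TlowK2 (Real.log X) ≤ Qsum ∅ X := by
  have h := sum_ft_ge_kappa2 hX
  have hI : Ioc 0 X = Icc 1 X := rfl
  have h2 := sum_ft_le_Qsum X
  rw [hI] at h2
  linarith

/-! ## §10  κ-refinement III (cell parity-ideate p5 ROUND-40 «CELLS-2»): the enlarged squarefull set `kappaSet3` and the cell polynomial `TlowK3`

ONE input varied relative to the tree's `TwoResidueSelbergExplicit.sum_ft_ge_kappa`: the finite odd squarefull set
behind the κ-refinement, `kappaSet = {1,9,25,27,49,81}` (`∑ k̂(s)/s = 1.29497`, 85.5 percent of `1/C₂ = 1.5148`) ↦ the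
68 odd `{3,5,7,11,13,17,19}`-smooth squarefull `s ≤ 20000` (`∑ k̂(s)/s = 1.46912`, 97.0 percent); the `8·68 = 544` cells then
dominate `TlowK3(l) = 0.3658 l² − 1.5193 l + 2.3407` (leading coefficient vs `0.3224`; truth `1/(4C₂) = 0.3787`), valid for
`X ≥ 2^22` (cells need `2^7·19773 ≤ X`).  The cell sum is bounded through its three moments
`∑ k̂/s`, `∑ (k̂/s)·logUb3`, `∑ (k̂/s)·logUb3²` (no symbolic 544-term expansion). -/

/-- The odd `19`-smooth squarefull numbers `≤ 20000`. [folklore] -/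
def kappaSet3 : Finset ℕ := {1, 9, 25, 27, 49, 81, 121, 125, 169, 225, 243, 289, 343, 361, 441, 625, 675, 729, 1089, 1125, 1225, 1323, 1331, 1521, 2025, 2187, 2197, 2401, 2601, 3025, 3087, 3125, 3249, 3267, 3375, 3969, 4225, 4563, 4913, 5625, 5929, 6075, 6125, 6561, 6859, 7225, 7803, 8281, 8575, 9025, 9261, 9747, 9801, 10125, 11025, 11907, 11979, 13689, 14161, 14641, 15125, 15625, 16807, 16875, 17689, 18225, 19683, 19773}

/-- Its elements are odd. [folklore] -/
private theorem kappaSet3_odd : ∀ s ∈ kappaSet3, Odd s := by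
  intro s hs
  simp only [kappaSet3, mem_insert, mem_singleton] at hs
  rcases hs with rfl | rfl | rfl | rfl | rfl | rfl | rfl | rfl | rfl | rfl | rfl | rfl | rfl | rfl | rfl | rfl | rfl | rfl | rfl | rfl | rfl | rfl | rfl | rfl | rfl | rfl | rfl | rfl | rfl | rfl | rfl | rfl | rfl | rfl | rfl | rfl | rfl | rfl | rfl | rfl | rfl | rfl | rfl | rfl | rfl | rfl | rfl | rfl | rfl | rfl | rfl | rfl | rfl | rfl | rfl | rfl | rfl | rfl | rfl | rfl | rfl | rfl | rfl | rfl | rfl | rfl | rfl | rfl <;> decide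

/-- Its elements are `≤ 19773`. [folklore] -/
private theorem kappaSet3_le : ∀ s ∈ kappaSet3, s ≤ 19773 := by
  intro s hs
  simp only [kappaSet3, mem_insert, mem_singleton] at hs
  rcases hs with rfl | rfl | rfl | rfl | rfl | rfl | rfl | rfl | rfl | rfl | rfl | rfl | rfl | rfl | rfl | rfl | rfl | rfl | rfl | rfl | rfl | rfl | rfl | rfl | rfl | rfl | rfl | rfl | rfl | rfl | rfl | rfl | rfl | rfl | rfl | rfl | rfl | rfl | rfl | rfl | rfl | rfl | rfl | rfl | rfl | rfl | rfl | rfl | rfl | rfl | rfl | rfl | rfl | rfl | rfl | rfl | rfl | rfl | rfl | rfl | rfl | rfl | rfl | rfl | rfl | rfl | rfl | rfl <;> norm_num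


/-- `k̂(1) = 1`. [folklore] -/
private theorem khat3_1 : khat 1 = 1 := by
  rw [show (1 : ℕ) = 3 ^ 0 by norm_num, khat_prime_pow (p := 3) (by norm_num) 0]; rfl

/-- `k̂(9) = 1` (`9 = 3^2`). [folklore] -/
private theorem khat3_9 : khat 9 = 1 := by
  rw [show (9 : ℕ) = 3 ^ 2 by norm_num, khat_prime_pow (p := 3) (by norm_num) 2]; rfl

/-- `k̂(25) = 1` (`25 = 5^2`). [folklore] -/
private theorem khat3_25 : khat 25 = 1 := by
  rw [show (25 : ℕ) = 5 ^ 2 by norm_num, khat_prime_pow (p := 5) (by norm_num) 2]; rfl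

/-- `k̂(27) = 2` (`27 = 3^3`). [folklore] -/
private theorem khat3_27 : khat 27 = 2 := by
  rw [show (27 : ℕ) = 3 ^ 3 by norm_num, khat_prime_pow (p := 3) (by norm_num) 3]; rfl

/-- `k̂(49) = 1` (`49 = 7^2`). [folklore] -/
private theorem khat3_49 : khat 49 = 1 := by
  rw [show (49 : ℕ) = 7 ^ 2 by norm_num, khat_prime_pow (p := 7) (by norm_num) 2]; rfl

/-- `k̂(81) = 4` (`81 = 3^4`). [folklore] -/
private theorem khat3_81 : khat 81 = 4 := by
  rw [show (81 : ℕ) = 3 ^ 4 by norm_num, khat_prime_pow (p := 3) (by norm_num) 4]; rfl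

/-- `k̂(121) = 1` (`121 = 11^2`). [folklore] -/
private theorem khat3_121 : khat 121 = 1 := by
  rw [show (121 : ℕ) = 11 ^ 2 by norm_num, khat_prime_pow (p := 11) (by norm_num) 2]; rfl

/-- `k̂(125) = 2` (`125 = 5^3`). [folklore] -/
private theorem khat3_125 : khat 125 = 2 := by
  rw [show (125 : ℕ) = 5 ^ 3 by norm_num, khat_prime_pow (p := 5) (by norm_num) 3]; rfl

/-- `k̂(169) = 1` (`169 = 13^2`). [folklore] -/
private theorem khat3_169 : khat 169 = 1 := by
  rw [show (169 : ℕ) = 13 ^ 2 by norm_num, khat_prime_pow (p := 13) (by norm_num) 2]; rfl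

/-- `k̂(225) = 1` (`225 = 3^2·5^2`). [folklore] -/
private theorem khat3_225 : khat 225 = 1 := by
  rw [show (225 : ℕ) = 3 ^ 2 * 5 ^ 2 by norm_num, khat_mul_coprime (by norm_num),
    khat_prime_pow (p := 3) (by norm_num) 2, khat_prime_pow (p := 5) (by norm_num) 2]; rfl

/-- `k̂(243) = 8` (`243 = 3^5`). [folklore] -/
private theorem khat3_243 : khat 243 = 8 := by
  rw [show (243 : ℕ) = 3 ^ 5 by norm_num, khat_prime_pow (p := 3) (by norm_num) 5]; rfl

/-- `k̂(289) = 1` (`289 = 17^2`). [folklore] -/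
private theorem khat3_289 : khat 289 = 1 := by
  rw [show (289 : ℕ) = 17 ^ 2 by norm_num, khat_prime_pow (p := 17) (by norm_num) 2]; rfl

/-- `k̂(343) = 2` (`343 = 7^3`). [folklore] -/
private theorem khat3_343 : khat 343 = 2 := by
  rw [show (343 : ℕ) = 7 ^ 3 by norm_num, khat_prime_pow (p := 7) (by norm_num) 3]; rfl

/-- `k̂(361) = 1` (`361 = 19^2`). [folklore] -/
private theorem khat3_361 : khat 361 = 1 := by
  rw [show (361 : ℕ) = 19 ^ 2 by norm_num, khat_prime_pow (p := 19) (by norm_num) 2]; rfl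

/-- `k̂(441) = 1` (`441 = 3^2·7^2`). [folklore] -/
private theorem khat3_441 : khat 441 = 1 := by
  rw [show (441 : ℕ) = 3 ^ 2 * 7 ^ 2 by norm_num, khat_mul_coprime (by norm_num),
    khat_prime_pow (p := 3) (by norm_num) 2, khat_prime_pow (p := 7) (by norm_num) 2]; rfl

/-- `k̂(625) = 4` (`625 = 5^4`). [folklore] -/
private theorem khat3_625 : khat 625 = 4 := by
  rw [show (625 : ℕ) = 5 ^ 4 by norm_num, khat_prime_pow (p := 5) (by norm_num) 4]; rfl

/-- `k̂(675) = 2` (`675 = 3^3·5^2`). [folklore] -/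
private theorem khat3_675 : khat 675 = 2 := by
  rw [show (675 : ℕ) = 3 ^ 3 * 5 ^ 2 by norm_num, khat_mul_coprime (by norm_num),
    khat_prime_pow (p := 3) (by norm_num) 3, khat_prime_pow (p := 5) (by norm_num) 2]; rfl

/-- `k̂(729) = 16` (`729 = 3^6`). [folklore] -/
private theorem khat3_729 : khat 729 = 16 := by
  rw [show (729 : ℕ) = 3 ^ 6 by norm_num, khat_prime_pow (p := 3) (by norm_num) 6]; rfl

/-- `k̂(1089) = 1` (`1089 = 3^2·11^2`). [folklore] -/
private theorem khat3_1089 : khat 1089 = 1 := by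
  rw [show (1089 : ℕ) = 3 ^ 2 * 11 ^ 2 by norm_num, khat_mul_coprime (by norm_num),
    khat_prime_pow (p := 3) (by norm_num) 2, khat_prime_pow (p := 11) (by norm_num) 2]; rfl

/-- `k̂(1125) = 2` (`1125 = 3^2·5^3`). [folklore] -/
private theorem khat3_1125 : khat 1125 = 2 := by
  rw [show (1125 : ℕ) = 3 ^ 2 * 5 ^ 3 by norm_num, khat_mul_coprime (by norm_num),
    khat_prime_pow (p := 3) (by norm_num) 2, khat_prime_pow (p := 5) (by norm_num) 3]; rfl

/-- `k̂(1225) = 1` (`1225 = 5^2·7^2`). [folklore] -/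
private theorem khat3_1225 : khat 1225 = 1 := by
  rw [show (1225 : ℕ) = 5 ^ 2 * 7 ^ 2 by norm_num, khat_mul_coprime (by norm_num),
    khat_prime_pow (p := 5) (by norm_num) 2, khat_prime_pow (p := 7) (by norm_num) 2]; rfl

/-- `k̂(1323) = 2` (`1323 = 3^3·7^2`). [folklore] -/
private theorem khat3_1323 : khat 1323 = 2 := by
  rw [show (1323 : ℕ) = 3 ^ 3 * 7 ^ 2 by norm_num, khat_mul_coprime (by norm_num),
    khat_prime_pow (p := 3) (by norm_num) 3, khat_prime_pow (p := 7) (by norm_num) 2]; rfl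

/-- `k̂(1331) = 2` (`1331 = 11^3`). [folklore] -/
private theorem khat3_1331 : khat 1331 = 2 := by
  rw [show (1331 : ℕ) = 11 ^ 3 by norm_num, khat_prime_pow (p := 11) (by norm_num) 3]; rfl

/-- `k̂(1521) = 1` (`1521 = 3^2·13^2`). [folklore] -/
private theorem khat3_1521 : khat 1521 = 1 := by
  rw [show (1521 : ℕ) = 3 ^ 2 * 13 ^ 2 by norm_num, khat_mul_coprime (by norm_num),
    khat_prime_pow (p := 3) (by norm_num) 2, khat_prime_pow (p := 13) (by norm_num) 2]; rfl

/-- `k̂(2025) = 4` (`2025 = 3^4·5^2`). [folklore] -/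
private theorem khat3_2025 : khat 2025 = 4 := by
  rw [show (2025 : ℕ) = 3 ^ 4 * 5 ^ 2 by norm_num, khat_mul_coprime (by norm_num),
    khat_prime_pow (p := 3) (by norm_num) 4, khat_prime_pow (p := 5) (by norm_num) 2]; rfl

/-- `k̂(2187) = 32` (`2187 = 3^7`). [folklore] -/
private theorem khat3_2187 : khat 2187 = 32 := by
  rw [show (2187 : ℕ) = 3 ^ 7 by norm_num, khat_prime_pow (p := 3) (by norm_num) 7]; rfl

/-- `k̂(2197) = 2` (`2197 = 13^3`). [folklore] -/
private theorem khat3_2197 : khat 2197 = 2 := by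
  rw [show (2197 : ℕ) = 13 ^ 3 by norm_num, khat_prime_pow (p := 13) (by norm_num) 3]; rfl

/-- `k̂(2401) = 4` (`2401 = 7^4`). [folklore] -/
private theorem khat3_2401 : khat 2401 = 4 := by
  rw [show (2401 : ℕ) = 7 ^ 4 by norm_num, khat_prime_pow (p := 7) (by norm_num) 4]; rfl

/-- `k̂(2601) = 1` (`2601 = 3^2·17^2`). [folklore] -/
private theorem khat3_2601 : khat 2601 = 1 := by
  rw [show (2601 : ℕ) = 3 ^ 2 * 17 ^ 2 by norm_num, khat_mul_coprime (by norm_num),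
    khat_prime_pow (p := 3) (by norm_num) 2, khat_prime_pow (p := 17) (by norm_num) 2]; rfl

/-- `k̂(3025) = 1` (`3025 = 5^2·11^2`). [folklore] -/
private theorem khat3_3025 : khat 3025 = 1 := by
  rw [show (3025 : ℕ) = 5 ^ 2 * 11 ^ 2 by norm_num, khat_mul_coprime (by norm_num),
    khat_prime_pow (p := 5) (by norm_num) 2, khat_prime_pow (p := 11) (by norm_num) 2]; rfl

/-- `k̂(3087) = 2` (`3087 = 3^2·7^3`). [folklore] -/
private theorem khat3_3087 : khat 3087 = 2 := by
  rw [show (3087 : ℕ) = 3 ^ 2 * 7 ^ 3 by norm_num, khat_mul_coprime (by norm_num),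
    khat_prime_pow (p := 3) (by norm_num) 2, khat_prime_pow (p := 7) (by norm_num) 3]; rfl

/-- `k̂(3125) = 8` (`3125 = 5^5`). [folklore] -/
private theorem khat3_3125 : khat 3125 = 8 := by
  rw [show (3125 : ℕ) = 5 ^ 5 by norm_num, khat_prime_pow (p := 5) (by norm_num) 5]; rfl

/-- `k̂(3249) = 1` (`3249 = 3^2·19^2`). [folklore] -/
private theorem khat3_3249 : khat 3249 = 1 := by
  rw [show (3249 : ℕ) = 3 ^ 2 * 19 ^ 2 by norm_num, khat_mul_coprime (by norm_num),
    khat_prime_pow (p := 3) (by norm_num) 2, khat_prime_pow (p := 19) (by norm_num) 2]; rfl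

/-- `k̂(3267) = 2` (`3267 = 3^3·11^2`). [folklore] -/
private theorem khat3_3267 : khat 3267 = 2 := by
  rw [show (3267 : ℕ) = 3 ^ 3 * 11 ^ 2 by norm_num, khat_mul_coprime (by norm_num),
    khat_prime_pow (p := 3) (by norm_num) 3, khat_prime_pow (p := 11) (by norm_num) 2]; rfl

/-- `k̂(3375) = 4` (`3375 = 3^3·5^3`). [folklore] -/
private theorem khat3_3375 : khat 3375 = 4 := by
  rw [show (3375 : ℕ) = 3 ^ 3 * 5 ^ 3 by norm_num, khat_mul_coprime (by norm_num),
    khat_prime_pow (p := 3) (by norm_num) 3, khat_prime_pow (p := 5) (by norm_num) 3]; rfl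

/-- `k̂(3969) = 4` (`3969 = 3^4·7^2`). [folklore] -/
private theorem khat3_3969 : khat 3969 = 4 := by
  rw [show (3969 : ℕ) = 3 ^ 4 * 7 ^ 2 by norm_num, khat_mul_coprime (by norm_num),
    khat_prime_pow (p := 3) (by norm_num) 4, khat_prime_pow (p := 7) (by norm_num) 2]; rfl

/-- `k̂(4225) = 1` (`4225 = 5^2·13^2`). [folklore] -/
private theorem khat3_4225 : khat 4225 = 1 := by
  rw [show (4225 : ℕ) = 5 ^ 2 * 13 ^ 2 by norm_num, khat_mul_coprime (by norm_num),
    khat_prime_pow (p := 5) (by norm_num) 2, khat_prime_pow (p := 13) (by norm_num) 2]; rfl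

/-- `k̂(4563) = 2` (`4563 = 3^3·13^2`). [folklore] -/
private theorem khat3_4563 : khat 4563 = 2 := by
  rw [show (4563 : ℕ) = 3 ^ 3 * 13 ^ 2 by norm_num, khat_mul_coprime (by norm_num),
    khat_prime_pow (p := 3) (by norm_num) 3, khat_prime_pow (p := 13) (by norm_num) 2]; rfl

/-- `k̂(4913) = 2` (`4913 = 17^3`). [folklore] -/
private theorem khat3_4913 : khat 4913 = 2 := by
  rw [show (4913 : ℕ) = 17 ^ 3 by norm_num, khat_prime_pow (p := 17) (by norm_num) 3]; rfl

/-- `k̂(5625) = 4` (`5625 = 3^2·5^4`). [folklore] -/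
private theorem khat3_5625 : khat 5625 = 4 := by
  rw [show (5625 : ℕ) = 3 ^ 2 * 5 ^ 4 by norm_num, khat_mul_coprime (by norm_num),
    khat_prime_pow (p := 3) (by norm_num) 2, khat_prime_pow (p := 5) (by norm_num) 4]; rfl

/-- `k̂(5929) = 1` (`5929 = 7^2·11^2`). [folklore] -/
private theorem khat3_5929 : khat 5929 = 1 := by
  rw [show (5929 : ℕ) = 7 ^ 2 * 11 ^ 2 by norm_num, khat_mul_coprime (by norm_num),
    khat_prime_pow (p := 7) (by norm_num) 2, khat_prime_pow (p := 11) (by norm_num) 2]; rfl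

/-- `k̂(6075) = 8` (`6075 = 3^5·5^2`). [folklore] -/
private theorem khat3_6075 : khat 6075 = 8 := by
  rw [show (6075 : ℕ) = 3 ^ 5 * 5 ^ 2 by norm_num, khat_mul_coprime (by norm_num),
    khat_prime_pow (p := 3) (by norm_num) 5, khat_prime_pow (p := 5) (by norm_num) 2]; rfl

/-- `k̂(6125) = 2` (`6125 = 5^3·7^2`). [folklore] -/
private theorem khat3_6125 : khat 6125 = 2 := by
  rw [show (6125 : ℕ) = 5 ^ 3 * 7 ^ 2 by norm_num, khat_mul_coprime (by norm_num),
    khat_prime_pow (p := 5) (by norm_num) 3, khat_prime_pow (p := 7) (by norm_num) 2]; rfl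

/-- `k̂(6561) = 64` (`6561 = 3^8`). [folklore] -/
private theorem khat3_6561 : khat 6561 = 64 := by
  rw [show (6561 : ℕ) = 3 ^ 8 by norm_num, khat_prime_pow (p := 3) (by norm_num) 8]; rfl

/-- `k̂(6859) = 2` (`6859 = 19^3`). [folklore] -/
private theorem khat3_6859 : khat 6859 = 2 := by
  rw [show (6859 : ℕ) = 19 ^ 3 by norm_num, khat_prime_pow (p := 19) (by norm_num) 3]; rfl

/-- `k̂(7225) = 1` (`7225 = 5^2·17^2`). [folklore] -/
private theorem khat3_7225 : khat 7225 = 1 := by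
  rw [show (7225 : ℕ) = 5 ^ 2 * 17 ^ 2 by norm_num, khat_mul_coprime (by norm_num),
    khat_prime_pow (p := 5) (by norm_num) 2, khat_prime_pow (p := 17) (by norm_num) 2]; rfl

/-- `k̂(7803) = 2` (`7803 = 3^3·17^2`). [folklore] -/
private theorem khat3_7803 : khat 7803 = 2 := by
  rw [show (7803 : ℕ) = 3 ^ 3 * 17 ^ 2 by norm_num, khat_mul_coprime (by norm_num),
    khat_prime_pow (p := 3) (by norm_num) 3, khat_prime_pow (p := 17) (by norm_num) 2]; rfl

/-- `k̂(8281) = 1` (`8281 = 7^2·13^2`). [folklore] -/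
private theorem khat3_8281 : khat 8281 = 1 := by
  rw [show (8281 : ℕ) = 7 ^ 2 * 13 ^ 2 by norm_num, khat_mul_coprime (by norm_num),
    khat_prime_pow (p := 7) (by norm_num) 2, khat_prime_pow (p := 13) (by norm_num) 2]; rfl

/-- `k̂(8575) = 2` (`8575 = 5^2·7^3`). [folklore] -/
private theorem khat3_8575 : khat 8575 = 2 := by
  rw [show (8575 : ℕ) = 5 ^ 2 * 7 ^ 3 by norm_num, khat_mul_coprime (by norm_num),
    khat_prime_pow (p := 5) (by norm_num) 2, khat_prime_pow (p := 7) (by norm_num) 3]; rfl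

/-- `k̂(9025) = 1` (`9025 = 5^2·19^2`). [folklore] -/
private theorem khat3_9025 : khat 9025 = 1 := by
  rw [show (9025 : ℕ) = 5 ^ 2 * 19 ^ 2 by norm_num, khat_mul_coprime (by norm_num),
    khat_prime_pow (p := 5) (by norm_num) 2, khat_prime_pow (p := 19) (by norm_num) 2]; rfl

/-- `k̂(9261) = 4` (`9261 = 3^3·7^3`). [folklore] -/
private theorem khat3_9261 : khat 9261 = 4 := by
  rw [show (9261 : ℕ) = 3 ^ 3 * 7 ^ 3 by norm_num, khat_mul_coprime (by norm_num),
    khat_prime_pow (p := 3) (by norm_num) 3, khat_prime_pow (p := 7) (by norm_num) 3]; rfl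

/-- `k̂(9747) = 2` (`9747 = 3^3·19^2`). [folklore] -/
private theorem khat3_9747 : khat 9747 = 2 := by
  rw [show (9747 : ℕ) = 3 ^ 3 * 19 ^ 2 by norm_num, khat_mul_coprime (by norm_num),
    khat_prime_pow (p := 3) (by norm_num) 3, khat_prime_pow (p := 19) (by norm_num) 2]; rfl

/-- `k̂(9801) = 4` (`9801 = 3^4·11^2`). [folklore] -/
private theorem khat3_9801 : khat 9801 = 4 := by
  rw [show (9801 : ℕ) = 3 ^ 4 * 11 ^ 2 by norm_num, khat_mul_coprime (by norm_num),
    khat_prime_pow (p := 3) (by norm_num) 4, khat_prime_pow (p := 11) (by norm_num) 2]; rfl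

/-- `k̂(10125) = 8` (`10125 = 3^4·5^3`). [folklore] -/
private theorem khat3_10125 : khat 10125 = 8 := by
  rw [show (10125 : ℕ) = 3 ^ 4 * 5 ^ 3 by norm_num, khat_mul_coprime (by norm_num),
    khat_prime_pow (p := 3) (by norm_num) 4, khat_prime_pow (p := 5) (by norm_num) 3]; rfl

/-- `k̂(11025) = 1` (`11025 = 3^2·5^2·7^2`). [folklore] -/
private theorem khat3_11025 : khat 11025 = 1 := by
  rw [show (11025 : ℕ) = 3 ^ 2 * 5 ^ 2 * 7 ^ 2 by norm_num, khat_mul_coprime (by norm_num),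
    khat_mul_coprime (by norm_num),
    khat_prime_pow (p := 3) (by norm_num) 2, khat_prime_pow (p := 5) (by norm_num) 2,
    khat_prime_pow (p := 7) (by norm_num) 2]; rfl

/-- `k̂(11907) = 8` (`11907 = 3^5·7^2`). [folklore] -/
private theorem khat3_11907 : khat 11907 = 8 := by
  rw [show (11907 : ℕ) = 3 ^ 5 * 7 ^ 2 by norm_num, khat_mul_coprime (by norm_num),
    khat_prime_pow (p := 3) (by norm_num) 5, khat_prime_pow (p := 7) (by norm_num) 2]; rfl

/-- `k̂(11979) = 2` (`11979 = 3^2·11^3`). [folklore] -/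
private theorem khat3_11979 : khat 11979 = 2 := by
  rw [show (11979 : ℕ) = 3 ^ 2 * 11 ^ 3 by norm_num, khat_mul_coprime (by norm_num),
    khat_prime_pow (p := 3) (by norm_num) 2, khat_prime_pow (p := 11) (by norm_num) 3]; rfl

/-- `k̂(13689) = 4` (`13689 = 3^4·13^2`). [folklore] -/
private theorem khat3_13689 : khat 13689 = 4 := by
  rw [show (13689 : ℕ) = 3 ^ 4 * 13 ^ 2 by norm_num, khat_mul_coprime (by norm_num),
    khat_prime_pow (p := 3) (by norm_num) 4, khat_prime_pow (p := 13) (by norm_num) 2]; rfl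

/-- `k̂(14161) = 1` (`14161 = 7^2·17^2`). [folklore] -/
private theorem khat3_14161 : khat 14161 = 1 := by
  rw [show (14161 : ℕ) = 7 ^ 2 * 17 ^ 2 by norm_num, khat_mul_coprime (by norm_num),
    khat_prime_pow (p := 7) (by norm_num) 2, khat_prime_pow (p := 17) (by norm_num) 2]; rfl

/-- `k̂(14641) = 4` (`14641 = 11^4`). [folklore] -/
private theorem khat3_14641 : khat 14641 = 4 := by
  rw [show (14641 : ℕ) = 11 ^ 4 by norm_num, khat_prime_pow (p := 11) (by norm_num) 4]; rfl

/-- `k̂(15125) = 2` (`15125 = 5^3·11^2`). [folklore] -/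
private theorem khat3_15125 : khat 15125 = 2 := by
  rw [show (15125 : ℕ) = 5 ^ 3 * 11 ^ 2 by norm_num, khat_mul_coprime (by norm_num),
    khat_prime_pow (p := 5) (by norm_num) 3, khat_prime_pow (p := 11) (by norm_num) 2]; rfl

/-- `k̂(15625) = 16` (`15625 = 5^6`). [folklore] -/
private theorem khat3_15625 : khat 15625 = 16 := by
  rw [show (15625 : ℕ) = 5 ^ 6 by norm_num, khat_prime_pow (p := 5) (by norm_num) 6]; rfl

/-- `k̂(16807) = 8` (`16807 = 7^5`). [folklore] -/
private theorem khat3_16807 : khat 16807 = 8 := by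
  rw [show (16807 : ℕ) = 7 ^ 5 by norm_num, khat_prime_pow (p := 7) (by norm_num) 5]; rfl

/-- `k̂(16875) = 8` (`16875 = 3^3·5^4`). [folklore] -/
private theorem khat3_16875 : khat 16875 = 8 := by
  rw [show (16875 : ℕ) = 3 ^ 3 * 5 ^ 4 by norm_num, khat_mul_coprime (by norm_num),
    khat_prime_pow (p := 3) (by norm_num) 3, khat_prime_pow (p := 5) (by norm_num) 4]; rfl

/-- `k̂(17689) = 1` (`17689 = 7^2·19^2`). [folklore] -/
private theorem khat3_17689 : khat 17689 = 1 := by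
  rw [show (17689 : ℕ) = 7 ^ 2 * 19 ^ 2 by norm_num, khat_mul_coprime (by norm_num),
    khat_prime_pow (p := 7) (by norm_num) 2, khat_prime_pow (p := 19) (by norm_num) 2]; rfl

/-- `k̂(18225) = 16` (`18225 = 3^6·5^2`). [folklore] -/
private theorem khat3_18225 : khat 18225 = 16 := by
  rw [show (18225 : ℕ) = 3 ^ 6 * 5 ^ 2 by norm_num, khat_mul_coprime (by norm_num),
    khat_prime_pow (p := 3) (by norm_num) 6, khat_prime_pow (p := 5) (by norm_num) 2]; rfl

/-- `k̂(19683) = 128` (`19683 = 3^9`). [folklore] -/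
private theorem khat3_19683 : khat 19683 = 128 := by
  rw [show (19683 : ℕ) = 3 ^ 9 by norm_num, khat_prime_pow (p := 3) (by norm_num) 9]; rfl

/-- `k̂(19773) = 2` (`19773 = 3^2·13^3`). [folklore] -/
private theorem khat3_19773 : khat 19773 = 2 := by
  rw [show (19773 : ℕ) = 3 ^ 2 * 13 ^ 3 by norm_num, khat_mul_coprime (by norm_num),
    khat_prime_pow (p := 3) (by norm_num) 2, khat_prime_pow (p := 13) (by norm_num) 3]; rfl

/-- Rational upper bounds `logUb3 s ≥ log s` on `kappaSet3` (`logUb3 1 = 0`). [folklore] -/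
noncomputable def logUb3 (s : ℕ) : ℝ :=
  if s = 9 then 2.1976
  else if s = 25 then 3.2192
  else if s = 27 then 3.2964
  else if s = 49 then 3.8922
  else if s = 81 then 4.3952
  else if s = 121 then 4.7962
  else if s = 125 then 4.8288
  else if s = 169 then 5.1302
  else if s = 225 then 5.4168
  else if s = 243 then 5.494
  else if s = 289 then 5.6668
  else if s = 343 then 5.8383
  else if s = 361 then 5.8892
  else if s = 441 then 6.0898
  else if s = 625 then 6.4384
  else if s = 675 then 6.5156
  else if s = 729 then 6.5928
  else if s = 1089 then 6.9938
  else if s = 1125 then 7.0264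
  else if s = 1225 then 7.1114
  else if s = 1323 then 7.1886
  else if s = 1331 then 7.1943
  else if s = 1521 then 7.3278
  else if s = 2025 then 7.6144
  else if s = 2187 then 7.6916
  else if s = 2197 then 7.6953
  else if s = 2401 then 7.7844
  else if s = 2601 then 7.8644
  else if s = 3025 then 8.0154
  else if s = 3087 then 8.0359
  else if s = 3125 then 8.048
  else if s = 3249 then 8.0868
  else if s = 3267 then 8.0926
  else if s = 3375 then 8.1252
  else if s = 3969 then 8.2874
  else if s = 4225 then 8.3494
  else if s = 4563 then 8.4266
  else if s = 4913 then 8.5002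
  else if s = 5625 then 8.636
  else if s = 5929 then 8.6884
  else if s = 6075 then 8.7132
  else if s = 6125 then 8.721
  else if s = 6561 then 8.7904
  else if s = 6859 then 8.8338
  else if s = 7225 then 8.886
  else if s = 7803 then 8.9632
  else if s = 8281 then 9.0224
  else if s = 8575 then 9.0575
  else if s = 9025 then 9.1084
  else if s = 9261 then 9.1347
  else if s = 9747 then 9.1856
  else if s = 9801 then 9.1914
  else if s = 10125 then 9.224
  else if s = 11025 then 9.309
  else if s = 11907 then 9.3862
  else if s = 11979 then 9.3919
  else if s = 13689 then 9.5254
  else if s = 14161 then 9.559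
  else if s = 14641 then 9.5924
  else if s = 15125 then 9.625
  else if s = 15625 then 9.6576
  else if s = 16807 then 9.7305
  else if s = 16875 then 9.7348
  else if s = 17689 then 9.7814
  else if s = 18225 then 9.812
  else if s = 19683 then 9.8892
  else if s = 19773 then 9.8929 else 0

/-- `logUb3 1 = 0`. [folklore] -/
private theorem logUb3v_1 : logUb3 1 = 0 := by norm_num [logUb3]

/-- `logUb3 9 = 2.1976`. [folklore] -/
private theorem logUb3v_9 : logUb3 9 = 2.1976 := by norm_num [logUb3]

/-- `logUb3 25 = 3.2192`. [folklore] -/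
private theorem logUb3v_25 : logUb3 25 = 3.2192 := by norm_num [logUb3]

/-- `logUb3 27 = 3.2964`. [folklore] -/
private theorem logUb3v_27 : logUb3 27 = 3.2964 := by norm_num [logUb3]

/-- `logUb3 49 = 3.8922`. [folklore] -/
private theorem logUb3v_49 : logUb3 49 = 3.8922 := by norm_num [logUb3]

/-- `logUb3 81 = 4.3952`. [folklore] -/
private theorem logUb3v_81 : logUb3 81 = 4.3952 := by norm_num [logUb3]

/-- `logUb3 121 = 4.7962`. [folklore] -/
private theorem logUb3v_121 : logUb3 121 = 4.7962 := by norm_num [logUb3]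

/-- `logUb3 125 = 4.8288`. [folklore] -/
private theorem logUb3v_125 : logUb3 125 = 4.8288 := by norm_num [logUb3]

/-- `logUb3 169 = 5.1302`. [folklore] -/
private theorem logUb3v_169 : logUb3 169 = 5.1302 := by norm_num [logUb3]

/-- `logUb3 225 = 5.4168`. [folklore] -/
private theorem logUb3v_225 : logUb3 225 = 5.4168 := by norm_num [logUb3]

/-- `logUb3 243 = 5.494`. [folklore] -/
private theorem logUb3v_243 : logUb3 243 = 5.494 := by norm_num [logUb3]

/-- `logUb3 289 = 5.6668`. [folklore] -/
private theorem logUb3v_289 : logUb3 289 = 5.6668 := by norm_num [logUb3]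

/-- `logUb3 343 = 5.8383`. [folklore] -/
private theorem logUb3v_343 : logUb3 343 = 5.8383 := by norm_num [logUb3]

/-- `logUb3 361 = 5.8892`. [folklore] -/
private theorem logUb3v_361 : logUb3 361 = 5.8892 := by norm_num [logUb3]

/-- `logUb3 441 = 6.0898`. [folklore] -/
private theorem logUb3v_441 : logUb3 441 = 6.0898 := by norm_num [logUb3]

/-- `logUb3 625 = 6.4384`. [folklore] -/
private theorem logUb3v_625 : logUb3 625 = 6.4384 := by norm_num [logUb3]

/-- `logUb3 675 = 6.5156`. [folklore] -/
private theorem logUb3v_675 : logUb3 675 = 6.5156 := by norm_num [logUb3]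

/-- `logUb3 729 = 6.5928`. [folklore] -/
private theorem logUb3v_729 : logUb3 729 = 6.5928 := by norm_num [logUb3]

/-- `logUb3 1089 = 6.9938`. [folklore] -/
private theorem logUb3v_1089 : logUb3 1089 = 6.9938 := by norm_num [logUb3]

/-- `logUb3 1125 = 7.0264`. [folklore] -/
private theorem logUb3v_1125 : logUb3 1125 = 7.0264 := by norm_num [logUb3]

/-- `logUb3 1225 = 7.1114`. [folklore] -/
private theorem logUb3v_1225 : logUb3 1225 = 7.1114 := by norm_num [logUb3]

/-- `logUb3 1323 = 7.1886`. [folklore] -/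
private theorem logUb3v_1323 : logUb3 1323 = 7.1886 := by norm_num [logUb3]

/-- `logUb3 1331 = 7.1943`. [folklore] -/
private theorem logUb3v_1331 : logUb3 1331 = 7.1943 := by norm_num [logUb3]

/-- `logUb3 1521 = 7.3278`. [folklore] -/
private theorem logUb3v_1521 : logUb3 1521 = 7.3278 := by norm_num [logUb3]

/-- `logUb3 2025 = 7.6144`. [folklore] -/
private theorem logUb3v_2025 : logUb3 2025 = 7.6144 := by norm_num [logUb3]

/-- `logUb3 2187 = 7.6916`. [folklore] -/
private theorem logUb3v_2187 : logUb3 2187 = 7.6916 := by norm_num [logUb3]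

/-- `logUb3 2197 = 7.6953`. [folklore] -/
private theorem logUb3v_2197 : logUb3 2197 = 7.6953 := by norm_num [logUb3]

/-- `logUb3 2401 = 7.7844`. [folklore] -/
private theorem logUb3v_2401 : logUb3 2401 = 7.7844 := by norm_num [logUb3]

/-- `logUb3 2601 = 7.8644`. [folklore] -/
private theorem logUb3v_2601 : logUb3 2601 = 7.8644 := by norm_num [logUb3]

/-- `logUb3 3025 = 8.0154`. [folklore] -/
private theorem logUb3v_3025 : logUb3 3025 = 8.0154 := by norm_num [logUb3]

/-- `logUb3 3087 = 8.0359`. [folklore] -/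
private theorem logUb3v_3087 : logUb3 3087 = 8.0359 := by norm_num [logUb3]

/-- `logUb3 3125 = 8.048`. [folklore] -/
private theorem logUb3v_3125 : logUb3 3125 = 8.048 := by norm_num [logUb3]

/-- `logUb3 3249 = 8.0868`. [folklore] -/
private theorem logUb3v_3249 : logUb3 3249 = 8.0868 := by norm_num [logUb3]

/-- `logUb3 3267 = 8.0926`. [folklore] -/
private theorem logUb3v_3267 : logUb3 3267 = 8.0926 := by norm_num [logUb3]

/-- `logUb3 3375 = 8.1252`. [folklore] -/
private theorem logUb3v_3375 : logUb3 3375 = 8.1252 := by norm_num [logUb3]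

/-- `logUb3 3969 = 8.2874`. [folklore] -/
private theorem logUb3v_3969 : logUb3 3969 = 8.2874 := by norm_num [logUb3]

/-- `logUb3 4225 = 8.3494`. [folklore] -/
private theorem logUb3v_4225 : logUb3 4225 = 8.3494 := by norm_num [logUb3]

/-- `logUb3 4563 = 8.4266`. [folklore] -/
private theorem logUb3v_4563 : logUb3 4563 = 8.4266 := by norm_num [logUb3]

/-- `logUb3 4913 = 8.5002`. [folklore] -/
private theorem logUb3v_4913 : logUb3 4913 = 8.5002 := by norm_num [logUb3]

/-- `logUb3 5625 = 8.636`. [folklore] -/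
private theorem logUb3v_5625 : logUb3 5625 = 8.636 := by norm_num [logUb3]

/-- `logUb3 5929 = 8.6884`. [folklore] -/
private theorem logUb3v_5929 : logUb3 5929 = 8.6884 := by norm_num [logUb3]

/-- `logUb3 6075 = 8.7132`. [folklore] -/
private theorem logUb3v_6075 : logUb3 6075 = 8.7132 := by norm_num [logUb3]

/-- `logUb3 6125 = 8.721`. [folklore] -/
private theorem logUb3v_6125 : logUb3 6125 = 8.721 := by norm_num [logUb3]

/-- `logUb3 6561 = 8.7904`. [folklore] -/
private theorem logUb3v_6561 : logUb3 6561 = 8.7904 := by norm_num [logUb3]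

/-- `logUb3 6859 = 8.8338`. [folklore] -/
private theorem logUb3v_6859 : logUb3 6859 = 8.8338 := by norm_num [logUb3]

/-- `logUb3 7225 = 8.886`. [folklore] -/
private theorem logUb3v_7225 : logUb3 7225 = 8.886 := by norm_num [logUb3]

/-- `logUb3 7803 = 8.9632`. [folklore] -/
private theorem logUb3v_7803 : logUb3 7803 = 8.9632 := by norm_num [logUb3]

/-- `logUb3 8281 = 9.0224`. [folklore] -/
private theorem logUb3v_8281 : logUb3 8281 = 9.0224 := by norm_num [logUb3]

/-- `logUb3 8575 = 9.0575`. [folklore] -/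
private theorem logUb3v_8575 : logUb3 8575 = 9.0575 := by norm_num [logUb3]

/-- `logUb3 9025 = 9.1084`. [folklore] -/
private theorem logUb3v_9025 : logUb3 9025 = 9.1084 := by norm_num [logUb3]

/-- `logUb3 9261 = 9.1347`. [folklore] -/
private theorem logUb3v_9261 : logUb3 9261 = 9.1347 := by norm_num [logUb3]

/-- `logUb3 9747 = 9.1856`. [folklore] -/
private theorem logUb3v_9747 : logUb3 9747 = 9.1856 := by norm_num [logUb3]

/-- `logUb3 9801 = 9.1914`. [folklore] -/
private theorem logUb3v_9801 : logUb3 9801 = 9.1914 := by norm_num [logUb3]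

/-- `logUb3 10125 = 9.224`. [folklore] -/
private theorem logUb3v_10125 : logUb3 10125 = 9.224 := by norm_num [logUb3]

/-- `logUb3 11025 = 9.309`. [folklore] -/
private theorem logUb3v_11025 : logUb3 11025 = 9.309 := by norm_num [logUb3]

/-- `logUb3 11907 = 9.3862`. [folklore] -/
private theorem logUb3v_11907 : logUb3 11907 = 9.3862 := by norm_num [logUb3]

/-- `logUb3 11979 = 9.3919`. [folklore] -/
private theorem logUb3v_11979 : logUb3 11979 = 9.3919 := by norm_num [logUb3]

/-- `logUb3 13689 = 9.5254`. [folklore] -/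
private theorem logUb3v_13689 : logUb3 13689 = 9.5254 := by norm_num [logUb3]

/-- `logUb3 14161 = 9.559`. [folklore] -/
private theorem logUb3v_14161 : logUb3 14161 = 9.559 := by norm_num [logUb3]

/-- `logUb3 14641 = 9.5924`. [folklore] -/
private theorem logUb3v_14641 : logUb3 14641 = 9.5924 := by norm_num [logUb3]

/-- `logUb3 15125 = 9.625`. [folklore] -/
private theorem logUb3v_15125 : logUb3 15125 = 9.625 := by norm_num [logUb3]

/-- `logUb3 15625 = 9.6576`. [folklore] -/
private theorem logUb3v_15625 : logUb3 15625 = 9.6576 := by norm_num [logUb3]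

/-- `logUb3 16807 = 9.7305`. [folklore] -/
private theorem logUb3v_16807 : logUb3 16807 = 9.7305 := by norm_num [logUb3]

/-- `logUb3 16875 = 9.7348`. [folklore] -/
private theorem logUb3v_16875 : logUb3 16875 = 9.7348 := by norm_num [logUb3]

/-- `logUb3 17689 = 9.7814`. [folklore] -/
private theorem logUb3v_17689 : logUb3 17689 = 9.7814 := by norm_num [logUb3]

/-- `logUb3 18225 = 9.812`. [folklore] -/
private theorem logUb3v_18225 : logUb3 18225 = 9.812 := by norm_num [logUb3]

/-- `logUb3 19683 = 9.8892`. [folklore] -/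
private theorem logUb3v_19683 : logUb3 19683 = 9.8892 := by norm_num [logUb3]

/-- `logUb3 19773 = 9.8929`. [folklore] -/
private theorem logUb3v_19773 : logUb3 19773 = 9.8929 := by norm_num [logUb3]

/-- `log s ≤ logUb3 s` on `kappaSet3`. [folklore] -/
private theorem log_le_logUb3 : ∀ s ∈ kappaSet3, Real.log s ≤ logUb3 s := by
  intro s hs
  simp only [kappaSet3, mem_insert, mem_singleton] at hs
  rcases hs with rfl | rfl | rfl | rfl | rfl | rfl | rfl | rfl | rfl | rfl | rfl | rfl | rfl | rfl | rfl | rfl | rfl | rfl | rfl | rfl | rfl | rfl | rfl | rfl | rfl | rfl | rfl | rfl | rfl | rfl | rfl | rfl | rfl | rfl | rfl | rfl | rfl | rfl | rfl | rfl | rfl | rfl | rfl | rfl | rfl | rfl | rfl | rfl | rfl | rfl | rfl | rfl | rfl | rfl | rfl | rfl | rfl | rfl | rfl | rfl | rfl | rfl | rfl | rfl | rfl | rfl | rfl | rfl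
  · simp [logUb3]
  · rw [show ((9 : ℕ) : ℝ) = (3 : ℝ) ^ 2 by norm_num, Real.log_pow]; norm_num [logUb3]
    linarith [logb_3]
  · rw [show ((25 : ℕ) : ℝ) = (5 : ℝ) ^ 2 by norm_num, Real.log_pow]; norm_num [logUb3]
    linarith [logb_5]
  · rw [show ((27 : ℕ) : ℝ) = (3 : ℝ) ^ 3 by norm_num, Real.log_pow]; norm_num [logUb3]
    linarith [logb_3]
  · rw [show ((49 : ℕ) : ℝ) = (7 : ℝ) ^ 2 by norm_num, Real.log_pow]; norm_num [logUb3]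
    linarith [logb_7]
  · rw [show ((81 : ℕ) : ℝ) = (3 : ℝ) ^ 4 by norm_num, Real.log_pow]; norm_num [logUb3]
    linarith [logb_3]
  · rw [show ((121 : ℕ) : ℝ) = (11 : ℝ) ^ 2 by norm_num, Real.log_pow]; norm_num [logUb3]
    linarith [logb_11]
  · rw [show ((125 : ℕ) : ℝ) = (5 : ℝ) ^ 3 by norm_num, Real.log_pow]; norm_num [logUb3]
    linarith [logb_5]
  · rw [show ((169 : ℕ) : ℝ) = (13 : ℝ) ^ 2 by norm_num, Real.log_pow]; norm_num [logUb3]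
    linarith [logb_13]
  · rw [show ((225 : ℕ) : ℝ) = (3 : ℝ) ^ 2 * (5 : ℝ) ^ 2 by norm_num,
      Real.log_mul (by positivity) (by positivity), Real.log_pow, Real.log_pow]; norm_num [logUb3]
    linarith [logb_3, logb_5]
  · rw [show ((243 : ℕ) : ℝ) = (3 : ℝ) ^ 5 by norm_num, Real.log_pow]; norm_num [logUb3]
    linarith [logb_3]
  · rw [show ((289 : ℕ) : ℝ) = (17 : ℝ) ^ 2 by norm_num, Real.log_pow]; norm_num [logUb3]
    linarith [logb_17]
  · rw [show ((343 : ℕ) : ℝ) = (7 : ℝ) ^ 3 by norm_num, Real.log_pow]; norm_num [logUb3]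
    linarith [logb_7]
  · rw [show ((361 : ℕ) : ℝ) = (19 : ℝ) ^ 2 by norm_num, Real.log_pow]; norm_num [logUb3]
    linarith [logb_19]
  · rw [show ((441 : ℕ) : ℝ) = (3 : ℝ) ^ 2 * (7 : ℝ) ^ 2 by norm_num,
      Real.log_mul (by positivity) (by positivity), Real.log_pow, Real.log_pow]; norm_num [logUb3]
    linarith [logb_3, logb_7]
  · rw [show ((625 : ℕ) : ℝ) = (5 : ℝ) ^ 4 by norm_num, Real.log_pow]; norm_num [logUb3]
    linarith [logb_5]
  · rw [show ((675 : ℕ) : ℝ) = (3 : ℝ) ^ 3 * (5 : ℝ) ^ 2 by norm_num,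
      Real.log_mul (by positivity) (by positivity), Real.log_pow, Real.log_pow]; norm_num [logUb3]
    linarith [logb_3, logb_5]
  · rw [show ((729 : ℕ) : ℝ) = (3 : ℝ) ^ 6 by norm_num, Real.log_pow]; norm_num [logUb3]
    linarith [logb_3]
  · rw [show ((1089 : ℕ) : ℝ) = (3 : ℝ) ^ 2 * (11 : ℝ) ^ 2 by norm_num,
      Real.log_mul (by positivity) (by positivity), Real.log_pow, Real.log_pow]; norm_num [logUb3]
    linarith [logb_3, logb_11]
  · rw [show ((1125 : ℕ) : ℝ) = (3 : ℝ) ^ 2 * (5 : ℝ) ^ 3 by norm_num,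
      Real.log_mul (by positivity) (by positivity), Real.log_pow, Real.log_pow]; norm_num [logUb3]
    linarith [logb_3, logb_5]
  · rw [show ((1225 : ℕ) : ℝ) = (5 : ℝ) ^ 2 * (7 : ℝ) ^ 2 by norm_num,
      Real.log_mul (by positivity) (by positivity), Real.log_pow, Real.log_pow]; norm_num [logUb3]
    linarith [logb_5, logb_7]
  · rw [show ((1323 : ℕ) : ℝ) = (3 : ℝ) ^ 3 * (7 : ℝ) ^ 2 by norm_num,
      Real.log_mul (by positivity) (by positivity), Real.log_pow, Real.log_pow]; norm_num [logUb3]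
    linarith [logb_3, logb_7]
  · rw [show ((1331 : ℕ) : ℝ) = (11 : ℝ) ^ 3 by norm_num, Real.log_pow]; norm_num [logUb3]
    linarith [logb_11]
  · rw [show ((1521 : ℕ) : ℝ) = (3 : ℝ) ^ 2 * (13 : ℝ) ^ 2 by norm_num,
      Real.log_mul (by positivity) (by positivity), Real.log_pow, Real.log_pow]; norm_num [logUb3]
    linarith [logb_3, logb_13]
  · rw [show ((2025 : ℕ) : ℝ) = (3 : ℝ) ^ 4 * (5 : ℝ) ^ 2 by norm_num,
      Real.log_mul (by positivity) (by positivity), Real.log_pow, Real.log_pow]; norm_num [logUb3]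
    linarith [logb_3, logb_5]
  · rw [show ((2187 : ℕ) : ℝ) = (3 : ℝ) ^ 7 by norm_num, Real.log_pow]; norm_num [logUb3]
    linarith [logb_3]
  · rw [show ((2197 : ℕ) : ℝ) = (13 : ℝ) ^ 3 by norm_num, Real.log_pow]; norm_num [logUb3]
    linarith [logb_13]
  · rw [show ((2401 : ℕ) : ℝ) = (7 : ℝ) ^ 4 by norm_num, Real.log_pow]; norm_num [logUb3]
    linarith [logb_7]
  · rw [show ((2601 : ℕ) : ℝ) = (3 : ℝ) ^ 2 * (17 : ℝ) ^ 2 by norm_num,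
      Real.log_mul (by positivity) (by positivity), Real.log_pow, Real.log_pow]; norm_num [logUb3]
    linarith [logb_3, logb_17]
  · rw [show ((3025 : ℕ) : ℝ) = (5 : ℝ) ^ 2 * (11 : ℝ) ^ 2 by norm_num,
      Real.log_mul (by positivity) (by positivity), Real.log_pow, Real.log_pow]; norm_num [logUb3]
    linarith [logb_5, logb_11]
  · rw [show ((3087 : ℕ) : ℝ) = (3 : ℝ) ^ 2 * (7 : ℝ) ^ 3 by norm_num,
      Real.log_mul (by positivity) (by positivity), Real.log_pow, Real.log_pow]; norm_num [logUb3]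
    linarith [logb_3, logb_7]
  · rw [show ((3125 : ℕ) : ℝ) = (5 : ℝ) ^ 5 by norm_num, Real.log_pow]; norm_num [logUb3]
    linarith [logb_5]
  · rw [show ((3249 : ℕ) : ℝ) = (3 : ℝ) ^ 2 * (19 : ℝ) ^ 2 by norm_num,
      Real.log_mul (by positivity) (by positivity), Real.log_pow, Real.log_pow]; norm_num [logUb3]
    linarith [logb_3, logb_19]
  · rw [show ((3267 : ℕ) : ℝ) = (3 : ℝ) ^ 3 * (11 : ℝ) ^ 2 by norm_num,
      Real.log_mul (by positivity) (by positivity), Real.log_pow, Real.log_pow]; norm_num [logUb3]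
    linarith [logb_3, logb_11]
  · rw [show ((3375 : ℕ) : ℝ) = (3 : ℝ) ^ 3 * (5 : ℝ) ^ 3 by norm_num,
      Real.log_mul (by positivity) (by positivity), Real.log_pow, Real.log_pow]; norm_num [logUb3]
    linarith [logb_3, logb_5]
  · rw [show ((3969 : ℕ) : ℝ) = (3 : ℝ) ^ 4 * (7 : ℝ) ^ 2 by norm_num,
      Real.log_mul (by positivity) (by positivity), Real.log_pow, Real.log_pow]; norm_num [logUb3]
    linarith [logb_3, logb_7]
  · rw [show ((4225 : ℕ) : ℝ) = (5 : ℝ) ^ 2 * (13 : ℝ) ^ 2 by norm_num,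
      Real.log_mul (by positivity) (by positivity), Real.log_pow, Real.log_pow]; norm_num [logUb3]
    linarith [logb_5, logb_13]
  · rw [show ((4563 : ℕ) : ℝ) = (3 : ℝ) ^ 3 * (13 : ℝ) ^ 2 by norm_num,
      Real.log_mul (by positivity) (by positivity), Real.log_pow, Real.log_pow]; norm_num [logUb3]
    linarith [logb_3, logb_13]
  · rw [show ((4913 : ℕ) : ℝ) = (17 : ℝ) ^ 3 by norm_num, Real.log_pow]; norm_num [logUb3]
    linarith [logb_17]
  · rw [show ((5625 : ℕ) : ℝ) = (3 : ℝ) ^ 2 * (5 : ℝ) ^ 4 by norm_num,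
      Real.log_mul (by positivity) (by positivity), Real.log_pow, Real.log_pow]; norm_num [logUb3]
    linarith [logb_3, logb_5]
  · rw [show ((5929 : ℕ) : ℝ) = (7 : ℝ) ^ 2 * (11 : ℝ) ^ 2 by norm_num,
      Real.log_mul (by positivity) (by positivity), Real.log_pow, Real.log_pow]; norm_num [logUb3]
    linarith [logb_7, logb_11]
  · rw [show ((6075 : ℕ) : ℝ) = (3 : ℝ) ^ 5 * (5 : ℝ) ^ 2 by norm_num,
      Real.log_mul (by positivity) (by positivity), Real.log_pow, Real.log_pow]; norm_num [logUb3]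
    linarith [logb_3, logb_5]
  · rw [show ((6125 : ℕ) : ℝ) = (5 : ℝ) ^ 3 * (7 : ℝ) ^ 2 by norm_num,
      Real.log_mul (by positivity) (by positivity), Real.log_pow, Real.log_pow]; norm_num [logUb3]
    linarith [logb_5, logb_7]
  · rw [show ((6561 : ℕ) : ℝ) = (3 : ℝ) ^ 8 by norm_num, Real.log_pow]; norm_num [logUb3]
    linarith [logb_3]
  · rw [show ((6859 : ℕ) : ℝ) = (19 : ℝ) ^ 3 by norm_num, Real.log_pow]; norm_num [logUb3]
    linarith [logb_19]
  · rw [show ((7225 : ℕ) : ℝ) = (5 : ℝ) ^ 2 * (17 : ℝ) ^ 2 by norm_num,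
      Real.log_mul (by positivity) (by positivity), Real.log_pow, Real.log_pow]; norm_num [logUb3]
    linarith [logb_5, logb_17]
  · rw [show ((7803 : ℕ) : ℝ) = (3 : ℝ) ^ 3 * (17 : ℝ) ^ 2 by norm_num,
      Real.log_mul (by positivity) (by positivity), Real.log_pow, Real.log_pow]; norm_num [logUb3]
    linarith [logb_3, logb_17]
  · rw [show ((8281 : ℕ) : ℝ) = (7 : ℝ) ^ 2 * (13 : ℝ) ^ 2 by norm_num,
      Real.log_mul (by positivity) (by positivity), Real.log_pow, Real.log_pow]; norm_num [logUb3]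
    linarith [logb_7, logb_13]
  · rw [show ((8575 : ℕ) : ℝ) = (5 : ℝ) ^ 2 * (7 : ℝ) ^ 3 by norm_num,
      Real.log_mul (by positivity) (by positivity), Real.log_pow, Real.log_pow]; norm_num [logUb3]
    linarith [logb_5, logb_7]
  · rw [show ((9025 : ℕ) : ℝ) = (5 : ℝ) ^ 2 * (19 : ℝ) ^ 2 by norm_num,
      Real.log_mul (by positivity) (by positivity), Real.log_pow, Real.log_pow]; norm_num [logUb3]
    linarith [logb_5, logb_19]
  · rw [show ((9261 : ℕ) : ℝ) = (3 : ℝ) ^ 3 * (7 : ℝ) ^ 3 by norm_num,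
      Real.log_mul (by positivity) (by positivity), Real.log_pow, Real.log_pow]; norm_num [logUb3]
    linarith [logb_3, logb_7]
  · rw [show ((9747 : ℕ) : ℝ) = (3 : ℝ) ^ 3 * (19 : ℝ) ^ 2 by norm_num,
      Real.log_mul (by positivity) (by positivity), Real.log_pow, Real.log_pow]; norm_num [logUb3]
    linarith [logb_3, logb_19]
  · rw [show ((9801 : ℕ) : ℝ) = (3 : ℝ) ^ 4 * (11 : ℝ) ^ 2 by norm_num,
      Real.log_mul (by positivity) (by positivity), Real.log_pow, Real.log_pow]; norm_num [logUb3]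
    linarith [logb_3, logb_11]
  · rw [show ((10125 : ℕ) : ℝ) = (3 : ℝ) ^ 4 * (5 : ℝ) ^ 3 by norm_num,
      Real.log_mul (by positivity) (by positivity), Real.log_pow, Real.log_pow]; norm_num [logUb3]
    linarith [logb_3, logb_5]
  · rw [show ((11025 : ℕ) : ℝ) = (3 : ℝ) ^ 2 * (5 : ℝ) ^ 2 * (7 : ℝ) ^ 2 by norm_num,
      Real.log_mul (by positivity) (by positivity), Real.log_mul (by positivity) (by positivity),
      Real.log_pow, Real.log_pow, Real.log_pow]; norm_num [logUb3]
    linarith [logb_3, logb_5, logb_7]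
  · rw [show ((11907 : ℕ) : ℝ) = (3 : ℝ) ^ 5 * (7 : ℝ) ^ 2 by norm_num,
      Real.log_mul (by positivity) (by positivity), Real.log_pow, Real.log_pow]; norm_num [logUb3]
    linarith [logb_3, logb_7]
  · rw [show ((11979 : ℕ) : ℝ) = (3 : ℝ) ^ 2 * (11 : ℝ) ^ 3 by norm_num,
      Real.log_mul (by positivity) (by positivity), Real.log_pow, Real.log_pow]; norm_num [logUb3]
    linarith [logb_3, logb_11]
  · rw [show ((13689 : ℕ) : ℝ) = (3 : ℝ) ^ 4 * (13 : ℝ) ^ 2 by norm_num,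
      Real.log_mul (by positivity) (by positivity), Real.log_pow, Real.log_pow]; norm_num [logUb3]
    linarith [logb_3, logb_13]
  · rw [show ((14161 : ℕ) : ℝ) = (7 : ℝ) ^ 2 * (17 : ℝ) ^ 2 by norm_num,
      Real.log_mul (by positivity) (by positivity), Real.log_pow, Real.log_pow]; norm_num [logUb3]
    linarith [logb_7, logb_17]
  · rw [show ((14641 : ℕ) : ℝ) = (11 : ℝ) ^ 4 by norm_num, Real.log_pow]; norm_num [logUb3]
    linarith [logb_11]
  · rw [show ((15125 : ℕ) : ℝ) = (5 : ℝ) ^ 3 * (11 : ℝ) ^ 2 by norm_num,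
      Real.log_mul (by positivity) (by positivity), Real.log_pow, Real.log_pow]; norm_num [logUb3]
    linarith [logb_5, logb_11]
  · rw [show ((15625 : ℕ) : ℝ) = (5 : ℝ) ^ 6 by norm_num, Real.log_pow]; norm_num [logUb3]
    linarith [logb_5]
  · rw [show ((16807 : ℕ) : ℝ) = (7 : ℝ) ^ 5 by norm_num, Real.log_pow]; norm_num [logUb3]
    linarith [logb_7]
  · rw [show ((16875 : ℕ) : ℝ) = (3 : ℝ) ^ 3 * (5 : ℝ) ^ 4 by norm_num,
      Real.log_mul (by positivity) (by positivity), Real.log_pow, Real.log_pow]; norm_num [logUb3]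
    linarith [logb_3, logb_5]
  · rw [show ((17689 : ℕ) : ℝ) = (7 : ℝ) ^ 2 * (19 : ℝ) ^ 2 by norm_num,
      Real.log_mul (by positivity) (by positivity), Real.log_pow, Real.log_pow]; norm_num [logUb3]
    linarith [logb_7, logb_19]
  · rw [show ((18225 : ℕ) : ℝ) = (3 : ℝ) ^ 6 * (5 : ℝ) ^ 2 by norm_num,
      Real.log_mul (by positivity) (by positivity), Real.log_pow, Real.log_pow]; norm_num [logUb3]
    linarith [logb_3, logb_5]
  · rw [show ((19683 : ℕ) : ℝ) = (3 : ℝ) ^ 9 by norm_num, Real.log_pow]; norm_num [logUb3]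
    linarith [logb_3]
  · rw [show ((19773 : ℕ) : ℝ) = (3 : ℝ) ^ 2 * (13 : ℝ) ^ 3 by norm_num,
      Real.log_mul (by positivity) (by positivity), Real.log_pow, Real.log_pow]; norm_num [logUb3]
    linarith [logb_3, logb_13]

/-- `logUb3 s ≤ 9.8929` on `kappaSet3`. [folklore] -/
private theorem logUb3_le : ∀ s ∈ kappaSet3, logUb3 s ≤ 9.8929 := by
  intro s hs
  simp only [kappaSet3, mem_insert, mem_singleton] at hs
  rcases hs with rfl | rfl | rfl | rfl | rfl | rfl | rfl | rfl | rfl | rfl | rfl | rfl | rfl | rfl | rfl | rfl | rfl | rfl | rfl | rfl | rfl | rfl | rfl | rfl | rfl | rfl | rfl | rfl | rfl | rfl | rfl | rfl | rfl | rfl | rfl | rfl | rfl | rfl | rfl | rfl | rfl | rfl | rfl | rfl | rfl | rfl | rfl | rfl | rfl | rfl | rfl | rfl | rfl | rfl | rfl | rfl | rfl | rfl | rfl | rfl | rfl | rfl | rfl | rfl | rfl | rfl | rfl | rfl <;> norm_num [logUb3]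

/-- `U₃(a,s) = a·0.6931472 + logUb3 s ≥ a log 2 + log s`. [folklore] -/
noncomputable def Ub3 (a s : ℕ) : ℝ := (a : ℝ) * 0.6931472 + logUb3 s

/-- One `(a, s)` cell: for `2^a s ≤ X` and `log X ≥ U(a,s)`,
`k̂(s)/s·(⅛(log X − U(a,s))² − 8/15) ≤ k̂(s)/s · D_odd(X/2^a/s)`. [folklore] -/
private theorem kappa_cell_ge3 {X a s : ℕ} (hs : s ∈ kappaSet3) (hX : 2 ^ a * s ≤ X) (hl : Ub3 a s ≤ Real.log X) :
    (khat s : ℝ) / s * ((1 / 8) * (Real.log X - Ub3 a s) ^ 2 - 8 / 15)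
      ≤ (khat s : ℝ) / s * Dodd (X / 2 ^ a / s) := by
  have hs1 : 1 ≤ s := (kappaSet3_odd s hs).pos
  have hsR : (0 : ℝ) < s := by exact_mod_cast hs1
  have hX0 : (0 : ℝ) < X := by
    have : 0 < X := lt_of_lt_of_le (Nat.mul_pos (by positivity) hs1) hX
    exact_mod_cast this
  refine mul_le_mul_of_nonneg_left ?_ (by positivity)
  have hy : (1 : ℝ) ≤ (X : ℝ) / ((2 : ℝ) ^ a * s) := by
    rw [le_div_iff₀ (by positivity), one_mul]
    exact_mod_cast hX
  have h := Dodd_ge hy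
  have hfloor : ⌊(X : ℝ) / ((2 : ℝ) ^ a * s)⌋₊ = X / 2 ^ a / s := by
    rw [show ((2 : ℝ) ^ a * s) = ((2 ^ a * s : ℕ) : ℝ) by push_cast; ring, Nat.floor_div_eq_div,
      Nat.div_div_eq_div_mul]
  have hlog : Real.log ((X : ℝ) / ((2 : ℝ) ^ a * s)) = Real.log X - a * Real.log 2 - Real.log s := by
    rw [Real.log_div hX0.ne' (by positivity), Real.log_mul (by positivity) hsR.ne', Real.log_pow]
    ring
  rw [hfloor, hlog] at h
  refine le_trans ?_ h
  have hU : (a : ℝ) * Real.log 2 + Real.log s ≤ Ub3 a s := by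
    unfold Ub3
    have h2 : Real.log 2 ≤ 0.6931472 := by linarith [Real.log_two_lt_d9]
    have := log_le_logUb3 s hs
    nlinarith [h2, this, Nat.cast_nonneg (α := ℝ) a]
  have h0 : 0 ≤ Real.log X - Ub3 a s := by linarith
  have hsq : (Real.log X - Ub3 a s) ^ 2 ≤ (Real.log X - a * Real.log 2 - Real.log s) ^ 2 :=
    pow_le_pow_left₀ h0 (by linarith) 2
  linarith

/-- One dyadic level, κ-refined: for `2^a·19773 ≤ X` and `log X ≥ 15.24`,
`∑_{s ∈ kappaSet3} k̂(s)/s·(⅛(log X − U(a,s))² − 8/15) ≤ ∑_{m ≤ X/2^a odd} f̃(m)`. [folklore] -/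
private theorem sum_ft_odd_level_ge_kappa3 {X a : ℕ} (ha : a ≤ 7) (hX : 2 ^ a * 19773 ≤ X)
    (hl : 15.24 ≤ Real.log X) :
    ∑ s ∈ kappaSet3, (khat s : ℝ) / s * ((1 / 8) * (Real.log X - Ub3 a s) ^ 2 - 8 / 15)
      ≤ ∑ m ∈ oddIcc (X / 2 ^ a), ft m := by
  refine le_trans ?_ (sum_khat_Dodd_le_sum_ft kappaSet3 kappaSet3_odd (X / 2 ^ a))
  refine sum_le_sum fun s hs => kappa_cell_ge3 hs ?_ ?_
  · exact le_trans (Nat.mul_le_mul_left _ (kappaSet3_le s hs)) hX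
  · have ha7 : (a : ℝ) ≤ 7 := by exact_mod_cast ha
    have := logUb3_le s hs
    unfold Ub3
    nlinarith [this, ha7, Nat.cast_nonneg (α := ℝ) a]

/-! ### §10b  The three moments of `kappaSet3` and the cell polynomial `TlowK3` -/

set_option maxHeartbeats 1000000 in
/-- `∑ k̂(s)/s ≥ 1.469124`. [folklore] -/
private theorem sum_w_ge3 : (1.469124 : ℝ) ≤ ∑ s ∈ kappaSet3, (khat s : ℝ) / s := by
  norm_num [kappaSet3, khat3_1, khat3_9, khat3_25, khat3_27, khat3_49, khat3_81, khat3_121, khat3_125, khat3_169, khat3_225, khat3_243, khat3_289, khat3_343, khat3_361, khat3_441, khat3_625, khat3_675, khat3_729, khat3_1089, khat3_1125, khat3_1225, khat3_1323, khat3_1331, khat3_1521, khat3_2025, khat3_2187, khat3_2197, khat3_2401, khat3_2601, khat3_3025, khat3_3087, khat3_3125, khat3_3249, khat3_3267, khat3_3375, khat3_3969, khat3_4225, khat3_4563, khat3_4913, khat3_5625, khat3_5929, khat3_6075, khat3_6125, khat3_6561, khat3_6859, khat3_7225, khat3_7803, khat3_8281, khat3_8575, khat3_9025, khat3_9261, khat3_9747,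 khat3_9801, khat3_10125, khat3_11025, khat3_11907, khat3_11979, khat3_13689, khat3_14161, khat3_14641, khat3_15125, khat3_15625, khat3_16807, khat3_16875, khat3_17689, khat3_18225, khat3_19683, khat3_19773]

set_option maxHeartbeats 1000000 in
/-- `∑ k̂(s)/s ≤ 1.469125`. [folklore] -/
private theorem sum_w_le3 : ∑ s ∈ kappaSet3, (khat s : ℝ) / s ≤ 1.469125 := by
  norm_num [kappaSet3, khat3_1, khat3_9, khat3_25, khat3_27, khat3_49, khat3_81, khat3_121, khat3_125, khat3_169, khat3_225, khat3_243, khat3_289, khat3_343, khat3_361, khat3_441, khat3_625, khat3_675, khat3_729, khat3_1089, khat3_1125, khat3_1225, khat3_1323, khat3_1331, khat3_1521, khat3_2025, khat3_2187, khat3_2197, khat3_2401, khat3_2601, khat3_3025, khat3_3087, khat3_3125, khat3_3249, khat3_3267, khat3_3375, khat3_3969, khat3_4225, khat3_4563, khat3_4913, khat3_5625, khat3_5929, khat3_6075, khat3_6125, khat3_6561, khat3_6859, khat3_7225, khat3_7803, khat3_8281, khat3_8575, khat3_9025, khat3_9261, khat3_9747, khat3_9801, khat3_10125, khat3_11025,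 khat3_11907, khat3_11979, khat3_13689, khat3_14161, khat3_14641, khat3_15125, khat3_15625, khat3_16807, khat3_16875, khat3_17689, khat3_18225, khat3_19683, khat3_19773]

set_option maxHeartbeats 1000000 in
/-- `∑ (k̂(s)/s)·logUb3 s ≤ 2.064141`. [folklore] -/
private theorem sum_wu_le3 : ∑ s ∈ kappaSet3, (khat s : ℝ) / s * logUb3 s ≤ 2.064141 := by
  norm_num [kappaSet3, khat3_1, khat3_9, khat3_25, khat3_27, khat3_49, khat3_81, khat3_121, khat3_125, khat3_169, khat3_225, khat3_243, khat3_289, khat3_343, khat3_361, khat3_441, khat3_625, khat3_675, khat3_729, khat3_1089, khat3_1125, khat3_1225, khat3_1323, khat3_1331, khat3_1521, khat3_2025, khat3_2187, khat3_2197, khat3_2401, khat3_2601, khat3_3025, khat3_3087, khat3_3125, khat3_3249, khat3_3267, khat3_3375, khat3_3969, khat3_4225, khat3_4563, khat3_4913, khat3_5625, khat3_5929, khat3_6075, khat3_6125, khat3_6561, khat3_6859, khat3_7225, khat3_7803, khat3_8281, khat3_8575, khat3_9025, khat3_9261, khat3_9747, khat3_9801, khat3_10125, khat3_11025, khat3_11907,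 khat3_11979, khat3_13689, khat3_14161, khat3_14641, khat3_15125, khat3_15625, khat3_16807, khat3_16875, khat3_17689, khat3_18225, khat3_19683, khat3_19773, logUb3v_1, logUb3v_9, logUb3v_25, logUb3v_27, logUb3v_49, logUb3v_81, logUb3v_121, logUb3v_125, logUb3v_169, logUb3v_225, logUb3v_243, logUb3v_289, logUb3v_343, logUb3v_361, logUb3v_441, logUb3v_625, logUb3v_675, logUb3v_729, logUb3v_1089, logUb3v_1125, logUb3v_1225, logUb3v_1323, logUb3v_1331, logUb3v_1521, logUb3v_2025, logUb3v_2187, logUb3v_2197, logUb3v_2401, logUb3v_2601, logUb3v_3025, logUb3v_3087, logUb3v_3125, logUb3v_3249, logUb3v_3267, logUb3v_3375, logUb3v_3969, logUb3v_4225, logUb3v_4563, logUb3v_4913, logUb3v_5625, logUb3v_5929, logUb3v_6075, logUb3v_6125, logUb3v_6561, logUb3v_6859, logUb3v_7225, logUb3v_7803, logUb3v_8281, logUb3v_8575, logUb3v_9025, logUb3v_9261, logUb3v_9747, logUb3v_9801, logUb3v_10125, logUb3v_11025, logUb3v_11907, logUb3v_11979, logUb3v_13689, logUb3v_14161, logUb3v_14641,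 logUb3v_15125, logUb3v_15625, logUb3v_16807, logUb3v_16875, logUb3v_17689, logUb3v_18225, logUb3v_19683, logUb3v_19773]

set_option maxHeartbeats 1000000 in
/-- `∑ (k̂(s)/s)·(logUb3 s)² ≥ 11.000135`. [folklore] -/
private theorem sum_wu2_ge3 : (11.000135 : ℝ) ≤ ∑ s ∈ kappaSet3, (khat s : ℝ) / s * logUb3 s ^ 2 := by
  norm_num [kappaSet3, khat3_1, khat3_9, khat3_25, khat3_27, khat3_49, khat3_81, khat3_121, khat3_125, khat3_169, khat3_225, khat3_243, khat3_289, khat3_343, khat3_361, khat3_441, khat3_625, khat3_675, khat3_729, khat3_1089, khat3_1125, khat3_1225, khat3_1323, khat3_1331, khat3_1521, khat3_2025, khat3_2187, khat3_2197, khat3_2401, khat3_2601, khat3_3025, khat3_3087, khat3_3125, khat3_3249, khat3_3267, khat3_3375, khat3_3969, khat3_4225, khat3_4563, khat3_4913, khat3_5625, khat3_5929, khat3_6075, khat3_6125, khat3_6561, khat3_6859, khat3_7225, khat3_7803, khat3_8281, khat3_8575, khat3_9025, khat3_9261, khat3_9747, khat3_9801, khat3_10125, khat3_11025, khat3_11907,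 khat3_11979, khat3_13689, khat3_14161, khat3_14641, khat3_15125, khat3_15625, khat3_16807, khat3_16875, khat3_17689, khat3_18225, khat3_19683, khat3_19773, logUb3v_1, logUb3v_9, logUb3v_25, logUb3v_27, logUb3v_49, logUb3v_81, logUb3v_121, logUb3v_125, logUb3v_169, logUb3v_225, logUb3v_243, logUb3v_289, logUb3v_343, logUb3v_361, logUb3v_441, logUb3v_625, logUb3v_675, logUb3v_729, logUb3v_1089, logUb3v_1125, logUb3v_1225, logUb3v_1323, logUb3v_1331, logUb3v_1521, logUb3v_2025, logUb3v_2187, logUb3v_2197, logUb3v_2401, logUb3v_2601, logUb3v_3025, logUb3v_3087, logUb3v_3125, logUb3v_3249, logUb3v_3267, logUb3v_3375, logUb3v_3969, logUb3v_4225, logUb3v_4563, logUb3v_4913, logUb3v_5625, logUb3v_5929, logUb3v_6075, logUb3v_6125, logUb3v_6561, logUb3v_6859, logUb3v_7225, logUb3v_7803, logUb3v_8281, logUb3v_8575, logUb3v_9025, logUb3v_9261, logUb3v_9747, logUb3v_9801, logUb3v_10125, logUb3v_11025, logUb3v_11907, logUb3v_11979, logUb3v_13689, logUb3v_14161, logUb3v_14641,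 logUb3v_15125, logUb3v_15625, logUb3v_16807, logUb3v_16875, logUb3v_17689, logUb3v_18225, logUb3v_19683, logUb3v_19773]

/-- One level through the moments: for `l ≥ 15.24`, `a ≤ 7`, with `m = l − a·0.6931472 ≥ 0`,
`∑_s k̂/s·(⅛(l − U₃(a,s))² − 8/15) ≥ ⅛(1.469124 m² − 2·2.064141 m + 11.000135) − (8/15)·1.469125`. [folklore] -/
private theorem level_ge3 {l : ℝ} {a : ℕ} (hl : 15.24 ≤ l) (ha : a ≤ 7) :
    (1 / 8) * (1.469124 * (l - a * 0.6931472) ^ 2 - 2 * 2.064141 * (l - a * 0.6931472) + 11.000135)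
        - (8 / 15) * 1.469125
      ≤ ∑ s ∈ kappaSet3, (khat s : ℝ) / s * ((1 / 8) * (l - Ub3 a s) ^ 2 - 8 / 15) := by
  have ha7 : (a : ℝ) ≤ 7 := by exact_mod_cast ha
  set m : ℝ := l - a * 0.6931472 with hm
  have hm0 : 0 ≤ m := by rw [hm]; nlinarith [hl, ha7, Nat.cast_nonneg (α := ℝ) a]
  have hcell : ∀ s ∈ kappaSet3, (khat s : ℝ) / s * ((1 / 8) * (l - Ub3 a s) ^ 2 - 8 / 15)
      = (1 / 8) * m ^ 2 * ((khat s : ℝ) / s) - (1 / 4) * m * ((khat s : ℝ) / s * logUb3 s)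
        + (1 / 8) * ((khat s : ℝ) / s * logUb3 s ^ 2) - (8 / 15) * ((khat s : ℝ) / s) := by
    intro s _
    rw [hm, Ub3]; ring
  rw [sum_congr rfl hcell, sum_sub_distrib, sum_add_distrib, sum_sub_distrib, ← mul_sum, ← mul_sum, ← mul_sum,
    ← mul_sum]
  have h1 := mul_nonneg (sub_nonneg.2 sum_w_ge3) (sq_nonneg m)
  have h2 := mul_nonneg (sub_nonneg.2 sum_wu_le3) hm0
  have h3 := sum_wu2_ge3
  have h4 := sum_w_le3
  nlinarith [h1, h2, h3, h4]

/-- The enlarged κ-refined explicit minorant of `T(X)` (and `Q_∅(X)`) as a function of `l = log X`: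
`0.3658 l² − 1.5193 l + 2.3407` (rounded down from the 8-level moment bound; `0.3658/0.3787 = 0.966` of the truth). [folklore] -/
noncomputable def TlowK3 (l : ℝ) : ℝ := 0.3658 * l ^ 2 - 1.5193 * l + 2.3407

/-- `TlowK3` is below the 8-level moment polynomial. [folklore] -/
private theorem TlowK3_le_levels {l : ℝ} (hl : 15.24 ≤ l) :
    TlowK3 l ≤ ∑ a ∈ range 8, (1 / 2 : ℝ) ^ a *
      ((1 / 8) * (1.469124 * (l - a * 0.6931472) ^ 2 - 2 * 2.064141 * (l - a * 0.6931472) + 11.000135)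
        - (8 / 15) * 1.469125) := by
  norm_num [Finset.sum_range_succ, TlowK3]
  nlinarith [hl, sq_nonneg l]

/-- The cell sum dominates `TlowK3`. [folklore] -/
private theorem TlowK3_le_cells {l : ℝ} (hl : 15.24 ≤ l) :
    TlowK3 l ≤ ∑ a ∈ range 8, (1 / 2 : ℝ) ^ a *
      ∑ s ∈ kappaSet3, (khat s : ℝ) / s * ((1 / 8) * (l - Ub3 a s) ^ 2 - 8 / 15) := by
  refine le_trans (TlowK3_le_levels hl) (sum_le_sum fun a ha => ?_)
  have ha7 : a ≤ 7 := by rw [mem_range] at ha; omega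
  exact mul_le_mul_of_nonneg_left (level_ge3 hl ha7) (by positivity)

/-- **ENLARGED κ-REFINED EXPLICIT TWO-RESIDUE SELBERG SUM** (ROUND-40 «CELLS-2»): for `X ≥ 2^{22}`,
`∑_{n ≤ X} f̃(n) ≥ TlowK3 (log X)`. [cite: BatemanDiamond2004, Lemma 13.11, p. 327 (explicit weaker lower bound proved here)] -/
theorem sum_ft_ge_kappa3 {X : ℕ} (hX : 4194304 ≤ X) :
    TlowK3 (Real.log X) ≤ ∑ n ∈ Icc 1 X, ft n := by
  have hXR : (4194304 : ℝ) ≤ X := by exact_mod_cast hX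
  have hl : 15.24 ≤ Real.log X := by
    have h1 : Real.log ((2 : ℝ) ^ 22) ≤ Real.log X :=
      Real.log_le_log (by positivity) (by norm_num; exact_mod_cast hXR)
    rw [Real.log_pow] at h1
    have h2 := Real.log_two_gt_d9
    push_cast at h1
    linarith
  refine le_trans (TlowK3_le_cells hl) ?_
  refine le_trans ?_ (sum_ft_ge_dyadic X 7)
  refine sum_le_sum fun a ha => ?_
  have ha7 : a ≤ 7 := by rw [mem_range] at ha; omega
  refine mul_le_mul_of_nonneg_left (sum_ft_odd_level_ge_kappa3 ha7 ?_ hl) (by positivity)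
  calc 2 ^ a * 19773 ≤ 2 ^ 7 * 19773 := Nat.mul_le_mul_right _ (Nat.pow_le_pow_right (by norm_num) ha7)
    _ ≤ X := by norm_num; omega

/-- `Q_∅(X) ≥ TlowK3(log X)` for `X ≥ 2^{22}` (chained with `sum_ft_le_Qsum`). [cite: BatemanDiamond2004, Lemma 13.11, p. 327 (explicit weaker lower bound proved here)] -/
theorem Qsum_ge_kappa3 {X : ℕ} (hX : 4194304 ≤ X) : TlowK3 (Real.log X) ≤ Qsum ∅ X := by
  have h := sum_ft_ge_kappa3 hX
  have hI : Ioc 0 X = Icc 1 X := rfl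
  have h2 := sum_ft_le_Qsum X
  rw [hI] at h2
  linarith

/-! ## §11  The harmonic constant (cell parity-ideate p5 ROUND-42 «HARMONIC»): the discarded constant `(γ + log 2)/2 ≥ 0.6351` of the odd harmonic sum

The tree's `Hodd_ge` keeps only `½ log(Y+1)` of `H_odd(Y) = H(Y) − ½ H(⌊Y/2⌋) = ½ log Y + (γ + log 2)/2 + O(1/Y)`,
and its `Dodd_ge` is therefore `⅛ log²y − 8/15`.  Here the constant `(γ + log 2)/2 ≥ 0.6351` is restored from the
tree's second-order Euler–Mascheroni envelopes `H_n − log(n + ½) ≥ γ ≥ H_n − log n − 1/(2n)`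
(`Literature.Analysis.SpecialFunctions.Real.le_upperSeq` / `lowerSeq_le`) and `γ > 0.57721558`
(`eulerMascheroniConstant_gt_d8`): `H_odd(W) ≥ 0.6351 + ½ log(W+1) − 1/(2(W−1))` (`W ≥ 2`), whence
`D_odd(⌊y⌋) ≥ ⅛ log²y + 0.6351 log y − 0.47` (the per-term losses `1/(u⌊Y/u⌋) ≤ 2/(Y+2)` on `u ≤ Y/2` sum to `≤ ½`;
the terms `u > Y/2` are exact since `0.6351 + ½ log 2 < 1 = H_odd(1)`). -/

/-- `∑_{v ∈ [1, W]} 1/v = H(W)` (Mathlib's `harmonic`, cast to `ℝ`). [folklore] -/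
private theorem sum_Icc_inv_eq_harmonic (W : ℕ) :
    ∑ v ∈ Icc 1 W, 1 / (v : ℝ) = (harmonic W : ℝ) := by
  rw [harmonic_eq_sum_Icc]
  push_cast
  exact sum_congr rfl fun v _ => one_div (v : ℝ)

/-- The even part of the harmonic sum: `∑_{v ≤ W, v even} 1/v = ½ H(⌊W/2⌋)`. [folklore] -/
private theorem sum_even_inv_eq (W : ℕ) :
    ∑ v ∈ (Icc 1 W).filter (fun v => ¬ Odd v), 1 / (v : ℝ) = (1 / 2) * (harmonic (W / 2) : ℝ) := by
  have hset : (Icc 1 W).filter (fun v => ¬ Odd v) = (Icc 1 (W / 2)).image (fun m => 2 * m) := by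
    ext v
    simp only [mem_filter, mem_Icc, mem_image, Nat.not_odd_iff_even]
    constructor
    · rintro ⟨⟨h1, h2⟩, ⟨m, hm⟩⟩
      exact ⟨m, ⟨by omega, by omega⟩, by omega⟩
    · rintro ⟨m, ⟨h1, h2⟩, rfl⟩
      exact ⟨⟨by omega, by omega⟩, ⟨m, by omega⟩⟩
  have hinj : ∀ a ∈ Icc 1 (W / 2), ∀ b ∈ Icc 1 (W / 2), 2 * a = 2 * b → a = b :=
    fun a _ b _ h => by omega
  rw [hset, sum_image hinj, ← sum_Icc_inv_eq_harmonic, mul_sum]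
  refine sum_congr rfl fun m _ => ?_
  push_cast
  ring

/-- **`H_odd(W) = H(W) − ½ H(⌊W/2⌋)`** (split `[1, W]` into odd and even `v = 2m`). [folklore] -/
private theorem Hodd_eq_harmonic (W : ℕ) :
    Hodd W = (harmonic W : ℝ) - (1 / 2) * (harmonic (W / 2) : ℝ) := by
  have h := Finset.sum_filter_add_sum_filter_not (Icc 1 W) (fun v => Odd v) (fun v => 1 / (v : ℝ))
  rw [sum_even_inv_eq, sum_Icc_inv_eq_harmonic] at h
  have e : Hodd W = ∑ v ∈ (Icc 1 W).filter (fun v => Odd v), 1 / (v : ℝ) := rfl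
  rw [e]
  linarith

/-- `1 ≤ H_odd(W)` for `W ≥ 1` (the term `v = 1`). [folklore] -/
private theorem one_le_Hodd {W : ℕ} (hW : 1 ≤ W) : 1 ≤ Hodd W := by
  have h1 : (1 : ℕ) ∈ oddIcc W := mem_oddIcc.mpr ⟨le_rfl, hW, odd_one⟩
  have := Finset.single_le_sum (s := oddIcc W) (f := fun v : ℕ => 1 / (v : ℝ)) (fun v _ => by positivity) h1
  simp only [Nat.cast_one, div_one] at this
  exact this

/-- **THE HARMONIC CONSTANT: `H_odd(W) ≥ 0.6351 + ½ log(W+1) − 1/(2(W−1))` for `W ≥ 2`**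
(`H(W) ≥ γ + log(W+½)`, `H(m) ≤ γ + log m + 1/(2m)` at `m = ⌊W/2⌋ ∈ [(W−1)/2, W/2]`, `γ/2 + ½ log 2 ≥ 0.6351`,
`(W+½)² ≥ W(W+1)`). [folklore] -/
private theorem Hodd_ge_sharp {W : ℕ} (hW : 2 ≤ W) :
    0.6351 + (1 / 2) * Real.log ((W : ℝ) + 1) - 1 / (2 * ((W : ℝ) - 1)) ≤ Hodd W := by
  rw [Hodd_eq_harmonic]
  have hm1 : 1 ≤ W / 2 := by omega
  have hWr : (2 : ℝ) ≤ W := by exact_mod_cast hW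
  have hmhi : 2 * ((W / 2 : ℕ) : ℝ) ≤ W := by
    have : 2 * (W / 2) ≤ W := by omega
    exact_mod_cast this
  have hmlo : (W : ℝ) - 1 ≤ 2 * ((W / 2 : ℕ) : ℝ) := by
    have : W ≤ 2 * (W / 2) + 1 := by omega
    have h' : (W : ℝ) ≤ 2 * ((W / 2 : ℕ) : ℝ) + 1 := by exact_mod_cast this
    linarith
  have hm0 : (0 : ℝ) < ((W / 2 : ℕ) : ℝ) := by
    have : (1 : ℝ) ≤ ((W / 2 : ℕ) : ℝ) := by exact_mod_cast hm1
    linarith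
  have hW0 : (0 : ℝ) < W := by linarith
  have hup := Literature.Analysis.SpecialFunctions.Real.le_upperSeq W
  have hlow := Literature.Analysis.SpecialFunctions.Real.lowerSeq_le (W / 2) hm1
  unfold Literature.Analysis.SpecialFunctions.Real.upperSeq at hup
  unfold Literature.Analysis.SpecialFunctions.Real.lowerSeq at hlow
  have hγ := Literature.Analysis.SpecialFunctions.Real.eulerMascheroniConstant_gt_d8
  have hl2 := Real.log_two_gt_d9
  have hlogm : Real.log ((W / 2 : ℕ) : ℝ) ≤ Real.log W - Real.log 2 := by
    have h1 : Real.log (2 * ((W / 2 : ℕ) : ℝ)) ≤ Real.log W := Real.log_le_log (by positivity) hmhi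
    rw [Real.log_mul (by norm_num) hm0.ne'] at h1
    linarith
  have hlogW : Real.log W + Real.log ((W : ℝ) + 1) ≤ 2 * Real.log ((W : ℝ) + 1 / 2) := by
    have e : 2 * Real.log ((W : ℝ) + 1 / 2) = Real.log (((W : ℝ) + 1 / 2) ^ 2) := by
      rw [Real.log_pow]; norm_num
    rw [e, ← Real.log_mul hW0.ne' (by positivity)]
    exact Real.log_le_log (by positivity) (by nlinarith)
  have hinv : 1 / (2 * ((W / 2 : ℕ) : ℝ)) ≤ 1 / ((W : ℝ) - 1) :=
    div_le_div_of_nonneg_left (by norm_num) (by linarith) hmlo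
  have e : 1 / (2 * ((W : ℝ) - 1)) = (1 / 2) * (1 / ((W : ℝ) - 1)) := by
    rw [one_div_mul_one_div]
  rw [e]
  linarith

/-- The number of odd integers in `[1, n]` is `⌊(n+1)/2⌋`. [folklore] -/
private theorem card_oddIcc (n : ℕ) : (oddIcc n).card = (n + 1) / 2 := by
  have hinj : Function.Injective (fun j : ℕ => 2 * j + 1) := fun a b h => by
    have : 2 * a + 1 = 2 * b + 1 := h
    omega
  rw [oddIcc_eq_image, card_image_of_injective _ hinj, card_range]

/-- The odd `u ≤ Y` with `2u ≤ Y` number at most `(Y+2)/4`. [folklore] -/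
private theorem card_odd_half_le (Y : ℕ) :
    ((((oddIcc Y).filter (fun u => 2 * u ≤ Y)).card : ℕ) : ℝ) ≤ ((Y : ℝ) + 2) / 4 := by
  have hsub : (oddIcc Y).filter (fun u => 2 * u ≤ Y) ⊆ oddIcc (Y / 2) := by
    intro u hu
    rw [mem_filter, mem_oddIcc] at hu
    exact mem_oddIcc.mpr ⟨hu.1.1, by omega, hu.1.2.2⟩
  have h1 := card_le_card hsub
  rw [card_oddIcc] at h1
  have h2 : 4 * ((Y / 2 + 1) / 2) ≤ Y + 2 := by omega
  have h3 : 4 * ((oddIcc Y).filter (fun u => 2 * u ≤ Y)).card ≤ Y + 2 :=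
    le_trans (Nat.mul_le_mul_left 4 h1) h2
  have h4 : (4 : ℝ) * ((((oddIcc Y).filter (fun u => 2 * u ≤ Y)).card : ℕ) : ℝ) ≤ (Y : ℝ) + 2 := by
    exact_mod_cast h3
  linarith

/-- Numerical: `1.0984 ≤ log 3` (`log 3 = log 2 + log(1 + 1/5) − log(1 − 1/5)`, two terms of the `artanh`
series at `1/5`). [folklore] -/
private theorem log_three_ge : (1.0984 : ℝ) ≤ Real.log 3 := by
  set x : ℝ := 1 / 5 with hx
  have hs := Real.hasSum_log_sub_log_of_abs_lt_one (x := x) (by rw [hx, abs_of_pos (by norm_num)]; norm_num)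
  have h2 := sum_le_hasSum (Finset.range 2) (fun n _ => by rw [hx]; positivity) hs
  simp only [Finset.sum_range_succ, Finset.sum_range_zero, zero_add] at h2
  have e1 : Real.log (1 + x) - Real.log (1 - x) = Real.log 3 - Real.log 2 := by
    rw [← Real.log_div (by rw [hx]; norm_num) (by rw [hx]; norm_num),
      ← Real.log_div (by norm_num) (by norm_num), hx]
    norm_num
  rw [e1, hx] at h2
  norm_num at h2
  linarith [Real.log_two_gt_d9]

/-- Numerical: `1.5862 ≤ log 5` (`log 5 = 2 log 2 + log(5/4)`, `log(5/4) ≥ 1 − 4/5`). [folklore] -/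
private theorem log_five_ge : (1.5862 : ℝ) ≤ Real.log 5 := by
  have h1 : (1 : ℝ) - (5 / 4 : ℝ)⁻¹ ≤ Real.log (5 / 4) := Real.one_sub_inv_le_log_of_pos (by norm_num)
  have h4 : Real.log 4 = 2 * Real.log 2 := by
    rw [show (4 : ℝ) = 2 ^ 2 by norm_num, Real.log_pow]; norm_num
  have e : Real.log 5 = 2 * Real.log 2 + Real.log (5 / 4) := by
    rw [Real.log_div (by norm_num) (by norm_num), h4]; ring
  rw [e]
  norm_num at h1
  linarith [Real.log_two_gt_d9]

/-- **`U_odd(Y) ≤ ¼ log²Y + 0.065`** (the tree's telescoping `Uodd_le`, now keeping the head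
`log 3/3 + log 5/5 ≤ 0.68819` against `¼ log²3 ≥ 0.3016` / `¼ log²5 ≥ 0.6290` and the foot `g 0 = ¼ log²5` of the
telescope; the tree's constant is `16/15`). [folklore] -/
private theorem Uodd_le_sharp (Y : ℕ) : Uodd Y ≤ (1 / 4) * Real.log Y ^ 2 + 0.065 := by
  unfold Uodd
  rw [sum_oddIcc_eq_sum_range]
  set K := (Y + 1) / 2 with hK
  set F : ℕ → ℝ := fun j => Real.log ((2 * j + 1 : ℕ) : ℝ) / ((2 * j + 1 : ℕ) : ℝ) with hF
  change ∑ j ∈ range K, F j ≤ _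
  have h0 : F 0 = 0 := by simp [hF]
  have h1 : F 1 ≤ 0.36627 := by
    simp only [hF]; norm_num
    have := logb_3
    linarith
  have h2 : F 2 ≤ 0.32192 := by
    simp only [hF]; norm_num
    have := logb_5
    linarith
  have hlogY0 : 0 ≤ Real.log Y := by
    rcases Nat.eq_zero_or_pos Y with hY | hY
    · rw [hY]; simp
    · exact Real.log_nonneg (by exact_mod_cast hY)
  have hhead : ∀ K' ≤ 3, ∑ j ∈ range K', F j ≤ 0.68819 := by
    intro K' hK'
    interval_cases K' <;> simp [Finset.sum_range_succ, h0] <;> linarith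
  by_cases hK1 : K ≤ 1
  · have hs : ∑ j ∈ range K, F j ≤ 0 := by
      have : ∀ K' ≤ 1, ∑ j ∈ range K', F j ≤ 0 := by
        intro K' hK'
        interval_cases K' <;> simp [h0]
      exact this K hK1
    nlinarith [sq_nonneg (Real.log Y)]
  by_cases hK2 : K ≤ 2
  · have hK2' : K = 2 := by omega
    have hY3 : (3 : ℝ) ≤ Y := by
      have : 3 ≤ Y := by omega
      exact_mod_cast this
    have hL3 : 1.0984 ≤ Real.log Y := le_trans log_three_ge (Real.log_le_log (by norm_num) hY3)
    have hs : ∑ j ∈ range K, F j ≤ 0.36627 := by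
      rw [hK2']; simp [Finset.sum_range_succ, h0]; linarith
    nlinarith [hL3, hs]
  by_cases hK3 : K ≤ 3
  · have hK3' : K = 3 := by omega
    have hY5 : (5 : ℝ) ≤ Y := by
      have : 5 ≤ Y := by omega
      exact_mod_cast this
    have hL5 : 1.5862 ≤ Real.log Y := le_trans log_five_ge (Real.log_le_log (by norm_num) hY5)
    have hs := hhead K hK3
    nlinarith [hL5, hs]
  push Not at hK3
  -- split range K = range 3 ∪ Ico 3 K
  have hsplit : ∑ j ∈ range K, F j = ∑ j ∈ range 3, F j + ∑ j ∈ Ico 3 K, F j := by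
    rw [Finset.range_eq_Ico, Finset.range_eq_Ico]
    exact (Finset.sum_Ico_consecutive F (by norm_num : 0 ≤ 3) hK3.le).symm
  rw [hsplit]
  have htail : ∑ j ∈ Ico 3 K, F j ≤ (1 / 4) * Real.log Y ^ 2 - 0.629 := by
    rw [Finset.sum_Ico_eq_sum_range]
    set g : ℕ → ℝ := fun i => (1 / 4) * Real.log (2 * (i : ℝ) + 5) ^ 2 with hg
    have hterm : ∀ i ∈ range (K - 3), F (3 + i) ≤ g (i + 1) - g i := by
      intro i _
      have hu : (7 : ℝ) ≤ ((2 * (3 + i) + 1 : ℕ) : ℝ) := by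
        have : 7 ≤ 2 * (3 + i) + 1 := by omega
        exact_mod_cast this
      have := log_div_le_quarter_diff hu
      simp only [hF, hg]
      have e1 : (2 * ((i + 1 : ℕ) : ℝ) + 5) = ((2 * (3 + i) + 1 : ℕ) : ℝ) := by push_cast; ring
      have e2 : (2 * (i : ℝ) + 5) = ((2 * (3 + i) + 1 : ℕ) : ℝ) - 2 := by push_cast; ring
      rw [e1, e2]
      linarith
    have htel : ∑ i ∈ range (K - 3), (g (i + 1) - g i) = g (K - 3) - g 0 :=
      Finset.sum_range_sub g (K - 3)
    have hg0 : 0.629 ≤ g 0 := by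
      simp only [hg]
      norm_num
      nlinarith [log_five_ge]
    have hgK : g (K - 3) ≤ (1 / 4) * Real.log Y ^ 2 := by
      simp only [hg]
      have h1 : (1 : ℝ) ≤ 2 * ((K - 3 : ℕ) : ℝ) + 5 := by
        have : (0 : ℝ) ≤ ((K - 3 : ℕ) : ℝ) := Nat.cast_nonneg _
        linarith
      have h2 : 2 * ((K - 3 : ℕ) : ℝ) + 5 ≤ (Y : ℝ) := by
        have : 2 * (K - 3) + 5 ≤ Y := by omega
        exact_mod_cast this
      have hl0 : 0 ≤ Real.log (2 * ((K - 3 : ℕ) : ℝ) + 5) := Real.log_nonneg h1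
      have hl : Real.log (2 * ((K - 3 : ℕ) : ℝ) + 5) ≤ Real.log Y :=
        Real.log_le_log (by linarith) h2
      gcongr
    calc ∑ i ∈ range (K - 3), F (3 + i) ≤ ∑ i ∈ range (K - 3), (g (i + 1) - g i) :=
          sum_le_sum hterm
      _ = g (K - 3) - g 0 := htel
      _ ≤ (1 / 4) * Real.log Y ^ 2 - 0.629 := by linarith
  linarith [hhead 3 le_rfl, htail]

/-- Per term of `D_odd`: for odd `u ≤ Y = ⌊y⌋`, `W = ⌊Y/u⌋`,
`(1/u)(0.6351 + ½(log y − log u)) − [2u ≤ Y]·2/(Y+2) ≤ (1/u)·H_odd(W)`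
(`W = 1`: `0.6351 + ½ log 2 < 1 = H_odd(1)`; `W ≥ 2`: `Hodd_ge_sharp`, `y/u < W + 1`, `1/(2(W−1)) ≤ 1/W`,
`uW ≥ Y − u + 1 ≥ (Y+2)/2`). [folklore] -/
private theorem Dodd_term_ge {y : ℝ} (hy : 1 ≤ y) {u : ℕ} (hu : u ∈ oddIcc ⌊y⌋₊) :
    (1 / (u : ℝ)) * (0.6351 + (1 / 2) * (Real.log y - Real.log u))
        - (if 2 * u ≤ ⌊y⌋₊ then 2 / ((⌊y⌋₊ : ℝ) + 2) else 0)
      ≤ (1 / (u : ℝ)) * Hodd (⌊y⌋₊ / u) := by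
  set Y := ⌊y⌋₊ with hYdef
  obtain ⟨hu1, huY, _⟩ := mem_oddIcc.mp hu
  have hy0 : 0 < y := by linarith
  have hu0 : (0 : ℝ) < u := by exact_mod_cast hu1
  have hylt : y < (Y : ℝ) + 1 := Nat.lt_floor_add_one y
  have hyu : Real.log y - Real.log u = Real.log (y / u) := (Real.log_div hy0.ne' hu0.ne').symm
  have hlt : y / u < ((Y / u : ℕ) : ℝ) + 1 := by
    have := Nat.lt_floor_add_one (y / u)
    rwa [Nat.floor_div_natCast] at this
  have hW1 : 1 ≤ Y / u := (Nat.le_div_iff_mul_le hu1).mpr (by simpa using huY)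
  split_ifs with h2
  · -- `W ≥ 2`
    have hW2 : 2 ≤ Y / u := (Nat.le_div_iff_mul_le hu1).mpr h2
    have hW2r : (2 : ℝ) ≤ ((Y / u : ℕ) : ℝ) := by exact_mod_cast hW2
    have hH := Hodd_ge_sharp hW2
    have hlog : Real.log (y / u) ≤ Real.log (((Y / u : ℕ) : ℝ) + 1) :=
      Real.log_le_log (by positivity) hlt.le
    have hWinv : 1 / (2 * (((Y / u : ℕ) : ℝ) - 1)) ≤ 1 / ((Y / u : ℕ) : ℝ) :=
      div_le_div_of_nonneg_left (by norm_num) (by linarith) (by linarith)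
    have huW : (Y : ℝ) - u + 1 ≤ (u : ℝ) * ((Y / u : ℕ) : ℝ) := by
      have h3 := Nat.div_add_mod Y u
      have h4 := Nat.mod_lt Y hu1
      have h5 : Y + 1 ≤ u * (Y / u) + u := by omega
      have h6 : ((Y + 1 : ℕ) : ℝ) ≤ ((u * (Y / u) + u : ℕ) : ℝ) := by exact_mod_cast h5
      push_cast at h6
      linarith
    have h2r : 2 * (u : ℝ) ≤ Y := by exact_mod_cast h2
    have hWpos : (0 : ℝ) < ((Y / u : ℕ) : ℝ) := by linarith
    have hprod : (1 / (u : ℝ)) * (1 / ((Y / u : ℕ) : ℝ)) ≤ 2 / ((Y : ℝ) + 2) := by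
      rw [one_div_mul_one_div, div_le_div_iff₀ (by positivity) (by positivity)]
      linarith
    have hmain : 0.6351 + (1 / 2) * (Real.log y - Real.log u) - 1 / ((Y / u : ℕ) : ℝ) ≤ Hodd (Y / u) := by
      rw [hyu]; linarith
    have hm := mul_le_mul_of_nonneg_left hmain (le_of_lt (one_div_pos.mpr hu0))
    linarith [hm, hprod]
  · -- `W = 1` regime: `y/u < 2`
    have h2' : Y + 1 ≤ 2 * u := by omega
    have hyu2 : y / u < 2 := by
      rw [div_lt_iff₀ hu0]
      have : (Y : ℝ) + 1 ≤ 2 * u := by exact_mod_cast h2'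
      linarith
    have hlog2 : Real.log (y / u) < Real.log 2 := Real.log_lt_log (by positivity) hyu2
    have hl2 := Real.log_two_lt_d9
    have hH := one_le_Hodd hW1
    rw [sub_zero, hyu]
    refine mul_le_mul_of_nonneg_left ?_ (by positivity)
    linarith

/-- **`D_odd(⌊y⌋) ≥ ⅛ log²y + 0.6351 log y − 0.47` for real `y ≥ 1`** (ROUND-42 «HARMONIC»; the tree's `Dodd_ge`
gives `⅛ log²y − 8/15`; the truth is `⅛ log²y + 0.6352 log y + 0.52 + o(1)`). [folklore] -/
private theorem Dodd_ge_sharp {y : ℝ} (hy : 1 ≤ y) :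
    (1 / 8) * Real.log y ^ 2 + 0.6351 * Real.log y - 0.47 ≤ Dodd ⌊y⌋₊ := by
  set Y := ⌊y⌋₊ with hYdef
  have hy0 : 0 < y := by linarith
  have hY1 : 1 ≤ Y := Nat.le_floor (by simpa using hy)
  have hL0 : 0 ≤ Real.log y := Real.log_nonneg hy
  have hylt : y < (Y : ℝ) + 1 := Nat.lt_floor_add_one y
  have hYy : (Y : ℝ) ≤ y := Nat.floor_le hy0.le
  -- `D_odd(Y) ≥ H_odd(Y) ≥ 1` (the term `u = 1`)
  have hD1 : 1 ≤ Dodd Y := by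
    have h1 : (1 : ℕ) ∈ oddIcc Y := mem_oddIcc.mpr ⟨le_rfl, hY1, odd_one⟩
    have := Finset.single_le_sum (s := oddIcc Y) (f := fun u : ℕ => (1 / (u : ℝ)) * Hodd (Y / u))
      (fun u _ => mul_nonneg (by positivity) (Hodd_nonneg _)) h1
    simp only [Nat.cast_one, div_one, one_mul, Nat.div_one] at this
    exact le_trans (one_le_Hodd hY1) this
  by_cases hY3 : Y < 3
  · -- `y < 3`: `⅛ log²y + 0.6351 log y − 0.47 < 1 ≤ D_odd`
    have hy3 : y ≤ 3 := by
      have : (Y : ℝ) + 1 ≤ 3 := by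
        have : Y + 1 ≤ 3 := by omega
        exact_mod_cast this
      linarith
    have hL3 : Real.log y ≤ 1.0988 := le_trans (Real.log_le_log hy0 hy3) logb_3
    nlinarith [hD1, hL0, hL3]
  push Not at hY3
  have hY3r : (3 : ℝ) ≤ Y := by exact_mod_cast hY3
  -- steps 1–2: the per-term bounds summed
  have hsum : ∑ u ∈ oddIcc Y, ((1 / (u : ℝ)) * (0.6351 + (1 / 2) * (Real.log y - Real.log u))
      - (if 2 * u ≤ Y then 2 / ((Y : ℝ) + 2) else 0)) ≤ Dodd Y := by
    unfold Dodd
    exact sum_le_sum fun u hu => Dodd_term_ge hy hu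
  have hY2 : (Y : ℝ) + 2 ≠ 0 := by positivity
  have herr : ∑ u ∈ oddIcc Y, (if 2 * u ≤ Y then 2 / ((Y : ℝ) + 2) else (0 : ℝ)) ≤ 1 / 2 := by
    rw [← sum_filter, sum_const, nsmul_eq_mul]
    have hc := card_odd_half_le Y
    calc ((((oddIcc Y).filter (fun u => 2 * u ≤ Y)).card : ℕ) : ℝ) * (2 / ((Y : ℝ) + 2))
        ≤ ((Y : ℝ) + 2) / 4 * (2 / ((Y : ℝ) + 2)) := mul_le_mul_of_nonneg_right hc (by positivity)
      _ = 1 / 2 := by field_simp; ring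
  have hmain : ∑ u ∈ oddIcc Y, (1 / (u : ℝ)) * (0.6351 + (1 / 2) * (Real.log y - Real.log u))
      = (0.6351 + (1 / 2) * Real.log y) * Hodd Y - (1 / 2) * Uodd Y := by
    unfold Hodd Uodd
    rw [mul_sum, mul_sum, ← sum_sub_distrib]
    refine sum_congr rfl fun u _ => ?_
    ring
  have h4 : (0.6351 + (1 / 2) * Real.log y) * Hodd Y - (1 / 2) * Uodd Y - 1 / 2 ≤ Dodd Y := by
    rw [sum_sub_distrib, hmain] at hsum
    linarith
  -- step 3: `H_odd(Y)`, `U_odd(Y)`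
  have hH : 0.6351 + (1 / 2) * Real.log y - 1 / (2 * ((Y : ℝ) - 1)) ≤ Hodd Y := by
    have h := Hodd_ge_sharp (W := Y) (by omega)
    have : Real.log y ≤ Real.log ((Y : ℝ) + 1) := Real.log_le_log hy0 hylt.le
    linarith
  have hU : Uodd Y ≤ (1 / 4) * Real.log y ^ 2 + 0.065 := by
    refine le_trans (Uodd_le_sharp Y) ?_
    have hY0 : (1 : ℝ) ≤ Y := by linarith
    have hlY : Real.log Y ≤ Real.log y := Real.log_le_log (by linarith) hYy
    have hlY0 : 0 ≤ Real.log Y := Real.log_nonneg hY0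
    nlinarith
  -- the correction `(0.6351 + ½ log y)/(2(Y−1)) ≤ 0.3322`
  have hB0 : 0 ≤ 1 / (2 * ((Y : ℝ) - 1)) := div_nonneg (by norm_num) (by linarith)
  have hB4 : 1 / (2 * ((Y : ℝ) - 1)) ≤ 1 / 4 :=
    div_le_div_of_nonneg_left (by norm_num) (by norm_num) (by linarith)
  have hl4 : Real.log 4 = 2 * Real.log 2 := by
    rw [show (4 : ℝ) = 2 ^ 2 by norm_num, Real.log_pow]; norm_num
  have hlog4 : Real.log ((Y : ℝ) + 1) ≤ ((Y : ℝ) + 1) / 4 + 0.3863 := by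
    have h1 : Real.log (((Y : ℝ) + 1) / 4) ≤ ((Y : ℝ) + 1) / 4 - 1 :=
      Real.log_le_sub_one_of_pos (by positivity)
    rw [Real.log_div (by positivity) (by norm_num), hl4] at h1
    have := Real.log_two_lt_d9
    linarith
  have hLB : Real.log y * (1 / (2 * ((Y : ℝ) - 1))) ≤ 0.3468 := by
    have hL1 : Real.log y ≤ Real.log ((Y : ℝ) + 1) := Real.log_le_log hy0 hylt.le
    have h2 : Real.log ((Y : ℝ) + 1) * (1 / (2 * ((Y : ℝ) - 1))) ≤ 0.3468 := by
      rw [mul_one_div, div_le_iff₀ (by linarith)]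
      linarith
    exact le_trans (mul_le_mul_of_nonneg_right hL1 hB0) h2
  -- final assembly
  have hP := mul_le_mul_of_nonneg_left hH (show (0 : ℝ) ≤ 0.6351 + (1 / 2) * Real.log y by linarith)
  linarith [hP, h4, hU, hLB, hB4, hB0, hL0]

/-! ### §11b  κ-refinement IV (cell parity-ideate p5 ROUND-42 «HARMONIC»): the 68 cells read through the sharpened divisor-sum minorant — `TlowK4`

ONE input varied relative to ROUND-40's `TlowK3`: the cell minorant `⅛(l − U)² − 8/15` (from the tree's `Dodd_ge`)
↦ `⅛(l − U)² + 0.6351(l − U) − 0.47` (from `Dodd_ge_sharp`, §B).  Same 68 cells `kappaSet3`, same 8 dyadic levels,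
same three moments `∑ k̂/s ∈ [1.469124, 1.469125]`, `∑ (k̂/s)·logUb3 ≤ 2.064141`, `∑ (k̂/s)·logUb3² ≥ 11.000135`;
the level polynomial gains the linear term `0.6351·(1.469124 m − 2.064141)`, and the 8-level sum rounds down to
`TlowK4(l) = 0.3658 l² + 0.3394 l − 1.3336` (vs `TlowK3(l) = 0.3658 l² − 1.5193 l + 2.3407`: `+32.7` percent at
`l = 17.6`, `+10` percent at `l = 52`, `+2.9` percent at `l = 179`). -/

/-- One `(a, s)` cell with the sharpened minorant: for `2^a s ≤ X` and `log X ≥ U(a,s)`,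
`k̂(s)/s·(⅛(log X − U)² + 0.6351(log X − U) − 0.47) ≤ k̂(s)/s · D_odd(X/2^a/s)`. [folklore] -/
private theorem kappa_cell_ge4 {X a s : ℕ} (hs : s ∈ kappaSet3) (hX : 2 ^ a * s ≤ X) (hl : Ub3 a s ≤ Real.log X) :
    (khat s : ℝ) / s * ((1 / 8) * (Real.log X - Ub3 a s) ^ 2 + 0.6351 * (Real.log X - Ub3 a s) - 0.47)
      ≤ (khat s : ℝ) / s * Dodd (X / 2 ^ a / s) := by
  have hs1 : 1 ≤ s := (kappaSet3_odd s hs).pos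
  have hsR : (0 : ℝ) < s := by exact_mod_cast hs1
  have hX0 : (0 : ℝ) < X := by
    have : 0 < X := lt_of_lt_of_le (Nat.mul_pos (by positivity) hs1) hX
    exact_mod_cast this
  refine mul_le_mul_of_nonneg_left ?_ (by positivity)
  have hy : (1 : ℝ) ≤ (X : ℝ) / ((2 : ℝ) ^ a * s) := by
    rw [le_div_iff₀ (by positivity), one_mul]
    exact_mod_cast hX
  have h := Dodd_ge_sharp hy
  have hfloor : ⌊(X : ℝ) / ((2 : ℝ) ^ a * s)⌋₊ = X / 2 ^ a / s := by
    rw [show ((2 : ℝ) ^ a * s) = ((2 ^ a * s : ℕ) : ℝ) by push_cast; ring, Nat.floor_div_eq_div,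
      Nat.div_div_eq_div_mul]
  have hlog : Real.log ((X : ℝ) / ((2 : ℝ) ^ a * s)) = Real.log X - a * Real.log 2 - Real.log s := by
    rw [Real.log_div hX0.ne' (by positivity), Real.log_mul (by positivity) hsR.ne', Real.log_pow]
    ring
  rw [hfloor, hlog] at h
  refine le_trans ?_ h
  have hU : (a : ℝ) * Real.log 2 + Real.log s ≤ Ub3 a s := by
    unfold Ub3
    have h2 : Real.log 2 ≤ 0.6931472 := by linarith [Real.log_two_lt_d9]
    have := log_le_logUb3 s hs
    nlinarith [h2, this, Nat.cast_nonneg (α := ℝ) a]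
  have h0 : 0 ≤ Real.log X - Ub3 a s := by linarith
  have hle : Real.log X - Ub3 a s ≤ Real.log X - a * Real.log 2 - Real.log s := by linarith
  have hsq : (Real.log X - Ub3 a s) ^ 2 ≤ (Real.log X - a * Real.log 2 - Real.log s) ^ 2 :=
    pow_le_pow_left₀ h0 hle 2
  linarith

/-- One dyadic level with the sharpened minorant: for `2^a·19773 ≤ X` and `log X ≥ 15.24`,
`∑_{s ∈ kappaSet3} k̂(s)/s·(⅛(log X − U)² + 0.6351(log X − U) − 0.47) ≤ ∑_{m ≤ X/2^a odd} f̃(m)`. [folklore] -/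
private theorem sum_ft_odd_level_ge_kappa4 {X a : ℕ} (ha : a ≤ 7) (hX : 2 ^ a * 19773 ≤ X)
    (hl : 15.24 ≤ Real.log X) :
    ∑ s ∈ kappaSet3, (khat s : ℝ) / s *
        ((1 / 8) * (Real.log X - Ub3 a s) ^ 2 + 0.6351 * (Real.log X - Ub3 a s) - 0.47)
      ≤ ∑ m ∈ oddIcc (X / 2 ^ a), ft m := by
  refine le_trans ?_ (sum_khat_Dodd_le_sum_ft kappaSet3 kappaSet3_odd (X / 2 ^ a))
  refine sum_le_sum fun s hs => kappa_cell_ge4 hs ?_ ?_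
  · exact le_trans (Nat.mul_le_mul_left _ (kappaSet3_le s hs)) hX
  · have ha7 : (a : ℝ) ≤ 7 := by exact_mod_cast ha
    have := logUb3_le s hs
    unfold Ub3
    nlinarith [this, ha7, Nat.cast_nonneg (α := ℝ) a]

/-- One level through the moments (sharpened minorant): for `l ≥ 15.24`, `a ≤ 7`, with `m = l − a·0.6931472 ≥ 0`,
`∑_s k̂/s·(⅛(l − U₃)² + 0.6351(l − U₃) − 0.47)
  ≥ ⅛(1.469124 m² − 2·2.064141 m + 11.000135) + 0.6351(1.469124 m − 2.064141) − 0.47·1.469125`. [folklore] -/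
private theorem level_ge4 {l : ℝ} {a : ℕ} (hl : 15.24 ≤ l) (ha : a ≤ 7) :
    (1 / 8) * (1.469124 * (l - a * 0.6931472) ^ 2 - 2 * 2.064141 * (l - a * 0.6931472) + 11.000135)
        + 0.6351 * (1.469124 * (l - a * 0.6931472) - 2.064141) - 0.47 * 1.469125
      ≤ ∑ s ∈ kappaSet3, (khat s : ℝ) / s *
          ((1 / 8) * (l - Ub3 a s) ^ 2 + 0.6351 * (l - Ub3 a s) - 0.47) := by
  have ha7 : (a : ℝ) ≤ 7 := by exact_mod_cast ha
  set m : ℝ := l - a * 0.6931472 with hm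
  have hm0 : 0 ≤ m := by rw [hm]; nlinarith [hl, ha7, Nat.cast_nonneg (α := ℝ) a]
  have hcell : ∀ s ∈ kappaSet3, (khat s : ℝ) / s *
        ((1 / 8) * (l - Ub3 a s) ^ 2 + 0.6351 * (l - Ub3 a s) - 0.47)
      = (1 / 8) * m ^ 2 * ((khat s : ℝ) / s) - (1 / 4) * m * ((khat s : ℝ) / s * logUb3 s)
        + (1 / 8) * ((khat s : ℝ) / s * logUb3 s ^ 2) + 0.6351 * m * ((khat s : ℝ) / s)
        - 0.6351 * ((khat s : ℝ) / s * logUb3 s) - 0.47 * ((khat s : ℝ) / s) := by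
    intro s _
    rw [hm, Ub3]; ring
  rw [sum_congr rfl hcell, sum_sub_distrib, sum_sub_distrib, sum_add_distrib, sum_add_distrib, sum_sub_distrib,
    ← mul_sum, ← mul_sum, ← mul_sum, ← mul_sum, ← mul_sum, ← mul_sum]
  have h1 := mul_nonneg (sub_nonneg.2 sum_w_ge3) (sq_nonneg m)
  have h2 := mul_nonneg (sub_nonneg.2 sum_wu_le3) hm0
  have h3 := sum_wu2_ge3
  have h4 := sum_w_le3
  have h5 := mul_nonneg (sub_nonneg.2 sum_w_ge3) hm0
  have h6 := sum_wu_le3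
  nlinarith [h1, h2, h3, h4, h5, h6]

/-- **The sharpened 68-cell polynomial `TlowK4(l) = 0.3658 l² + 0.3394 l − 1.3336`** (ROUND-42 «HARMONIC»; rounded down
from the 8-level moment bound; ROUND-40's `TlowK3 = 0.3658 l² − 1.5193 l + 2.3407`). [folklore] -/
noncomputable def TlowK4 (l : ℝ) : ℝ := 0.3658 * l ^ 2 + 0.3394 * l - 1.3336

/-- `TlowK4` is below the 8-level moment polynomial. [folklore] -/
private theorem TlowK4_le_levels {l : ℝ} (hl : 15.24 ≤ l) :
    TlowK4 l ≤ ∑ a ∈ range 8, (1 / 2 : ℝ) ^ a *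
      ((1 / 8) * (1.469124 * (l - a * 0.6931472) ^ 2 - 2 * 2.064141 * (l - a * 0.6931472) + 11.000135)
        + 0.6351 * (1.469124 * (l - a * 0.6931472) - 2.064141) - 0.47 * 1.469125) := by
  norm_num [Finset.sum_range_succ, TlowK4]
  nlinarith [hl, sq_nonneg l]

/-- The cell sum dominates `TlowK4`. [folklore] -/
private theorem TlowK4_le_cells {l : ℝ} (hl : 15.24 ≤ l) :
    TlowK4 l ≤ ∑ a ∈ range 8, (1 / 2 : ℝ) ^ a *
      ∑ s ∈ kappaSet3, (khat s : ℝ) / s * ((1 / 8) * (l - Ub3 a s) ^ 2 + 0.6351 * (l - Ub3 a s) - 0.47) := by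
  refine le_trans (TlowK4_le_levels hl) (sum_le_sum fun a ha => ?_)
  have ha7 : a ≤ 7 := by rw [mem_range] at ha; omega
  exact mul_le_mul_of_nonneg_left (level_ge4 hl ha7) (by positivity)

/-- **THE SHARPENED κ-REFINED EXPLICIT TWO-RESIDUE SELBERG SUM** (ROUND-42 «HARMONIC»): for `X ≥ 2^{22}`,
`∑_{n ≤ X} f̃(n) ≥ TlowK4 (log X)`. [cite: BatemanDiamond2004, Lemma 13.11, p. 327 (explicit weaker lower bound proved here)] -/
theorem sum_ft_ge_kappa4 {X : ℕ} (hX : 4194304 ≤ X) :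
    TlowK4 (Real.log X) ≤ ∑ n ∈ Icc 1 X, ft n := by
  have hXR : (4194304 : ℝ) ≤ X := by exact_mod_cast hX
  have hl : 15.24 ≤ Real.log X := by
    have h1 : Real.log ((2 : ℝ) ^ 22) ≤ Real.log X :=
      Real.log_le_log (by positivity) (by norm_num; exact_mod_cast hXR)
    rw [Real.log_pow] at h1
    have h2 := Real.log_two_gt_d9
    push_cast at h1
    linarith
  refine le_trans (TlowK4_le_cells hl) ?_
  refine le_trans ?_ (sum_ft_ge_dyadic X 7)
  refine sum_le_sum fun a ha => ?_
  have ha7 : a ≤ 7 := by rw [mem_range] at ha; omega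
  refine mul_le_mul_of_nonneg_left (sum_ft_odd_level_ge_kappa4 ha7 ?_ hl) (by positivity)
  calc 2 ^ a * 19773 ≤ 2 ^ 7 * 19773 := Nat.mul_le_mul_right _ (Nat.pow_le_pow_right (by norm_num) ha7)
    _ ≤ X := by norm_num; omega

/-- **`Q_∅(X) ≥ TlowK4(log X)` for `X ≥ 2^{22}`** (chained with `sum_ft_le_Qsum`).
[cite: BatemanDiamond2004, Lemma 13.11, p. 327 (explicit weaker lower bound proved here)] -/
theorem Qsum_ge_kappa4 {X : ℕ} (hX : 4194304 ≤ X) : TlowK4 (Real.log X) ≤ Qsum ∅ X := by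
  have h := sum_ft_ge_kappa4 hX
  have hI : Ioc 0 X = Icc 1 X := rfl
  have h2 := sum_ft_le_Qsum X
  rw [hI] at h2
  linarith


end TwoResidueSelbergExplicit

end Literature.NumberTheory.Sieve
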